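import Summits.QuantumFields.YangMills.Theorems.BalabanUVNodesN24K1R9ByNameOfOpenStubsGridGChildrenSplitSlot8Thm1AEPosN09T5AtGaussPinPrintedZBY
import Summits.QuantumFields.YangMills.Theorems.BalabanUVNodesN24K1R9ByNameSlot8Thm1AEInstPerKappaPrimeGuarded
import Summits.QuantumFields.YangMills.Theorems.BalabanUVNodesN05SubBP2DK2PerKappaSlotExistsOfBindersLettersPerDoorL
import Literature.MathematicalPhysics.QuantumFieldTheory.Balaban1983to89.B9Thm33BindersUniformZdPerNestedEta
import Literature.MathematicalPhysics.QuantumFieldTheory.Balaban1983to89.Node00.Record12NumericsFamilyFiniteDim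
import Summits.QuantumFields.YangMills.Theorems.BalabanUVNodesN06AtOpsYNuOfRecordV6EPairVQ
import Literature.MathematicalPhysics.QuantumFieldTheory.Balaban1983to89.B9SectionCarryingMembersV1
import Literature.MathematicalPhysics.QuantumFieldTheory.Balaban1983to89.Node00.CarriersZSectE
import Summits.QuantumFields.YangMills.Theorems.BalabanUVNodesN08AlphaEq324RowACReMassedZSlot
import Literature.MathematicalPhysics.QuantumFieldTheory.Balaban1983to89.Node00.Record12NumericsFamilyTraceState
import Summits.QuantumFields.YangMills.Theorems.BalabanUVNodesK0V22ZDefs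

/-!
# NODE N24 (B2) — THE K1 FACE AT V22-Z's Z3 MEMBER, EDITION «N09T5» (engine = ✓«N09T3» p726416 with the consumed door's label `ε₀ := a₀`, ym-nodeO DEF-1 g30 LOCATED-EPS0-LABEL, and the per-door display PINNED to that door by `hε₀ρ : ε₀ = a₀`), INSTANTIATION (α5) (the N06 pin over the SECTION-CARRYING = surjective-β sub-family of members, `ιB hι` CONSTRUCTED by dag-n06-c's carrier `SCMemberY`), RE-KEYED FROM N06's CERTIFICATE EDITION «UD» (the (α5) faces p737119 at «UD», p740270 at «UJ», p745609 at «UN», p750549 at «UT» #10992, p755614 at «UT» over the engine «N09T5» #11026 (■ BATCH 68), p759737 at «VD» #11108, p763064 at «VH» #11173, p765906 at «VL» #11256, p768254 at «VO» = the K1 FACE OF RECORD #11396 since 2026-08-30 09:57Z, chair lead g35) TO ITS SUCCESSOR EDITION «VQ» (JUNCTION «J9T» + a₀-SHRINK + DOOR CEILING GUARD + K0⁷ = THE TWO REGISTERED V22-Z STUBS BY NAME, the door's threshold chosen inside the engine): the face `…N24K1FaceTrN06PCN07N08JunctionLSlot8KappaPrimeAtGaussPinPrintedZBY` lineage (p717662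 → p719388 → N09T∕N09T2 faces p720099 ∕ p724237), RE-KEYED TO N06's CERTIFICATE EDITION «VQ», with
# NODE N09's THEOREM-3 DOOR READ THROUGH N09's OWN EIGHT STRUCTURAL INPUT ROWS; K0⁷ DISPLAYED AS EXACTLY THE TWO REGISTERED STUBS BY NAME (`Prop8StepCoPGridGAt`, `AbsBetaBoxAtThm1WitnessCCMGenGridGZAt`) (`hN09T`, displayed per door) instead of its conclusion `h09T` — over the «N09T3» engine `…Thm1AEPosN09T3AtGaussPinPrintedZBY` (edition of p723546: K0⁷ = EXACTLY the two REGISTERED V22-Z stubs BY NAME on DEF-1's `K0V22ZDefs` §1; the door's small-field threshold CHOSEN `ε₀ := 2a₀∕L²` (door v1.2's third numerics row with equality; the N09-friendliest label — FLAG №7's reg8 road then reads `B₃^{N07} ≤ L²∕2`) and the registered box read at that label through DEF-1 g29's ε₀-blindness reader `K0ZBWitnessBetaEps0.forall_eps0_absBox_of_GZAt`; the two L-only numerics rows PROVED at a SHRUNK ceiling), which feeds dag-n09-w2's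
# `thm3Member_forall_stage13SepCoPH_onDomains_of_axialOn_of_reg8_of_suppPt` BY NAME with the ⚑EPSBG letter `hle : θ.ν.εreg ≤ θ.εbg` PROVED `le_rfl`; K1⁹ `StabilityBRunRowsAtRecordR13SepCoPHV` (stmt-QuantumFields-27364) BY ITS ROUTE NAME

EDITION (α5) AT N06's EDITION «VQ» (THIS FILE = the K1 FACE OF RECORD #11396 ✓p768254 `…N24K1FaceTrN06VOSCN07N08N09T5JunctionLSlot8KappaPrimeAtGaussPinPrintedZBY` — VO-keyed, over the engine «N09T5» #11022 ✓p755526 with the door-pinned per-door display; referee dag-ref-H g35 READ-615 PASS · NON-VACUITY 18∕18 · 0 NIT-blocking, chair lead g35 ■ #11396 2026-08-30 09:57Z; lineage: the (α5) face of record p737119 at «UD» (FLAG №8′ CLOSED OF RECORD on it, director-ym №302∕№303, dag-ref-H g33 V-591∕V-592, chair T-300″) re-keyed «UJ» p740270 → «UN» p745609 → «UT» p750549 (#10992, ■ BATCH 66) → over «N09T5» p755614 (#11026, ■ BATCH 68) → «VD» p759737 (#11108, ■ BATCH 73) → «VH» p763064 (#11173, ■ BATCH 76) → «VL» p765906 (#11256)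 → «VO» p768254 (#11396) — with the N06 certificate read from edition «VQ» instead of «VO»; the instantiation (α5), the engine «N09T5», the door pins and every other slot UNCHANGED).  HISTORY OF THE INSTANTIATION: FLAG №8 was RE-OPENED AT THE (α4) FACE ONLY — chair lead g30 T-299⁺ 2026-08-29 17:36Z, YM-PLAN v0.13.34 row 06; referee dag-ref-H g33 VERDICT 587 RE-LABELLED + INSTANTIATION VERDICT «LOCATED-19: YES»; kernel witness dag-n06-c g18 `B9BetaNotchMemberV1.not_exists_sections_memberY` p735619).  At (α4) (`J := MemberY …`, `f := id`; face `…N24K1FaceTrN06UDN07N08N09T3JunctionLSlot8KappaPrimeAtGaussPinPrintedZBY` p731579) the displayed pair `(ιB F) (hι F)` asked a RIGHT INVERSE of `β` at EVERY member of the record, and the tree's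
index set `MemberY` contains «notch» members whose `β` is not onto ([Balaban1984PropagatorsII] (2.3) p.224, (2.45) p.231 as typed): that pair is UNSATISFIABLE for every `F`, so the (α4) face was VACUOUS at
its l.253 (A3).  HERE the certificate's free index `{J : Type} (f : J → MemberY …)` is instantiated at the SURJECTIVE-β SUB-FAMILY — `J := {x : MemberY (stage3OfFamily F).d₆ … (Mstar F) // Function.Surjective (β x.toKIdx.hN x.toKIdx.D x.toKIdx.hk)}`, `f := Subtype.val` — and the pair is CONSTRUCTED (Mathlib), not displayed: `ιB := fun j => Function.surjInv j.2`,
`hι := fun j s => Function.surjInv_eq j.2 s` (dag-n06-c g18's published cure, 2026-08-29 17:33Z).  The three remaining `J`-indexed rows `C38 hunitA hnbrB` are displayed over that sub-family (`j.1` = the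
member; at editions from «UF» on only `C38` is left of them — `hunitA` is SUPPLIED inside the certificate by dag-n06-c∕dag-n06-j, `hnbrB` likewise gone); the certificate's own member-indexed `∀ x : MemberY …` rows are ITS text (edition «UD») and stay verbatim.  The sub-family is NON-EMPTY at every `M⋆` — a constant-level member (one empty top
level) has `β` onto: `B8Thm2TorusMemberCatalogue.surjective_beta_of_constLev` ∕ `exists_constLev_member`, packaged as a `MemberY` by dag-n06-c's carrier `B9SectionCarryingMembersV1`
(`exists_member_surjective_beta`, `SCMemberY.nonempty`; its `SCMemberY` IS this subtype) — CITED, not re-proved: no binder of this face needs it.  HONEST SCOPE of the N06 pin after (α5): the leaf is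
certified over the section-carrying members ONLY (node00-def-Y g28: the coded carrier's design intends the whole member type — this is NARROWER and says so); N06 NOT discharged; the engine's `∃ Y₀`
socket stays junk-inhabitable (no N06 → K1 credit); 365 displayed N06 binders = «VQ»'s 367 (as Skolemised here) minus `ιB hι`.  STATEMENT DELTA w.r.t. the K1 face of record #11396 ✓p768254 = the N06 display re-keyed «VO» → «VQ» ONLY (instantiation (α5), engine «N09T5» ✓p755526 by import, the five door-pinned per-door families `h09 hN09T h11N h13pos hrowsR`, the N07∕N08∕N10∕N13-`hEfl`∕K0 slots and the conclusion BY NAME untouched; w.r.t. the previous face of record #11256 ✓p765906 (VL-keyed) = that delta + the N06-display delta «VL» → «VO» (GONE 3 `θ₂ hθ₂ hD2sup` · NEW 9 `ρG hρG hρGP hρGK κC δC2 hκC hgap hC2`)). W.r.t. #11396 binder by binder: GONE 3 `𝔠 h𝔠real h36` · NEW 5 `Bc hBc hM₀N hB₀ge h36b` + the instance binder `[∀ x, Fintype (geoBY x).Site]` (Skolemised `instN06_3`; the later `instN06_k` indices shift by one, types unchanged) · RETYPED 2 `h𝔯` (re-pinned to `resYOfRecordP`) and `hC2` (the form of record `(c2YOfRecord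 … x).form`).

TRACK A (YM-PLAN §2d, node N24 of 28 = binder B2), seat `pub-ymgap-dag-n24-c` (R134 s2; gen 20, INTENT-99).  Summits lane; count-neutral.  [4] = [Balaban1985BackgroundPropagators]; [B8] = [Balaban1985RegularSpaces];
[V] = [Balaban1989LargeFieldII]; [III] = [Balaban1988Convergent]; [I] = [Balaban1987RG1]; [B11] = [Balaban1985Variational].

WHAT THE FACE IS (generators `genLface.py` ∕ `genTr.py` ∕ `pinEd2.py` ∕ `genJ9T.py` ∕ `genJ9T3.py` ∕ `guardDoors.py` ∕ `genJ9T4.py` ∕ `edNamesHeader.py` ∕ `instJ.py` ∕ `alphaSC.py` ∕ `faceOverT5.py` ∕ `pinEps0.py` ∕ `hdrT5pin.py` ∕ `hdrVB.py` ∕ `pruneOpens.py` (driver `rekeyFaceT5.sh`), HOME `pub-ymgap-dag-n24-c/lean/g1[6-9]-PRESTAGE/gen`; one pass per N06 edition).  ONE theorem = ONE `refine` of the engine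
`…N24K1R9ByNameOfOpenStubsGridGChildrenSplitSlot8Thm1AEPosN09T5AtGaussPinPrintedZBY` §2 — the K1 engine at the Z3 member `εbg := a₀`: K0⁷'s two REGISTERED V22-Z stubs displayed BY NAME
(ym-nodeO DEF-1 `K0V22ZDefs` §1: `h1G3 : ∀ F, Prop8StepCoPGridGAt F` = REGISTERED 1-G‴; `h3 : ∀ F, AbsBetaBoxAtThm1WitnessCCMGenGridGZAt F` = REGISTERED 3ᴬ′-G‴-Z; the LOCATED-K0ε₀ letter met WITH EQUALITY at the engine's chosen threshold `ε₀ := 2a₀∕L²` via DEF-1 g29's ε₀-blindness reader — edition «N09T3»); every per-door child row keyed at the Gauss pin `θᴳᶻᴮ(π) := gaussPinH (Stage13HParams.ofHistoryBlind F 2 ⟨θZB(π), ZrOfRecord₁₃ F 2 θZB(π)⟩)`,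
`θZB(π) := theta13OfThm1CCMWZB F 2 j γ a₀ ε₀ ε₂₉ B₃ B₃' a₀ a₁ (Efl F j γ …) (fun p i => log z(gOfRecord₁₃ F 2 θZB(0) p i ^ 2, ε))` ([I] (0.15), read along the Z3 member's own history); N13's level 0 consumed
inside — with FOUR child slots FED BY NAME and their suppliers' hypotheses DISPLAYED:
* NODE N06 — dag-n06-d's Stage-11 certificate **edition 115 «VQ»** `N06AtOpsYNuOfRecordV6EPairVQ.b9LeafXUR_opsYNuOfRecordV6E_pairVQ` (dag-n06-d g23, p768667, filed 2026-08-30 10:14Z; R-generic, print-literal twin = «VR»; n06-d FILED-2 I.18108; VO booked #11259 = N06 TOP PAIR OF RECORD with «VP» #11260, witness T #11258).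
  LINEAGE: «VQ» = edition 113 «VO» (p766018, #11259) with (i) rows 18's `Local342 (opsWalkY …)` record letter `h36` DERIVED inside the certificate from ONE displayed BLOCK-KEYED table hypothesis `h36b` (dag-n06-c PLAN (γ′)
  h0–h3 at the record's letters, kernels `Bc·len^{2,1,1,0}·e^{−p.δ₀d}` on `toB6 (geoBY x) 1 (H x)`, ALL members) by dag-n06-c's `B9BlockKeyTransferXSK.local342_opsWalkY_of_blocks` p767820 ∘ node00-def-Y's dictionary
  `dist_beta_blkSK_sIK_bIYOfRecord_le_one ∕ len_blkSK_sIK_bIYOfRecord_eq` p766905 ∘ dag-n06-d's count `B9GeoNbrCountBlocksY.hnbrBY_real_of_le` p768083 (`local342_mono_const … hB₀ge`), and (ii) the C⁽²⁾ DATUM PINNED to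
  node00-def-Y's record `c2YOfRecord` p767959: `𝔠 h𝔠real h36` GONE, NEW `Bc hBc hM₀N hB₀ge h36b` (+ instance `[∀ x, Fintype (geoBY x).Site]`), `h𝔯` RE-PINNED to `resYOfRecordP N θ.toStage3Params Mstar`, `hC2` RETYPED to the
  form of record `(c2YOfRecord … x).form`; 353 → 355 explicit; witness `…N06NumericsWitnessU.numerics_inhabited_ed115` p768668 (= T + `Bc := 0`, `nbrM₀BY … 1 ≤ M⋆`); [B9]∕[5] letter-schemas 15 (`h348; h36b h36H hopI;
  h36A hGsqA h36HA h36A2 hopIA; hC2 hZ; h14₁ h14₂ hexp14; hE`); «VO» = edition 111 «VL» (p763822, #11196) with the Δ⁽²⁾ LETTER (3.137) `hD2sup` DERIVED inside the certificate (dag-n06-l CUT 1 `d2sup_prechain_v2_of_pins` p764766 inside dag-n06-d's LANDED-9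
  `…N06Level13D2LayerAtPinsPUW.level13_d2_layer_of_pinsP_geo9Y` p765741; `g0_core…` p764348, `formSmall_identities_of_stepL2` p764426, `blockBd_tpi_of_letter_schemasR`, `hrgdd13_of_pinsP_geo9Y` p763448 BY NAME):
  `θ₂ hθ₂ hD2sup` GONE, NEW `ρG hρG hρGP hρGK κC δC2 hκC hgap hC2` (the (3.137) chain's letters: the C⁽²⁾-form letter schema `hC2` with its constants and windows); 0 types changed; 354 → 360 displayed; [B9]∕[5] letter-schemas
  15 (`h348; h36 h36H hopI; h36A hGsqA h36HA h36A2 hopIA; hC2 hZ; h14₁ h14₂ hexp14; hE` + `h𝔠real`); witness `…N06NumericsWitnessT.numerics_inhabited_ed113` p765773; «VL» = edition 109 «VJ» (p763543) with the residual family `𝔯` PINNED to node00-def-Y's record `resYOfC2P` (`Node00.OpsYDelta2FormP` p763134, t2a FOLD RECIPE I.32338): NEW displayed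
  `(𝔠 : C2Y 2 θ.toStage3Params Mstar) (h𝔯 : 𝔯 = resYOfC2P 2 θ.toStage3Params Mstar 𝔠) (h𝔠real : ∀ x U, (∀ μ z, U μ z ∈ specialUnitaryUnits (Fin 2)) → ∀ A A', (𝔠 x).form U (star A) (star A') = star ((𝔠 x).form U A A'))`
  (the definitional-pin pattern of `h𝔈 ∕ h𝔬12 ∕ hbI`; the conclusion keeps its `𝔯` letter), `hΔ2` GONE (derived: `subst h𝔯; exact resYOfC2P_Δ2_isSymmTr_SU … h𝔠real`); 352 → 354 displayed, 15 [B9] letter-schemas left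
  (`h348; h36 h36H hopI; h36A hGsqA h36HA h36A2 hopIA; hD2sup hZ; h14₁ h14₂ hexp14; hE` + the structural reality letter `h𝔠real` on the new datum); numerics unchanged (witness S p763544); «VJ» = edition 107 «VH» (p761921, #11147) with the LAST rows-20–21 second-order letter `hrgdd13` (print's lossy two-exponent species) DERIVED inside the certificate by dag-n06-d's second U8 state
  layer above `δ12₃` `…N06Rgdd13AtPinsPUW.hrgdd13_of_pinsP_geo9Y` (p763448) over dag-n06-c's `rgdd_of_pinsT` (p762558; leg (C) of the P-HRGDD road): `hrgdd13 Br13 hBr13` GONE, thirteen pure numerics `τR hτR hR8a … hR8k`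
  displayed in their slot (witness `…N06NumericsWitnessS.numerics_inhabited_ed109` p763544); 342 → 352 displayed, 16 [B9] letter-schemas left (`h348; h36 h36H hopI; h36A hGsqA h36HA h36A2 hopIA; hD2sup hZ hΔ2;
  h14₁ h14₂ hexp14; hE`) — rows 20–21 of [4] Thm 3.3 now carry NO displayed letter; «VH» = edition 105 «VF» (p759375, #11099) with the rows-20–21 GRADIENT letters `hdgDvd13 : ∀ ν ε, HasMaj (bHX x ε) (ofBlocks (𝔬12 x).blk)
  ((𝔡A x).Dd U ν ∘ₗ ((𝔬12 x).G0 U ∘ₗ (𝔬12 x).Dv U)) (Bd13 ε · e^{−δ12₃ d})` and `hpdgDvd13 : ∀ ν ε β, HasMaj (bHX x (β+ε)) (ofBlocks (𝔭A x).blkPX) (((𝔭A x).ΦX U β ∘ₗ (𝔡A x).Dd U ν) ∘ₗ (G0 ∘ₗ Dv))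
  (Bd2₁₃ ε β · len^{−β} · e^{−δ12₃ d})` REMOVED together with their letters∕signs `Bd13 Bd2₁₃ hBd13 hBd2₁₃`, and DERIVED inside the certificate AT PRINT's TRANSPORTED SITE CLASS (3.40) `bHW13 := bHXT`
  (`bHZPIfam (taxiS U)`) by dag-n06-c's UNIT D (`thm33G0DirT_of_local3107` p758723 → LEG v1.1 `dgDvd_pdgDvd_of_pinsT_all` → `…N06StateLayerAtPinsPUW` p760678 with `htransW := hasMaj_bHZPIfam_of_supBlocks` p760411,
  `hκW13 := bHZPIfam_κ`, `hdomW := exists_l1_control_bHZPIfam` p759248; U8 v2 state layer `…StateProducersBAtPinsPUW` p760519 ∕ `…StateAssemblyAtPinsPUW` p760386); `hrgdd13` RETYPED once more (target class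
  `bHX x ε′ ↦ bHXT x U ε′`); 348 → 342 displayed, 17 [B9] letter-schemas left (`h348; h36 h36H hopI; h36A hGsqA h36HA h36A2 hopIA; hrgdd13 hD2sup hZ hΔ2; h14₁ h14₂ hexp14; hE`), witness
  `…N06NumericsWitnessR.numerics_inhabited_ed107` (= witness Q minus the `Bd13 ∕ Bd2₁₃` letters and their two signs); «VF» = edition 103 «VD» (p757219) with the rows-20–21 Dv-letter `hpXDv : ∀ x …, ∀ β, 0 ≤ β → β < 1 → HasMaj (cNormR 1 (H x) (𝔬12 x).blkW _ 0) (cNormR 1 (H x) (𝔭A x).blkPX _ (β − 1))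
  (((𝔭A x).ΦX U β ∘ₗ (𝔬12 x).G0 U) ∘ₗ (𝔬12 x).Dv U) (Bx13 β · e^{−δ12₃ d})` REMOVED and DERIVED inside the certificate by dag-n06-c's BX-handle leg v1.1 `pXDv_of_pins_KX` (p754003) from the G₀ layer's
  `(hG0C …).1.h43R` at `(M₀, aZ)` with `Bh12 := BhC` (the U8 state layer's `hpXDv` slot reads `Bx13 := fun β => max (max (Bx13 β) Bxz) (KX · BhC β)`, sup bound via the displayed closed `hwBhG`);
  349 → 348 displayed (−`hpXDv`; nothing added or retyped; `Bx13 hBx13 Bx13₀ hBx13₀ hwBx13` STAY for the W-route member), NUMERICS IDENTICAL (witness Q `…N06NumericsWitnessQ.numerics_inhabited_ed103` p756543 applies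
  verbatim), 19 [B9] letter-schemas left (`h348; h36 h36H hopI; h36A hGsqA h36HA h36A2 hopIA; hdgDvd13 hpdgDvd13 hrgdd13 hD2sup hZ hΔ2; h14₁ h14₂ hexp14; hE`); «VD» = edition 101 «VB» (p755299, #11015) read through dag-n06-l's face v1.7 SUCLE (`hrgdd13` re-displayed in print's lossy species, `Br13 Bd2₁₃` two-argument, `hBr13` guarded; 349);
  «VB» ← «UZ» ← «UX» ← «UV» ← «UT» (editions 101∕99∕97∕95∕93; dag-n06-l's face v1.6 «c1 INSIDE» + GUSP closed Hölder profile + Thm 3.13's block-L² pair record assembled from three legs and folded, dag-n06-c's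
  C2c∕Dv∕rgdI∕D_U legs and the rows-20–21 INPUT members `h44m h45X h45Y h44G hp45W` derived with the Cor.-3.6 transported input legs `bHXT hbHXT hopI`∕`bHXTA hbHXTA hopIA` + transfer numerics displayed
  — listed EDITION BY EDITION in the docstring of the K1 face of record #11108 ✓p759737 (VD-keyed), not repeated here; witnesses N∕O∕P∕Q);
  «UT» ← «UR» ← «UP» ← «UN» ← «UL» ← «UJ» ← «UH» ← «UF» ← «UD» (= edition 77, THE CERTIFICATE OF RECORD — FLAG №8 CLOSED director-ym №296; print twins «UE»…«UU»): those earlier folds (node00-def-Y's records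
  `h𝔬12`∕`h𝔈`∕`hbI`, dag-n06-l's G₀Q*∕(3.132)∕leg folds and GUSP-side budget `hwBhG`, dag-n06-c's near-pair assemblers deriving `h43Gp`∕`hpDGW` + the SN probe re-pin `h𝔭`) are listed EDITION BY EDITION in the
  docstrings of the K1 faces of record #11026 ✓p755614 ∕ #10992 ✓p750549 (UT-keyed) and are not repeated here; displayed-binder counts 373 → 347 → 344 → 343 → 335 → 335 → 339 → 340 («UD»…«UT») → 353 → 352 →
  351 → 349 → 349 → 348 → 342 → 352 → 354 → 360 («UV»…«VO») by those editions' own counts; conclusion IDENTICAL from «UD» through «VL» at the coded carrier `B9LeafX (Y9OfRecordUPb N θ₃ M⋆ (opsYNuStOfRecordV4PE …) f bR ιB C38)` (node00-def-Y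
  `CarriersYU` (α2), dag-n06-c `B9SectBStepUGuardedR` §4 = the (α3) object of record, knit `B9LeafXCodedKnitU`); the regular-families PARAMETERS `{R₁ R₂}` with the class-transfer
  binders `hGR hRP1 hRP2 hP1 hP2` and the cube constant `c hcB hc` displayed (director-ym №290 (1); discharged in the print-literal twin); CONE CENSUS per its header (0 raw-class
  Step letters, 0 unguarded Reg335-keyed binders).  (α5) HERE (replacing (α4) of p731579 —
  see EDITION (α5) above): `J := {x : MemberY (stage3OfFamily F).d₆ … (Mstar F) // Function.Surjective (β x.toKIdx…)}`, `f := Subtype.val`, `ιB := fun j => Function.surjInv j.2`,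
  `hι := fun j s => Function.surjInv_eq j.2 s` (by name: dag-n06-c's `SCMemberY` ∕ `.val` ∕ `.ιBsc` ∕ `.hιsc`) — the pinned leaf covers the surjective-`β` members and the (α3) block's `J`-indexed row(s) `C38` are displayed over them (`ιB hι`
  CONSTRUCTED, off the display); `{ιR} [Fintype] [DecidableEq] bR` (an ℝ-basis of
  M₂(ℂ)) and the constants stay displayed as data; N06 NOT discharged; the certificate OF RECORD stays «UD»∕«UE» (director-ym №296∕№303) — THIS re-key reads the slimmest successor
  edition and changes the N06 display ONLY): 365 of its 367 binders after `(θ) (hθ)` (all but `ιB hι`) are THIS THEOREM's HYPOTHESES VERBATIM up to `J ∕ f` as above, `N := 2`, `θ.toStage3Params ∕ θ.<Stage-3 field> ↦ (stage3OfFamily F)…`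
  and Skolemisation in `F` (`(b : T)` ↦ `(b : ∀ F : T4Family, T[e ↦ e F])`, implicit groups made explicit; instance binders named `instN06_k`; inner bound names colliding with an
  outer certificate name α-renamed `·ᵢ`).  Per door the proof has
  `have h06 F … : B9LeafX (Y9OfRecordUPb 2 (stage3OfFamily F) (Mstar F) (opsYNuStOfRecordV4PE 2 (stage3OfFamily F) (Mstar F) (𝔯 F) (sectEStYOfRecordV7 2 (stage3OfFamily F) (Mstar F) (𝔢₀ F)) (𝔴 F) (𝔈 F)) SCMemberY.val (bR F) SCMemberY.ιBsc (C38 F))` —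
  TYPED AT N06's OBJECT OF RECORD — proved by the certificate at the door witness's Stage-11 view `(θZB(π)).toStage12Params.toStage11 F 2 ⟨0, 0, 0⟩` (its Stage-3 dictionary IS `stage3OfFamily F`,
  `rfl`; admissible by `admissible_theta13OfThm1CCMWZB_of_le_half … .toStage12.toStage11`; the view's run-indexed weight binder is read by no certificate binder), then fed to the engine's
  CARRIER-GENERIC socket `∃ Y₀ : PrintedCarriers9X, B9LeafX Y₀` as `⟨_, h06 F …⟩`.  That socket is JUNK-INHABITABLE (referee dag-ref-H g32 VERDICT 555: `emptyCarriers9X` + `B9LeafKnit.b9LeafX_of_isEmpty`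
  ⊢ `exists_b9LeafX_vacuous`; p682802 :22–23's standard «the honest display of N06 is the FACE's»): the N06 binders here are load-bearing for the PIN and the DISPLAY (N06's open burdens, unweakened),
  NOT for the truth of the conclusion through that socket; NO N06 → K1 credit is claimed (chair lead g29's note of 2026-08-29 12:18Z is the reading of record).  Q-SOCKET (dag-n06-d g17, located
  2026-08-29): the certificate's W-letter display `hB` (FLAG №8) is located UNSATISFIABLE AS INSTANTIATED for `N ≥ 2`; road (α) re-concludes the certificate at the coded carrier `Y9OfRecordU` — one
  generator pass then re-keys this face; until then this face INHERITS that located display verbatim (A2 caveat declared here, not resolved here).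
* NODE N07 — `h07 : ∀ F, ∃ ζ, B11Leaf (Z11OfRecord F 2 ζ)` fed by NODE 00's Sect.-E presentation `CarriersZSectE.b11Leaf_Z11OfRecord_withSectE_of_parts` at print's letters (`L := F.L`,
  `η i := (F.P i.K).eta i.k`): displayed per `F` (`hN07`, 23 conjuncts) = the presentation `E`, n16's bridges + laws + capped existence leaves, the `famX` laws, the Sect. A law (14), the printed
  sign∕size relations, THE SIX REMAINING PRINTED PARTS `Prop2∕3∕5∕8Printed`, `SectFPrinted`, `Prop9Printed`.  N07's ∀-form junk channel (`ζ.R`, F8) NOT closed — said in `CarriersZSectE`.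
* NODE N08 — `h08 : ∀ F, PrintedUV3V 2 F.L` fed by dag-n08-w4's `…N08AlphaEq324RowACReMassedZSlot.printedUV3V_at_slotOfRecord_of_coreLTAtAC_of_massBoundZAE_of_consts`: displayed per `F` (`hN08`, 6) = the
  (α)-AC residual (AC inputs at print's averaging, the numeric window, the EDITED (α)-AC rows `RunAlphaEq324CoreLTAtAC`, `0 ≤ c_m`, the `dU`-a.e. mass bound); E6′ seam ∕ object gap = n08's located items.
* NODE N09's THEOREM-3 DOOR (editions «N09T»∕«N09T2»∕«N09T3»∕«N09T5» — THIS file's delta w.r.t. `…N08Junction…PrintedZBY`; «N09T5» (engine `…Thm1AEPosN09T5AtGaussPinPrintedZBY`, 2026-08-29): the engine CONSUMES the per-door families at the TOP of the window `ε₀ := a₀` instead of `2a₀∕L²` — ym-nodeO DEF-1 g30 LOCATED-EPS0-LABEL: at `2a₀∕L²` K0e's threshold route `hord` to the displayed `hχregpt` is EMPTY, and the reg8 road that wanted ε₀ small is DEAD (FLAG №7′, door v1.3 ✓p747503, consumable here after (D1′)); the displayed families below are DOOR-PINNED IN `ε₀`: each gains ONE guard binder `(hε₀ρ : ε₀ =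 a₀)` after the ceiling guard `ha₀ρ`, so the rows are demanded only at the door the engine consumes (weaker hypotheses; the other door letters stay ∀ under their signs∕ceiling, V-579's caveat shrinks to them)) — INSIDE THE ENGINE, per door: `⟨1, one_pos, fun _ hC _ => thm3Member_forall_stage13SepCoPH_onDomains_of_axialOn_of_reg8_of_suppPt θᴳᶻᴮ(π) hP hC
  cd hreg8 le_rfl ha₀.le haxDom haxbg hχregpt hint h11 hres huniq hε' ha₀ hbg3 hbg2 hbg₀⟩ (`hbg3`∕`hbg2` PROVED at the engine's SHRUNK ceiling `a₀ ≤ 1∕(109824·L²)`; `hbg₀` = the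
  LOCATED-K0ε₀ letter `K0N09Eps0LetterAt F a₀ ε₀` read off the engine's internally DERIVED Eps0 text at its door — editions «N09T2»∕«N09T3»)`; the face PASSES THROUGH the engine's displayed binder `hN09T : <door letters, signs, box> → ∃ cd : (P : B12.RunParams) → (i : ℕ) →
  ContourData (F.P P.K) i (SU 2), hreg8 ∧ haxDom ∧ haxbg ∧ hχregpt ∧ hint ∧ h11 ∧ hres ∧ huniq` — dag-n09-w2's door v1.2 (FILE 10 `…N09AxialCovariance181OnDomainsReg8Nesting`:
  nesting + a.e. (F7a) DERIVED from [B7] Prop. 2 (53)) INPUT rows VERBATIM at `N := 2`, the Z3-pin projections in reduced form (`θ.ν ↦ numerics7OfThm1CCM F.L j ε₀ B₃ B₃' a₀ a₁`, `θ.εbg ∕ θ.ν.εreg ↦ a₀`,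
  `θ.ν.ε₀ ↦ ε₀`, `θ.toStage13Params ↦ θZB(π)`; all `rfl`: Z3 `theta13OfThm1CCMWZB_ν ∕ _εbg ∕ _εreg ∕ _ε₀`, `gaussPinH_toStage13Params`): (8)-membership at radius `a₀` (dag-n09-w1; LOCATED modulo N07's
  Theorem-1 slot), [I] (2.3)'s axial convention + hierarchical block-axiality of the background's partial averages (definitional after node00-def's re-points), POINTWISE (F7a) (K0e), (I19),
  [B11] Thm 1 ×3 at radius `a₀` (N07's slot), — each a located item, displayed not resolved; `hεreg`, `0 < εbg`, `0 < ε₂₉` by the door's signs.  The three [B7]-numerics rows are OFF the per-door bill (edition «N09T2»): the two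
  L-only ones PROVED at the engine's SHRUNK ceiling; the third IS the LOCATED-K0ε₀ letter `K0N09Eps0LetterAt F a₀ ε₀ := 2a₀ ≤ ε₀L²`, since edition «N09T3» met at the engine's CHOSEN threshold («N09T3»: `2a₀∕L²` with equality; «N09T5»: `a₀`, by `2 ≤ L²`) — superseding the words that follow: formerly WITH EQUALITY at the engine's CHOSEN threshold `ε₀ := 2a₀∕L²`, the registered
  box being read at that label by DEF-1 g29 `K0ZBWitnessBetaEps0.forall_eps0_absBox_of_GZAt` (β of record at the Z3 member is ε₀-blind by `rfl`) — displayed NOWHERE on this face.  DOOR CEILING GUARD: every per-door family of this face carries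
  `(ha₀ρ : a₀ ≤ 1 ∕ (109824·L²))` — demanded only below the engine's shrunk ceiling (ref-H 579's door-side suggestion).  PER-DOOR CAVEAT: rows are still demanded at EVERY such door (letters +
  signs + β-box); joint inhabitation across doors is NOT claimed (LOCATED-N09NUM ∕ ref-H VERDICT 579).  The ⚑EPSBG letter `hle : θ.ν.εreg ≤ θ.εbg` (FALSE at the `εbg = 1` members, dag-n09-w1) is `le_rfl` HERE.
* N05 (inside the N05∕N06 slot `hN06`, 43 conjuncts: Hölder pair + [4]'s letters `hLet`∕`SLetUB`) read through dag-n05-d's ζ-L door BY NAME at the witness slot of record `Slot8κ′`, N06's five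
  N05-side binders consumed η-free (p688041's slot proof VERBATIM); print's TRACE STATE `(τ, C_τ)` on `(stage3OfFamily F).𝔸 = Matrix (Fin 2) (Fin 2) ℂ` OFF the bill since edition «Tr» (NODE 00
  `Record12NumericsFamilyTraceState.exists_traceState_stage3OfFamily`; [I] (0.2) p.252, [B8] p.76).

WHICH CHILD BLOCKS AT THE Z3 GAUSS PIN AFTER THIS FILE (= its hypotheses): K0⁷ = `Prop8StepCoPGridGAt F` (REGISTERED 1-G‴, fe2ecbb43f63b100) ∧ `AbsBetaBoxAtThm1WitnessCCMGenGridGZAt F` — EXACTLY the two REGISTERED stubs BY NAME (0∕2); the LOCATED-K0ε₀ letter `2a₀ ≤ ε₀L²` DERIVED inside the engine (DEF-1 g29: ε₀-blind β, edition «N09T3»); per `F` at `stage3OfFamily F`: the N05∕N06 slot `hN06`;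
**N06 = 365 of edition «VQ»'s 367 certificate binders VERBATIM** (as Skolemised here; `ιB hι` CONSTRUCTED at (α5), `C38` over the section-carrying sub-family); **N07 `hN07`**;
**N08 `hN08`**; N10 `h10` (display-only, inhabited AS TYPED, p685841); per door: N09 `h09` ([I] Lemma 4 leaf) + **`hN09T` (the eight structural Thm-3 input rows)**, N11 `h11N` (FLAG №1), N13 `h13pos` + `hEfl`,
NODE O `hrowsR`; `0 < ε`.  OFF the bill: N06's ∕ N07's bare leaves, N08's bare slot, N09's Thm-3 CONCLUSION and its EPSBG letter, N13's level 0, `logz`, the trace state.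

FLAG №14 (director-ym №256) — STATE OF RECORD: the family dictionary is RECORD-NONABELIAN (`(stage3OfFamily F).𝔸 = Matrix (Fin 2) (Fin 2) ℂ`, `rfl`, `Record12NumericsColourTie.stage3OfFamily_𝔸`;
`FiniteDimensional ℝ (stage3OfFamily F).𝔸` BY NAME from `Node00.finiteDimensional_𝔸_stage3OfFamily`); N06's certificate binders read the dictionary's GEOMETRY only (`d₆ ℓ₆ hd' hL' b₀ b₁`; 0 occurrences
of `θ.𝔸`) over print's cube class with coefficients `Matrix (Fin 2) (Fin 2) ℂ` ∕ `specialUnitaryUnits (Fin 2)` (SU(2) AS TYPED); no K-display movement claimed.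

HONEST FRAMING.  Composition BY NAME (one typed `have` per door for N06, one `refine` of the engine, p688041's N05∕N06-slot proof); NO estimate of Bałaban's proved here; every family DISPLAYED as a
hypothesis (CONDITIONAL, audit `proof.conditional`) — every letter schema of N06's certificate and every N09 input family REMAINS a displayed hypothesis, now on the K1 face; `Efl`, `ε` FREE; NOT a
claim that the Z3 member IS K1⁹'s witness; NO v10 ∕ V22-Z stub proved or closed; **N06, N07, N08, N09 NOT discharged** (no «DISCHARGE CLAIMED» line exists for any; the chair books discharges on
referee reads, R417); N05's discharge is R467's; N10 ∕ N11 ∕ N13 NOT discharged; N24 COMPOSITE — no count moved (typed 28∕28 · discharged 8∕28, 8∕27 excl. NODE O); K0⁷ «V22-Z 0∕2 (+2′)» ∕ K1⁹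
stmt-QuantumFields-27364 (DECIDING; v10 0∕6, HARD FREEZE respected — Theorems side only) ∕ K3⁸ OPEN; one finite 𝕋⁴ programme at fixed ε, Bałaban AS PRINTED; R4 = the conditional finite-𝕋⁴ rung
`BalabanLadder.UV` only — NOT continuum ∕ ℝ⁴ ∕ OS ∕ mass gap ∕ Clay: the Yang–Mills mass gap is NOT proved by any of this.  No `sorry`, `def`, `instance`, `notation`.  Elaboration options as the
certificate's own (`maxHeartbeats 800000`, `synthInstance.maxSize 2048`, `maxRecDepth 8192`).
-/

noncomputable section

open scoped Matrix.Norms.L2Operator BigOperators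
open Filter Topology MeasureTheory

namespace Summit.QuantumFields.YangMills.BalabanUVNodes.N24K1FaceTrN06VQSCN07N08N09T5JunctionLSlot8KappaPrimeAtGaussPinPrintedZBY

open Literature.MathematicalPhysics.QuantumFieldTheory.Balaban1983to89
open Literature.MathematicalPhysics.QuantumFieldTheory.Balaban1983to89.Node00
open DagBinding T4Continuum T4DatumAssembly FlowStepRuns AveragingRT
open FlowStep (RGEqH prefixOf BetaLowerH BetaUpperH clampPrefix Y)
open Literature.MathematicalPhysics.QuantumFieldTheory.Balaban1983to89.B8LeafModelZd (ZdIdx)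

open Literature.MathematicalPhysics.QuantumFieldTheory.Balaban1983to89.B9SupplySockB9P3ZdLetters (OpsZd)

open Literature.MathematicalPhysics.QuantumFieldTheory.Balaban1983to89.B9SupplySockB9P3ZdH2Per (holderAtIH2Per_anti)

open T4TermwiseTorus (IsPeriodic)
open MatrixLog B7Prop2Explicit B7Prop1Local B7Eq92Concrete
open B8Ineq132 (InAk covDerivFwd)
open B8Eq119TwistedAxial (bgT)
open B8Eq140Level (SideTouches)
open B8Eq138LandauZd (covLap QT)
open B7Eq78Linearization (zdBlocking QprimeIter)
open B8Eq1117Concrete (XSpace)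
open B8Prop5ContractionKLevel (Bd2)
open B8LambdaSpaceKLevel (wt)

open Summit.QuantumFields.YangMills.Theorems.K0V22ZDefs (Prop8StepCoPGridGAt AbsBetaBoxAtThm1WitnessCCMGenGridGZAt)
open Summit.QuantumFields.YangMills.Theorems.BalabanUVNodesN11GaussianCertificateDefs (gaussPinH)
open Summit.QuantumFields.YangMills.Theorems.BalabanUVNodesN11Sect3SupplyChainDefs (Sect3Supplier)
open Summit.QuantumFields.YangMills.Theorems.BalabanUVNodesN11Sect3SupplyChainObligationsDefs (SupplierObligations OperandRowsAlongChain)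
open Summit.QuantumFields.YangMills.BalabanUVNodes.N05SubBP2DK2PerKappaSlotExistsOfBindersLettersPerDoorL (exists_residB8_slot8κ'_of_bindersLettersPer_doorL)
open Summit.QuantumFields.YangMills.BalabanUVNodes.N24K1R9ByNameOfOpenStubsGridGChildrenSplitSlot8Thm1AEPosN09T5AtGaussPinPrintedZBY (N24_stabilityBRunRowsAtRecordR13SepCoPHV_byName_of_registeredStubsGridGZ_of_childrenSplitSlot8DoorPinnedN09Thm3InputsN11OperandRowsThm1AEPos_atGaussPinPrintedZB_pinY_of_runRowsCont)
open T4Continuum (T4Family) open Node00 open B9PinMembersKLevelV1 (MemberY geo9Y) open B9PinGeometryKLevelV1 (c35Y) open B7Prop2SpecialUnitary (specialUnitaryUnits) open B9CoReadingCoordsHolderAdm (holderProbesKA) open B9CoReadingCoordsHolderSNear (holderProbesSN) open B9H44mFromPinsKA (thm33G0DirT_of_local3107) open B9SmoothHolderClassPI (bHZPIfam bHZKPIfam) open B9RWSums347DefiniteFaces (exp261) open B9RWSums344Input (inputConst44 inputConst45) open B9RWSums343Holder (holderConst) open B9Thm37Whole (const37) open B9RWSums346MixedFactorAtRecordClosed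 (MRec aRec BRec δRec) open B9WalkLettersOps (opsWalkY dirOpsWalkY dirLettersWalkY thetaWalkY KcWalkY) open B9SmoothHolderClassP (bHZPG bHZKPG) open B9SmoothHolderClassPProducers (CTel) open B9Ineq349SiteThresholdRateNamed (cg349) open B9Thm39ReadingAtLetters (basis39 κ39) open B9MultiscaleSmoothPartitionYNear (rNear) open B9Thm313WholeDvHolderAtPinsGraded (thetaL CJG) open B9MultiscaleSmoothPartitionYLip (CLip) open B9GradViaDivLettersTransported (taxiS taxiB) open B9BackgroundsKLevelV1P (bg9YP)
open Node00.OpsYExpsOfRecordV2 (expsYOfRecordV2) open Node00.OpsYOps312OfRecord (ops312YOfRecord) open Node00.OpsYBondMapOfRecord (bIYOfRecord) open B9Thm315SectEStarRepAtLettersR (DecayMidOnStY) open B9BackgroundsKLevelV1R (RegFamY MemOfFam bg9YR regYP335 regYP336) open B9LeafXClassAntitone (ClassIncl) open B9PinGeometryKLevelV1B (c35B) open DagBinding (B9LeafX) open B9Thm39WholeBlk (Conv348Blk) open B9Thm39OneCubeReadingAtLettersY (oneCubeOps39YF) open B9RowSum261DefiniteFaces (rowConst261) open B11SectG (BlockNorm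 HasMaj) open B9Thm34Ext (toB6) open B9CoRealizesRelAtLetters (RelB) open B6Ineq2142KLevelV1 (β) open B9PinGeometryKLevelV1 (kLab) open B9Thm314GpFlatTorusGeometry (tdistK OmegaC) open B9Thm314WholePinGeometry (locDataY) open B9Thm314WholePair (locData₂) open B9Thm314WholePairWalks (pairWalkSets) open B9Thm314WholeSummation (WalkSetsSpec WalkWeightsSummable) open B9SectCWalkTermsAllNorms (Thm310AllNormsPrinted) open B9Thm314WholeExpansionReads (ExpansionReads) open B9Thm314WholeCancellationLayer (pairOp) open B9Thm37Whole (Local342) open B6RandomWalk (HasMajorant) open Node00.OpsYLocalInverse (GsqY)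
open B9GeoNbrCountBlocksY (nbrM₀BY nbrCountBY) open B9SectBAllBlocksGeometryY (geoBY) open Node00.OpsYBlockPinOfRecord (dist_beta_blkSK_sIK_bIYOfRecord_le_one len_blkSK_sIK_bIYOfRecord_eq) open B6Geom246MultiLevelBox (blkOf) open B9Eq352DivFormLetters (conj) open B9Eq352GradLetters (diffLetter) open B9Thm310Whole (Ops310 WalkReading310 Sizes310 StaticOK310 Locality310 Local342G) open B9Thm310WholeDir (DirLetters310 Identities310₂) open B9RWSumsDefinitePins (PinPrims) open B9RWSumsDefinitePinsPair (PairPrims) open B9RWSumsDefinitePinsPairM (MixedPrims) open B9Thm37KLetterDir (HolderV37Dir FactorsInputPair37Dir) open B9RWSums344InputPair (InputLegsPair37 InputLegsPair310 FactorsInputPair310) open B9RWSums346MixedPair (L2MixedLegs310 FactorsL2Mixed310) open B9CoReadingCoordsTranspose (TrIdx trBasis) open B9RWSums346SecondDiff (DirOps310 L2SecondLegs310) open B9RWSums346SecondDiffGp (L2SecondLegs37) open B9Thm37Glue (IsTransposePair) open B9RWSums346Two (L2TwoLegs310 FactorsL2_310) open B9RWSums343Holder (HolderProbes HolderLegs310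 FactorsHolder310) open B9RWSums343HolderGp (HolderLegs37) open B9Thm39ReadingCoords (cR39) open B9CoReadingCoords (XBK blkBK GcoK DcoK DscoK LcoK coordOpK cdBₗ cdsBₗ) open B9CoReadingCoordsS (XSK sIK) open B9GeoNbrCountKLevelV1 (nbrM₀Y nbrCountY) open B9CoReadingCoordsH (XHK) open B6Ineq2142KLevelV1 (lvl) open scoped Matrix.Norms.L2Operator open B9Eq346GradGpDivAtPinsL2Closed (δ46)
open B9Thm312WholeClasses (cNormR) open B9CoReadingCoordsHolder (PK) open B9CoReadingCoordsInput (bHK) open B9CoReadingCoordsInputS (bHS) open B9WalkLettersCoordsS (walkCntM₀Y walkCntY nearBlkCntY cubeDomY) open B6Cover236MultiLevelBlocks (cubes) open B9Eq346MixedLegAtPinsL2Closed (MMix aMix BMix δMix) open B9Thm39ReadingCoords (coordBound39 basisBound39) open B9RowSum261DefiniteFaces (rowConst261) open N06StepL2AtPinsPhysR (blockBd_tpi_of_letter_schemasR) open B9Delta2FormMajorant (C2FormMaj) open B9GradLetterTransportedSupSource (hasMaj_bHZPIfam_of_supBlocks) open B9GradLetterTransportedInputClassesPI (bHZPIfam_κ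 exists_l1_control_bHZPIfam) open B9MultiscaleSmoothPartitionYNear (rNear) open Node00 (Y9OfRecordUPb CfgY IBondY) open B9Eq360DeltaPrimeAY (AfldY)
open Summit.QuantumFields.YangMills.BalabanUVNodes.N06AtOpsYNuOfRecordV6EPairVQ (b9LeafXUR_opsYNuOfRecordV6E_pairVQ) open Literature.MathematicalPhysics.QuantumFieldTheory.Balaban1983to89.B9SectionCarryingMembersV1 (SCMemberY)

set_option maxHeartbeats 800000 in set_option synthInstance.maxSize 2048 in set_option maxRecDepth 8192 in
/-- **★★★★ THE K1 FACE AT THE Z3 MEMBER, EDITION «N09T5» AT N06's EDITION «VQ», INSTANTIATION (α5)** — K1⁹ `StabilityBRunRowsAtRecordR13SepCoPHV` (stmt-QuantumFields-27364) BY ITS ROUTE NAME: ONE `refine` of the «N09T3»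
engine's §2 (the two REGISTERED V22-Z stubs displayed BY NAME; per-door rows at the Gauss pin of `θZB(π)`, `εbg := a₀`, printed z) with NODE N06's leaf = a per-door `have` TYPED AT N06's OBJECT OF RECORD
`B9LeafX (Y9OfRecordUPb 2 (stage3OfFamily F) (Mstar F) (opsYNuStOfRecordV4PE 2 (stage3OfFamily F) (Mstar F) (𝔯 F) (sectEStYOfRecordV7 2 (stage3OfFamily F) (Mstar F) (𝔢₀ F)) (𝔴 F) (𝔈 F)) SCMemberY.val (bR F) SCMemberY.ιBsc (C38 F))` proved by dag-n06-d's certificate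
`N06AtOpsYNuOfRecordV6EPairVQ.b9LeafXUR_opsYNuOfRecordV6E_pairVQ` (edition «VQ») at the door view (instantiation (α5): `J` = the surjective-`β` members, `f := Subtype.val`, `ιB ∕ hι` by `Function.surjInv ∕ surjInv_eq`; its other binders = this theorem's N06 hypotheses VERBATIM, Skolemised in `F`) and fed to the engine's carrier-generic (junk-inhabitable —
header) socket as `⟨_, h06 F …⟩`; NODE N07's leaf by `⟨ζ.withSectE E, CarriersZSectE.b11Leaf_Z11OfRecord_withSectE_of_parts …⟩` from `hN07`; NODE N08's slot by dag-n08-w4's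
`printedUV3V_at_slotOfRecord_of_coreLTAtAC_of_massBoundZAE_of_consts` from `hN08`; NODE N09's THEOREM-3 door by dag-n09-w2's `thm3Member_forall_stage13SepCoPH_onDomains_of_axialOn_of_reg8_of_suppPt`
INSIDE the engine from `hN09T` (`hle := le_rfl`; threshold `ε₀ := 2a₀∕L²` chosen inside); N05 through ζ-L at `Slot8κ′` with print's trace state by name.  CONDITIONAL (every family displayed; audit
`proof.conditional`); not a closure; NO stub used as proved; N06 ∕ N07 ∕ N08 ∕ N09 ∕ N10 ∕ N11 ∕ N13 NOT discharged; no N06 → K1 credit claimed; no count moved.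
[cite: Balaban1985BackgroundPropagators, Thms 3.1–3.15 pp.397–432, (3.40)–(3.47) pp.397–398, (3.87)–(3.90) pp.408–409, (3.117)–(3.121) p.419; Balaban1985RegularSpaces, Lemma 1 p.79 – Thm 8 p.101, Prop. 5 p.94, Prop. 6 p.99; Balaban1989LargeFieldII, Thm 1 p.355, (0.1) pp.355–356, (0.15) p.360; Balaban1988Convergent, Theorem p.245, Cor. 3 (2.50) p.264, (3.16)–(3.25) pp.268–270; Balaban1987RG1, (0.14)–(0.17) pp.254–255, Thm 3 p.264, §1 pp.263–264; Balaban1988RG2Cluster, Lemmas 1–3 pp.9–20; Balaban1985Variational, Thm 1 p.279, Props 2–9 pp.281–309, Sect. E (111)–(121) pp.293–296; Balaban1985UV3, Thm 1 p.257, Thm 2 p.272, (41) p.266 (bookkeeping)] -/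
theorem N24_stabilityBRunRowsAtRecordR13SepCoPHV_byName_of_registeredStubsGridGZ_of_n06TorusDataLettersLSlot8KappaPrime_n06CertificateVQSC_n07PartsSectE_n08ResidualAC_doorPinned_n09Thm3Inputs_trM2_stage3DoorFree_n13LevelZero_atGaussPinPrintedZB_pinY_of_runRowsCont (M₁ R : ℕ) (hM₁ : 1 ≤ M₁) (ε : ℝ) (hεz : 0 < ε)
    (Efl : T4Family → ℕ → ℝ → ℝ → ℝ → ℝ → ℝ → ℝ → ℝ → B12.RunParams → ℕ → ℝ)
    -- K0⁷'s display = EXACTLY the two REGISTERED V22-Z stubs BY NAME (ym-nodeO DEF-1 `Theorems/BalabanUVNodesK0V22ZDefs` §1, skeleton fe2ecbb43f63b100 :73–78 ∕ :84–96):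
    -- stub 1-G‴ = `Prop8StepCoPGridGAt F`, stub 3ᴬ′-G‴-Z = `AbsBetaBoxAtThm1WitnessCCMGenGridGZAt F`; the LOCATED-K0ε₀ letter is DERIVED inside (DEF-1 g29 `K0ZBWitnessBetaEps0`: β of record at the
    -- Z3 member is ε₀-BLIND by `rfl`, so the Eps0 text follows from the registered one — editions «N09T3»∕«N09T5»; «N09T5» consumes the families at the door `ε₀ := a₀`)
    (h1G3 : ∀ F : T4Family, Prop8StepCoPGridGAt F)
    (h3 : ∀ F : T4Family, AbsBetaBoxAtThm1WitnessCCMGenGridGZAt F)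
    -- N05∕N06 SLOT (per F): print's trace state `(τ, C_τ)` is OFF this display since edition «Tr» — a THEOREM at the record algebra `(stage3OfFamily F).𝔸 = M₂(ℂ)` (NODE 00 `Record12NumericsFamilyTraceState`), fed in the proof
    (hN06 : ∀ (F : T4Family) [FiniteDimensional ℝ (stage3OfFamily F).𝔸],
      ∃ (β : ℝ) (len : B7Prop1Explicit.Site (stage3OfFamily F).D → ℝ) (B₀'H B₂' BG BR cL : ℝ),
        0 ≤ β ∧ (∀ v : B7Prop1Explicit.Site (stage3OfFamily F).D, 0 < len v → 1 ≤ len v) ∧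
        0 < B₀'H ∧ 0 ≤ B₂' ∧ 0 ≤ BG ∧ 0 ≤ BR ∧ 0 < cL ∧
        (∀ a : IdxB8SubDPerκ (stage3OfFamily F) (M₁ * (stage3OfFamily F).L) M₁ R, ∀ α₀ : ℝ, 0 < α₀ → α₀ ≤ cL → ∀ U₀ : B7Prop1Explicit.Site (stage3OfFamily F).D → Fin (stage3OfFamily F).D → (stage3OfFamily F).𝔸ˣ, (∀ x κ, U₀ x κ ∈ unitaryUnits (stage3OfFamily F).𝔸) → IsPeriodic (M₁ * (stage3OfFamily F).L) U₀ →
      InAk (stage3OfFamily F).L a.toZdIdx.k a.toZdIdx.η α₀ a.toZdIdx.Ω U₀ → ∀ n, 1 ≤ n → n ≤ a.toZdIdx.k →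
      ∃ (g Δ : (B7Prop1Explicit.Site (stage3OfFamily F).D → (stage3OfFamily F).𝔸) →ₗ[ℂ] (B7Prop1Explicit.Site (stage3OfFamily F).D → (stage3OfFamily F).𝔸)) (q : (B7Prop1Explicit.Site (stage3OfFamily F).D → (stage3OfFamily F).𝔸) →ₗ[ℂ] (ℕ → B7Prop1Explicit.Site (stage3OfFamily F).D → (stage3OfFamily F).𝔸)) (qs : (ℕ → B7Prop1Explicit.Site (stage3OfFamily F).D → (stage3OfFamily F).𝔸) →ₗ[ℂ] (B7Prop1Explicit.Site (stage3OfFamily F).D → (stage3OfFamily F).𝔸))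
        (Aw c : (ℕ → B7Prop1Explicit.Site (stage3OfFamily F).D → (stage3OfFamily F).𝔸) →ₗ[ℂ] (ℕ → B7Prop1Explicit.Site (stage3OfFamily F).D → (stage3OfFamily F).𝔸)) (H' : XSpace (stage3OfFamily F).D n (stage3OfFamily F).𝔸 →ₗ[ℂ] (B7Prop1Explicit.Site (stage3OfFamily F).D → (stage3OfFamily F).𝔸)),
        (∀ x, (∀ (z : B7Prop1Explicit.Site (stage3OfFamily F).D) (i : Fin (stage3OfFamily F).D), x (z + ((M₁ * (stage3OfFamily F).L) : ℤ) • B7Prop1Explicit.e i) = x z) → ∀ y ∈ a.toZdIdx.Ω 0, (Δ (g x) + qs (Aw (q (g x)))) y = x y) ∧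
        (∀ f, (∀ (z : B7Prop1Explicit.Site (stage3OfFamily F).D) (i : Fin (stage3OfFamily F).D), f (z + ((M₁ * (stage3OfFamily F).L) : ℤ) • B7Prop1Explicit.e i) = f z) → q (g (g (qs (c (q f))))) = q f) ∧
        (∀ (f : B7Prop1Explicit.Site (stage3OfFamily F).D → (stage3OfFamily F).𝔸) (z : B7Prop1Explicit.Site (stage3OfFamily F).D) (i : Fin (stage3OfFamily F).D), g f (z + ((M₁ * (stage3OfFamily F).L) : ℤ) • B7Prop1Explicit.e i) = g f z) ∧
        (∀ f : B7Prop1Explicit.Site (stage3OfFamily F).D → (stage3OfFamily F).𝔸, (∀ (z : B7Prop1Explicit.Site (stage3OfFamily F).D) (i : Fin (stage3OfFamily F).D), f (z + ((M₁ * (stage3OfFamily F).L) : ℤ) • B7Prop1Explicit.e i) = f z) →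
      ∀ (z : B7Prop1Explicit.Site (stage3OfFamily F).D) (i : Fin (stage3OfFamily F).D), qs (c (q f)) (z + ((M₁ * (stage3OfFamily F).L) : ℤ) • B7Prop1Explicit.e i) = qs (c (q f)) z) ∧
        (∀ (f : B7Prop1Explicit.Site (stage3OfFamily F).D → (stage3OfFamily F).𝔸), ∀ x ∈ a.toZdIdx.Ω 0, Δ f x = covLap a.toZdIdx.η U₀ ((a.toZdIdx.Ω 0).indicator f) x) ∧
        (∀ (μ : ℕ → B7Prop1Explicit.Site (stage3OfFamily F).D → (stage3OfFamily F).𝔸), ∀ x ∈ a.toZdIdx.Ω 0, qs μ x = QT (stage3OfFamily F).L n (a.toZdIdx.Λs n) U₀ μ x) ∧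
        (∀ (f : B7Prop1Explicit.Site (stage3OfFamily F).D → (stage3OfFamily F).𝔸) (j : ℕ), j ≤ n → ∀ y ∈ a.toZdIdx.Λs n j, q f j y = QprimeIter (zdBlocking (stage3OfFamily F).D (stage3OfFamily F).L) (bgT (stage3OfFamily F).L U₀) j f y) ∧
        (∀ (X : XSpace (stage3OfFamily F).D n (stage3OfFamily F).𝔸) (x : B7Prop1Explicit.Site (stage3OfFamily F).D), ‖H' X x‖ ≤ B₀'H * ‖X‖) ∧
        (∀ j, j ≤ n → ∀ (X : XSpace (stage3OfFamily F).D n (stage3OfFamily F).𝔸), ∀ b ∈ {b : B7Prop1Explicit.Site (stage3OfFamily F).D × Fin (stage3OfFamily F).D | SideTouches (a.toZdIdx.Ω j) b.1 b.2},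
      wt (stage3OfFamily F).L a.toZdIdx.η j * ‖covDerivFwd a.toZdIdx.η U₀ b.2 (H' X) b.1‖ ≤ B₀'H * ‖X‖) ∧
        (∀ X : XSpace (stage3OfFamily F).D n (stage3OfFamily F).𝔸, Bd2 (stage3OfFamily F).L a.toZdIdx.η n a.toZdIdx.Ω (covLap a.toZdIdx.η U₀ (H' X)) (B₂' * ‖X‖)) ∧
        (∀ (X : XSpace (stage3OfFamily F).D n (stage3OfFamily F).𝔸) (x : B7Prop1Explicit.Site (stage3OfFamily F).D), x ∉ a.toZdIdx.Ω 0 → H' X x = 0) ∧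
        (∀ X Y : XSpace (stage3OfFamily F).D n (stage3OfFamily F).𝔸, (∀ b, Y b = -star (X b)) → ∀ x, H' Y x = -star (H' X x)) ∧
        (∀ X : XSpace (stage3OfFamily F).D n (stage3OfFamily F).𝔸, (∀ (b : Fin (n + 1) × B7Prop1Explicit.Site (stage3OfFamily F).D) (i : Fin (stage3OfFamily F).D), X (b.1, b.2 + (((M₁ * (stage3OfFamily F).L) : ℤ) / ((stage3OfFamily F).L : ℤ) ^ (b.1 : ℕ)) • B7Prop1Explicit.e i) = X b) →
      ∀ (z : B7Prop1Explicit.Site (stage3OfFamily F).D) (i : Fin (stage3OfFamily F).D), H' X (z + ((M₁ * (stage3OfFamily F).L) : ℤ) • B7Prop1Explicit.e i) = H' X z) ∧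
        (∀ (Y : XSpace (stage3OfFamily F).D n (stage3OfFamily F).𝔸), (∀ (b : Fin (n + 1) × B7Prop1Explicit.Site (stage3OfFamily F).D) (i : Fin (stage3OfFamily F).D), Y (b.1, b.2 + (((M₁ * (stage3OfFamily F).L) : ℤ) / ((stage3OfFamily F).L : ℤ) ^ (b.1 : ℕ)) • B7Prop1Explicit.e i) = Y b) →
      ∀ (j : ℕ) (hj : j ≤ n) (y : B7Prop1Explicit.Site (stage3OfFamily F).D), y ∈ a.toZdIdx.Λs n j →
      QprimeIter (zdBlocking (stage3OfFamily F).D (stage3OfFamily F).L) (bgT (stage3OfFamily F).L U₀) j (H' Y) y = Y (⟨j, Nat.lt_succ_of_le hj⟩, y)) ∧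
        (∀ (f : B7Prop1Explicit.Site (stage3OfFamily F).D → (stage3OfFamily F).𝔸) (r : ℝ), 0 ≤ r → Bd2 (stage3OfFamily F).L a.toZdIdx.η n a.toZdIdx.Ω f r →
      (∀ x, ‖g f x‖ ≤ BG * r) ∧ ∀ j, j ≤ n → ∀ b ∈ {b : B7Prop1Explicit.Site (stage3OfFamily F).D × Fin (stage3OfFamily F).D | SideTouches (a.toZdIdx.Ω j) b.1 b.2},
        wt (stage3OfFamily F).L a.toZdIdx.η j * ‖covDerivFwd a.toZdIdx.η U₀ b.2 (g f) b.1‖ ≤ BG * r) ∧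
        (∀ (f : B7Prop1Explicit.Site (stage3OfFamily F).D → (stage3OfFamily F).𝔸) (x : B7Prop1Explicit.Site (stage3OfFamily F).D), x ∉ a.toZdIdx.Ω 0 → g f x = 0) ∧
        (∀ f : B7Prop1Explicit.Site (stage3OfFamily F).D → (stage3OfFamily F).𝔸, (∀ j, j ≤ n → ∀ x ∈ a.toZdIdx.Ω j, IsSelfAdjoint (f x)) → ∀ x, IsSelfAdjoint (g f x)) ∧
        (∀ (f : B7Prop1Explicit.Site (stage3OfFamily F).D → (stage3OfFamily F).𝔸) (r : ℝ), 0 ≤ r → Bd2 (stage3OfFamily F).L a.toZdIdx.η n a.toZdIdx.Ω f r → Bd2 (stage3OfFamily F).L a.toZdIdx.η n a.toZdIdx.Ω (f - g (qs (c (q (g f))))) (BR * r)) ∧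
        (∀ f : B7Prop1Explicit.Site (stage3OfFamily F).D → (stage3OfFamily F).𝔸, (∀ j, j ≤ n → ∀ x ∈ a.toZdIdx.Ω j, IsSelfAdjoint (f x)) →
      ∀ j, j ≤ n → ∀ x ∈ a.toZdIdx.Ω j, IsSelfAdjoint ((f - g (qs (c (q (g f))))) x))) ∧
        (∀ a : IdxB8LanCκPer (stage3OfFamily F) (M₁ * (stage3OfFamily F).L) M₁ R, ∀ α₀ : ℝ, 0 < α₀ → α₀ ≤ cL → InAk (stage3OfFamily F).L a.toZdLanIdx.k a.toZdLanIdx.η α₀ a.toZdLanIdx.Ω a.toZdLanIdx.U₀ →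
      ∃ (g Δ : (B7Prop1Explicit.Site (stage3OfFamily F).D → (stage3OfFamily F).𝔸) →ₗ[ℂ] (B7Prop1Explicit.Site (stage3OfFamily F).D → (stage3OfFamily F).𝔸)) (q : (B7Prop1Explicit.Site (stage3OfFamily F).D → (stage3OfFamily F).𝔸) →ₗ[ℂ] (ℕ → B7Prop1Explicit.Site (stage3OfFamily F).D → (stage3OfFamily F).𝔸)) (qs : (ℕ → B7Prop1Explicit.Site (stage3OfFamily F).D → (stage3OfFamily F).𝔸) →ₗ[ℂ] (B7Prop1Explicit.Site (stage3OfFamily F).D → (stage3OfFamily F).𝔸))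
        (Aw c : (ℕ → B7Prop1Explicit.Site (stage3OfFamily F).D → (stage3OfFamily F).𝔸) →ₗ[ℂ] (ℕ → B7Prop1Explicit.Site (stage3OfFamily F).D → (stage3OfFamily F).𝔸)) (H' : XSpace (stage3OfFamily F).D a.toZdLanIdx.k (stage3OfFamily F).𝔸 →ₗ[ℂ] (B7Prop1Explicit.Site (stage3OfFamily F).D → (stage3OfFamily F).𝔸)),
        (∀ x : B7Prop1Explicit.Site (stage3OfFamily F).D → (stage3OfFamily F).𝔸, (∀ (z : B7Prop1Explicit.Site (stage3OfFamily F).D) (i : Fin (stage3OfFamily F).D), x (z + ((M₁ * (stage3OfFamily F).L) : ℤ) • B7Prop1Explicit.e i) = x z) → (∃ C : ℝ, ∀ y, ‖x y‖ ≤ C) →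
          g (Δ x + qs (Aw (q x))) = x) ∧
        (∀ φ : ℕ → B7Prop1Explicit.Site (stage3OfFamily F).D → (stage3OfFamily F).𝔸, (∀ n, n ≤ a.toZdLanIdx.k → ∀ (y : B7Prop1Explicit.Site (stage3OfFamily F).D) (i : Fin (stage3OfFamily F).D), φ n (y + (((M₁ * (stage3OfFamily F).L) : ℤ) / ((stage3OfFamily F).L : ℤ) ^ n) • B7Prop1Explicit.e i) = φ n y) →
          qs (c (q (g (g (qs φ))))) = qs φ) ∧
        (∀ (f : B7Prop1Explicit.Site (stage3OfFamily F).D → (stage3OfFamily F).𝔸), ∀ x ∈ a.toZdLanIdx.Ω 0, Δ f x = covLap a.toZdLanIdx.η a.toZdLanIdx.U₀ ((a.toZdLanIdx.Ω 0).indicator f) x) ∧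
        (∀ (μ : ℕ → B7Prop1Explicit.Site (stage3OfFamily F).D → (stage3OfFamily F).𝔸), ∀ x ∈ a.toZdLanIdx.Ω 0, qs μ x = QT (stage3OfFamily F).L a.toZdLanIdx.k a.toZdLanIdx.Λ a.toZdLanIdx.U₀ μ x) ∧
        (∀ (f : B7Prop1Explicit.Site (stage3OfFamily F).D → (stage3OfFamily F).𝔸) (n : ℕ), n ≤ a.toZdLanIdx.k → ∀ y ∈ a.toZdLanIdx.Λ n, q f n y = QprimeIter (zdBlocking (stage3OfFamily F).D (stage3OfFamily F).L) (bgT (stage3OfFamily F).L a.toZdLanIdx.U₀) n f y) ∧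
        (∀ (f : B7Prop1Explicit.Site (stage3OfFamily F).D → (stage3OfFamily F).𝔸) (n : ℕ) (y : B7Prop1Explicit.Site (stage3OfFamily F).D), ¬ (n ≤ a.toZdLanIdx.k ∧ y ∈ a.toZdLanIdx.Λ n) → q f n y = 0) ∧
        (∀ (f : B7Prop1Explicit.Site (stage3OfFamily F).D → (stage3OfFamily F).𝔸) (z : B7Prop1Explicit.Site (stage3OfFamily F).D) (i : Fin (stage3OfFamily F).D), g f (z + ((M₁ * (stage3OfFamily F).L) : ℤ) • B7Prop1Explicit.e i) = g f z) ∧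
        (∀ μ : ℕ → B7Prop1Explicit.Site (stage3OfFamily F).D → (stage3OfFamily F).𝔸, ∀ n, n ≤ a.toZdLanIdx.k → ∀ (y : B7Prop1Explicit.Site (stage3OfFamily F).D) (i : Fin (stage3OfFamily F).D), Aw μ n (y + (((M₁ * (stage3OfFamily F).L) : ℤ) / ((stage3OfFamily F).L : ℤ) ^ n) • B7Prop1Explicit.e i) = Aw μ n y) ∧
        (∀ (X : XSpace (stage3OfFamily F).D a.toZdLanIdx.k (stage3OfFamily F).𝔸) (x : B7Prop1Explicit.Site (stage3OfFamily F).D), ‖H' X x‖ ≤ B₀'H * ‖X‖) ∧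
        (∀ n, n ≤ a.toZdLanIdx.k → ∀ (X : XSpace (stage3OfFamily F).D a.toZdLanIdx.k (stage3OfFamily F).𝔸), ∀ b ∈ {b : B7Prop1Explicit.Site (stage3OfFamily F).D × Fin (stage3OfFamily F).D | SideTouches (a.toZdLanIdx.Ω n) b.1 b.2},
          wt (stage3OfFamily F).L a.toZdLanIdx.η n * ‖covDerivFwd a.toZdLanIdx.η a.toZdLanIdx.U₀ b.2 (H' X) b.1‖ ≤ B₀'H * ‖X‖) ∧
        (∀ X : XSpace (stage3OfFamily F).D a.toZdLanIdx.k (stage3OfFamily F).𝔸, Bd2 (stage3OfFamily F).L a.toZdLanIdx.η a.toZdLanIdx.k a.toZdLanIdx.Ω (covLap a.toZdLanIdx.η a.toZdLanIdx.U₀ (H' X)) (B₂' * ‖X‖)) ∧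
        (∀ X : XSpace (stage3OfFamily F).D a.toZdLanIdx.k (stage3OfFamily F).𝔸, (∀ (q : Fin (a.toZdLanIdx.k + 1) × B7Prop1Explicit.Site (stage3OfFamily F).D) (i : Fin (stage3OfFamily F).D), X (q.1, q.2 + (((M₁ * (stage3OfFamily F).L) : ℤ) / ((stage3OfFamily F).L : ℤ) ^ (q.1 : ℕ)) • B7Prop1Explicit.e i) = X q) →
          ∀ (z : B7Prop1Explicit.Site (stage3OfFamily F).D) (i : Fin (stage3OfFamily F).D), H' X (z + ((M₁ * (stage3OfFamily F).L) : ℤ) • B7Prop1Explicit.e i) = H' X z) ∧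
        (∀ (Y : XSpace (stage3OfFamily F).D a.toZdLanIdx.k (stage3OfFamily F).𝔸), (∀ (q : Fin (a.toZdLanIdx.k + 1) × B7Prop1Explicit.Site (stage3OfFamily F).D) (i : Fin (stage3OfFamily F).D), Y (q.1, q.2 + (((M₁ * (stage3OfFamily F).L) : ℤ) / ((stage3OfFamily F).L : ℤ) ^ (q.1 : ℕ)) • B7Prop1Explicit.e i) = Y q) →
          ∀ (n : ℕ) (hn : n ≤ a.toZdLanIdx.k) (y : B7Prop1Explicit.Site (stage3OfFamily F).D), y ∈ a.toZdLanIdx.Λ n →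
          QprimeIter (zdBlocking (stage3OfFamily F).D (stage3OfFamily F).L) (bgT (stage3OfFamily F).L a.toZdLanIdx.U₀) n (H' Y) y = Y (⟨n, Nat.lt_succ_of_le hn⟩, y)) ∧
        (∀ (f : B7Prop1Explicit.Site (stage3OfFamily F).D → (stage3OfFamily F).𝔸) (r : ℝ), 0 ≤ r → Bd2 (stage3OfFamily F).L a.toZdLanIdx.η a.toZdLanIdx.k a.toZdLanIdx.Ω f r →
          (∀ x, ‖g f x‖ ≤ BG * r) ∧ ∀ n, n ≤ a.toZdLanIdx.k → ∀ b ∈ {b : B7Prop1Explicit.Site (stage3OfFamily F).D × Fin (stage3OfFamily F).D | SideTouches (a.toZdLanIdx.Ω n) b.1 b.2},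
            wt (stage3OfFamily F).L a.toZdLanIdx.η n * ‖covDerivFwd a.toZdLanIdx.η a.toZdLanIdx.U₀ b.2 (g f) b.1‖ ≤ BG * r) ∧
        (∀ (f : B7Prop1Explicit.Site (stage3OfFamily F).D → (stage3OfFamily F).𝔸) (r : ℝ), 0 ≤ r → Bd2 (stage3OfFamily F).L a.toZdLanIdx.η a.toZdLanIdx.k a.toZdLanIdx.Ω f r →
          Bd2 (stage3OfFamily F).L a.toZdLanIdx.η a.toZdLanIdx.k a.toZdLanIdx.Ω (f - g (qs (c (q (g f))))) (BR * r))))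
    -- NODE N06's LEAF: dag-n06-d's Stage-11 certificate b9LeafXUR_opsYNuOfRecordV6E_pairVQ — its binders VERBATIM (N := 2, θ.toStage3Params := stage3OfFamily F), Skolemised in F
    (Mstar : ∀ F : T4Family, ℕ) (𝔯 : ∀ F : T4Family, ResY 2 (stage3OfFamily F) (Mstar F)) (h𝔯 : ∀ F : T4Family, (𝔯 F) = resYOfRecordP 2 (stage3OfFamily F) (Mstar F)) (𝔢₀ : ∀ F : T4Family, SectEY 2 (stage3OfFamily F) (Mstar F)) (𝔴 : ∀ F : T4Family, RWEY 2 (stage3OfFamily F) (Mstar F)) (𝔈 : ∀ F : T4Family, ExpsY 2 (stage3OfFamily F) (Mstar F)) (𝔈₀ : ∀ F : T4Family, ExpsY 2 (stage3OfFamily F) (Mstar F)) (R₁ R₂ : ∀ F : T4Family, RegFamY (stage3OfFamily F).d₆ (stage3OfFamily F).ℓ₆ (stage3OfFamily F).hd' (stage3OfFamily F).hL' (stage3OfFamily F).b₀ (stage3OfFamily F).b₁ (Mstar F) (Matrix (Fin 2) (Fin 2) ℂ)) (c : ∀ F : T4Family, ℝ) (hcB : ∀ F : T4Family, c35B (stage3OfFamily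 F).ℓ₆ ≤ (c F)) (hc : ∀ F : T4Family, 0 < (c F)) (hGR : ∀ F : T4Family, MemOfFam (specialUnitaryUnits (Fin 2)) (R₁ F)) (hRP1 : ∀ F : T4Family, ∀ (x : MemberY (stage3OfFamily F).d₆ (stage3OfFamily F).ℓ₆ (stage3OfFamily F).hd' (stage3OfFamily F).hL' (stage3OfFamily F).b₀ (stage3OfFamily F).b₁ (Mstar F)) (α₀ : ℝ) (U : (bg9YR (Matrix (Fin 2) (Fin 2) ℂ) (specialUnitaryUnits (Fin 2)) (R₁ F) (R₂ F) x).Cfg), (bg9YR (Matrix (Fin 2) (Fin 2) ℂ) (specialUnitaryUnits (Fin 2)) (R₁ F) (R₂ F) x).Reg335 (c F) α₀ U → 0 ≤ α₀ ∧ (bg9YP (Matrix (Fin 2) (Fin 2) ℂ) (specialUnitaryUnits (Fin 2)) x).Reg335 c35Y α₀ U) (hRP2 : ∀ F : T4Family, ∀ (x : MemberY (stage3OfFamily F).d₆ (stage3OfFamily F).ℓ₆ (stage3OfFamily F).hd' (stage3OfFamily F).hL' (stage3OfFamily F).b₀ (stage3OfFamily F).b₁ (Mstar F)) (α₀ : ℝ)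 (U : (bg9YR (Matrix (Fin 2) (Fin 2) ℂ) (specialUnitaryUnits (Fin 2)) (R₁ F) (R₂ F) x).Cfg), (bg9YR (Matrix (Fin 2) (Fin 2) ℂ) (specialUnitaryUnits (Fin 2)) (R₁ F) (R₂ F) x).Reg336 (c F) α₀ U → 0 ≤ α₀ ∧ (bg9YP (Matrix (Fin 2) (Fin 2) ℂ) (specialUnitaryUnits (Fin 2)) x).Reg336 c35Y α₀ U) (hP1 : ∀ F : T4Family, ClassIncl (regYP335 (Matrix (Fin 2) (Fin 2) ℂ) (specialUnitaryUnits (Fin 2))) c35Y (R₁ F) (c F)) (hP2 : ∀ F : T4Family, ClassIncl (regYP336 (Matrix (Fin 2) (Fin 2) ℂ) (specialUnitaryUnits (Fin 2))) c35Y (R₂ F) (c F)) (instN06_1 : ∀ F : T4Family, ∀ x : MemberY (stage3OfFamily F).d₆ (stage3OfFamily F).ℓ₆ (stage3OfFamily F).hd' (stage3OfFamily F).hL' (stage3OfFamily F).b₀ (stage3OfFamily F).b₁ (Mstar F), Fintype (geo9Y x).Site)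
    (instN06_2 : ∀ F : T4Family, ∀ x : MemberY (stage3OfFamily F).d₆ (stage3OfFamily F).ℓ₆ (stage3OfFamily F).hd' (stage3OfFamily F).hL' (stage3OfFamily F).b₀ (stage3OfFamily F).b₁ (Mstar F), DecidableEq (geo9Y x).Site) (instN06_3 : ∀ F : T4Family, ∀ x : MemberY (stage3OfFamily F).d₆ (stage3OfFamily F).ℓ₆ (stage3OfFamily F).hd' (stage3OfFamily F).hL' (stage3OfFamily F).b₀ (stage3OfFamily F).b₁ (Mstar F), Fintype (geoBY x).Site) (instN06_4 : ∀ F : T4Family, ∀ x : MemberY (stage3OfFamily F).d₆ (stage3OfFamily F).ℓ₆ (stage3OfFamily F).hd' (stage3OfFamily F).hL' (stage3OfFamily F).b₀ (stage3OfFamily F).b₁ (Mstar F), DecidableRel (RelB x.toKIdx)) (bI : ∀ F : T4Family, ∀ x : MemberY (stage3OfFamily F).d₆ (stage3OfFamily F).ℓ₆ (stage3OfFamily F).hd' (stage3OfFamily F).hL' (stage3OfFamily F).b₀ (stage3OfFamily F).b₁ (Mstar F), FBondY x.toKIdx → IBondY x.toKIdx) (hbI : ∀ F : T4Family, (bI F)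 = bIYOfRecord (stage3OfFamily F) (Mstar F)) (α' r39 δ39 B39 a39 M39 : ∀ F : T4Family, ℝ) (hα'0 : ∀ F : T4Family, 0 < (α' F)) (hα'1 : ∀ F : T4Family, (α' F) < 1) (hr39 : ∀ F : T4Family, 0 < (r39 F)) (hrδ39 : ∀ F : T4Family, (r39 F) ≤ (δ39 F)) (hB39 : ∀ F : T4Family, 0 < (B39 F)) (ha39 : ∀ F : T4Family, 0 < (a39 F)) (hM39 : ∀ F : T4Family, 0 < (M39 F)) (h348 : ∀ F : T4Family, ∀ x : MemberY (stage3OfFamily F).d₆ (stage3OfFamily F).ℓ₆ (stage3OfFamily F).hd' (stage3OfFamily F).hL' (stage3OfFamily F).b₀ (stage3OfFamily F).b₁ (Mstar F), (M39 F) ≤ (geo9Y x).M → ∀ α₀ : ℝ, 0 < α₀ → (c F) * (geo9Y x).M * α₀ ≤ (a39 F) → ∀ U : (bg9YR (Matrix (Fin 2) (Fin 2) ℂ) (specialUnitaryUnits (Fin 2)) (R₁ F) (R₂ F) x).Cfg, (bg9YR (Matrix (Fin 2) (Fin 2) ℂ) (specialUnitaryUnits (Fin 2)) (R₁ F) (R₂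 F) x).Reg335 (c F) α₀ U → Conv348Blk (oneCubeOps39YF (stage3OfFamily F) (Mstar F) (lettersYOfRecordV4P 2 (stage3OfFamily F) (Mstar F) (𝔯 F)) (bI F) x) (B39 F) (δ39 F) U) (ιA AA : ∀ F : T4Family, MemberY (stage3OfFamily F).d₆ (stage3OfFamily F).ℓ₆ (stage3OfFamily F).hd' (stage3OfFamily F).hL' (stage3OfFamily F).b₀ (stage3OfFamily F).b₁ (Mstar F) → Type) (instN06_5 : ∀ F : T4Family, ∀ x, Fintype ((ιA F) x)) (instN06_6 : ∀ F : T4Family, ∀ x, Fintype ((AA F) x)) (p q : ∀ F : T4Family, PinPrims) (hp : ∀ F : T4Family, (p F).OK) (hq : ∀ F : T4Family, (q F).OK) (hα3 : ∀ F : T4Family, 3 * (p F).α ≤ (1 - (p F).αF) * (1 - 2 * (p F).α)) (p3 q3 : ∀ F : T4Family, PairPrims) (hp3 : ∀ F : T4Family, (p3 F).OK)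
    (hq3 : ∀ F : T4Family, (q3 F).OK) (pM qM : ∀ F : T4Family, MixedPrims) (hpM : ∀ F : T4Family, (pM F).OK) (hqM : ∀ F : T4Family, (qM F).OK) (H : ∀ F : T4Family, MemberY (stage3OfFamily F).d₆ (stage3OfFamily F).ℓ₆ (stage3OfFamily F).hd' (stage3OfFamily F).hL' (stage3OfFamily F).b₀ (stage3OfFamily F).b₁ (Mstar F) → Prop) (hM₀ : ∀ F : T4Family, nbrM₀Y (stage3OfFamily F).d₆ (stage3OfFamily F).ℓ₆ (stage3OfFamily F).hd' (stage3OfFamily F).hL' (stage3OfFamily F).b₀ (stage3OfFamily F).b₁ 2 ≤ (Mstar F)) (hM₀' : ∀ F : T4Family, nbrM₀Y (stage3OfFamily F).d₆ (stage3OfFamily F).ℓ₆ (stage3OfFamily F).hd' (stage3OfFamily F).hL' (stage3OfFamily F).b₀ (stage3OfFamily F).b₁ (((stage3OfFamily F).ℓ₆ : ℝ) + 4) ≤ (Mstar F)) (hM₀B : ∀ F : T4Family, nbrM₀Y (stage3OfFamily F).d₆ (stage3OfFamily F).ℓ₆ (stage3OfFamily F).hd' (stage3OfFamily F).hL' (stage3OfFamily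 F).b₀ (stage3OfFamily F).b₁ (2 * (((stage3OfFamily F).d₆ : ℝ) + 1)) ≤ (Mstar F)) (𝔭 : ∀ F : T4Family, ∀ x : MemberY (stage3OfFamily F).d₆ (stage3OfFamily F).ℓ₆ (stage3OfFamily F).hd' (stage3OfFamily F).hL' (stage3OfFamily F).b₀ (stage3OfFamily F).b₁ (Mstar F), HolderProbes (geo9Y x) (bg9YR (Matrix (Fin 2) (Fin 2) ℂ) (specialUnitaryUnits (Fin 2)) (R₁ F) (R₂ F) x) (XSK (TrIdx 2) x.toKIdx) (XSK (TrIdx 2) x.toKIdx) (PK (SiteY x.toKIdx) (Fin ((stage3OfFamily F).d₆ + 1)) (TrIdx 2)) (PK (SiteY x.toKIdx) (Fin ((stage3OfFamily F).d₆ + 1)) (TrIdx 2))) (h𝔭 : ∀ F : T4Family, ∀ x : MemberY (stage3OfFamily F).d₆ (stage3OfFamily F).ℓ₆ (stage3OfFamily F).hd' (stage3OfFamily F).hL' (stage3OfFamily F).b₀ (stage3OfFamily F).b₁ (Mstar F), (𝔭 F) x = holderProbesSN x.toKIdx (trBasis 2) (bg9YR (Matrix (Fin 2) (Fin 2) ℂ)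 (specialUnitaryUnits (Fin 2)) (R₁ F) (R₂ F) x) (fun U => U) (lettersYOfRecordV4P 2 (stage3OfFamily F) (Mstar F) (𝔯 F) x).parS ((bI F) x)) (bHX : ∀ F : T4Family, ∀ x : MemberY (stage3OfFamily F).d₆ (stage3OfFamily F).ℓ₆ (stage3OfFamily F).hd' (stage3OfFamily F).hL' (stage3OfFamily F).b₀ (stage3OfFamily F).b₁ (Mstar F), ℝ → BlockNorm (toB6 (geo9Y x) 1 ((H F) x)) ((XSK (TrIdx 2) x.toKIdx) → ℝ))
    (hbHX : ∀ F : T4Family, ∀ x : MemberY (stage3OfFamily F).d₆ (stage3OfFamily F).ℓ₆ (stage3OfFamily F).hd' (stage3OfFamily F).hL' (stage3OfFamily F).b₀ (stage3OfFamily F).b₁ (Mstar F), (bHX F) x = fun ε => letI : Fintype (B9GeoNormsKLevelV1.geo9K x.toKIdx).Site := (inferInstance : Fintype (geo9Y x).Site); bHS x.toKIdx (sIK x.toKIdx ((bI F) x)) ε) (SH S3 SI : ∀ F : T4Family, ∀ x : MemberY (stage3OfFamily F).d₆ (stage3OfFamily F).ℓ₆ (stage3OfFamily F).hd' (stage3OfFamily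 F).hL' (stage3OfFamily F).b₀ (stage3OfFamily F).b₁ (Mstar F), ↥(cubes x.toKIdx.D.toDomains) → Finset (geo9Y x).Site) (Bc : ∀ F : T4Family, ℝ) (hBc : ∀ F : T4Family, 0 ≤ (Bc F)) (hM₀N : ∀ F : T4Family, nbrM₀BY (stage3OfFamily F).d₆ (stage3OfFamily F).ℓ₆ (stage3OfFamily F).hd' (stage3OfFamily F).hL' (stage3OfFamily F).b₀ (stage3OfFamily F).b₁ 1 ≤ (Mstar F)) (hB₀ge : ∀ F : T4Family, (nbrCountBY (stage3OfFamily F).d₆ (stage3OfFamily F).ℓ₆ (stage3OfFamily F).hd' (stage3OfFamily F).hL' (stage3OfFamily F).b₀ (stage3OfFamily F).b₁ 1 : ℝ) * Real.exp (2 * (p F).δ₀) * (cR39 (trBasis 2) * (Bc F)) ≤ (p F).B₀)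
    (h36b : ∀ F : T4Family, ∀ x, (p F).M₁ ≤ (geo9Y x).M → ∀ α₀ : ℝ, 0 < α₀ → (c F) * (geo9Y x).M * α₀ ≤ (p F).a₁ → ∀ U : (bg9YR (Matrix (Fin 2) (Fin 2) ℂ) (specialUnitaryUnits (Fin 2)) (R₁ F) (R₂ F) x).Cfg, (bg9YR (Matrix (Fin 2) (Fin 2) ℂ) (specialUnitaryUnits (Fin 2)) (R₁ F) (R₂ F) x).Reg335 (c F) α₀ U → (∀ c', HasMajorant (g := toB6 (geoBY x) 1 ((H F) x)) (fun p' : SiteY x.toKIdx × TrIdx 2 => blkOf x.toKIdx.D.toDomains p'.1) (conj (trBasis 2) ((etaS x.toKIdx ^ 2) • (GsqY x.toKIdx (parSymY x.toKIdx) (cubeDomY x c') U).restrictScalars ℝ)) (fun s s' => (Bc F) * (geoBY x).len s ^ 2 * Real.exp (-((p F).δ₀ * (geoBY x).dist s s')))) ∧ (∀ c' (μ : Fin ((stage3OfFamily F).d₆ + 1)), HasMajorant (g := toB6 (geoBY x) 1 ((H F) x)) (fun p' : SiteY x.toKIdx × TrIdx 2 => blkOf x.toKIdx.D.toDomains p'.1)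 (conj (trBasis 2) (diffLetter (shiftY x.toKIdx) (UboxY x.toKIdx U) (((etaS x.toKIdx : ℂ))⁻¹) (Sum.inl μ)) * conj (trBasis 2) ((etaS x.toKIdx ^ 2) • (GsqY x.toKIdx (parSymY x.toKIdx) (cubeDomY x c') U).restrictScalars ℝ)) (fun s s' => (Bc F) * (geoBY x).len s * Real.exp (-((p F).δ₀ * (geoBY x).dist s s')))) ∧ (∀ c' (μ : Fin ((stage3OfFamily F).d₆ + 1)), HasMajorant (g := toB6 (geoBY x) 1 ((H F) x)) (fun p' : SiteY x.toKIdx × TrIdx 2 => blkOf x.toKIdx.D.toDomains p'.1) (conj (trBasis 2) ((etaS x.toKIdx ^ 2) • (GsqY x.toKIdx (parSymY x.toKIdx) (cubeDomY x c') U).restrictScalars ℝ) * conj (trBasis 2) (diffLetter (shiftY x.toKIdx) (UboxY x.toKIdx U) (((etaS x.toKIdx : ℂ))⁻¹) (Sum.inr μ))) (fun s s' => (Bc F) * (geoBY x).len s * Real.exp (-((p F).δ₀ * (geoBY x).dist s s')))) ∧ (∀ c', HasMajorant (g := toB6 (geoBY x) 1 ((H F) x)) (fun p' : SiteY x.toKIdx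 × TrIdx 2 => blkOf x.toKIdx.D.toDomains p'.1) (conj (trBasis 2) (((etaS x.toKIdx ^ 2)⁻¹) • (lapSL x.toKIdx U).restrictScalars ℝ) * conj (trBasis 2) ((etaS x.toKIdx ^ 2) • (GsqY x.toKIdx (parSymY x.toKIdx) (cubeDomY x c') U).restrictScalars ℝ)) (fun s s' => (Bc F) * 1 * Real.exp (-((p F).δ₀ * (geoBY x).dist s s')))))
    (h36H : ∀ F : T4Family, ∀ x, (p F).M₁ ≤ (geo9Y x).M → ∀ α₀ : ℝ, 0 < α₀ → (c F) * (geo9Y x).M * α₀ ≤ (p F).a₁ → ∀ U : (bg9YR (Matrix (Fin 2) (Fin 2) ℂ) (specialUnitaryUnits (Fin 2)) (R₁ F) (R₂ F) x).Cfg, (bg9YR (Matrix (Fin 2) (Fin 2) ℂ) (specialUnitaryUnits (Fin 2)) (R₁ F) (R₂ F) x).Reg335 (c F) α₀ U → HolderLegs37 (opsWalkY x (trBasis 2) (bg9YR (Matrix (Fin 2) (Fin 2) ℂ) (specialUnitaryUnits (Fin 2)) (R₁ F) (R₂ F) x) (fun U => U) (parSymY x.toKIdx) ((bI F) x)) ((𝔭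 F) x) 1 ((H F) x) ((SH F) x) (p F).Bl (p F).δ₀ U ∧ HolderV37Dir (opsWalkY x (trBasis 2) (bg9YR (Matrix (Fin 2) (Fin 2) ℂ) (specialUnitaryUnits (Fin 2)) (R₁ F) (R₂ F) x) (fun U => U) (parSymY x.toKIdx) ((bI F) x)) (dirOpsWalkY x (trBasis 2) (bg9YR (Matrix (Fin 2) (Fin 2) ℂ) (specialUnitaryUnits (Fin 2)) (R₁ F) (R₂ F) x) (fun U => U) (parSymY x.toKIdx) ((bI F) x)) (dirLettersWalkY x (trBasis 2) (bg9YR (Matrix (Fin 2) (Fin 2) ℂ) (specialUnitaryUnits (Fin 2)) (R₁ F) (R₂ F) x) (fun U => U) (parSymY x.toKIdx) ((bI F) x)) ((𝔭 F) x) 1 ((H F) x) (p F).Bt (p F).δ₀ U ∧ (L2SecondLegs37 (opsWalkY x (trBasis 2) (bg9YR (Matrix (Fin 2) (Fin 2) ℂ) (specialUnitaryUnits (Fin 2)) (R₁ F) (R₂ F) x) (fun U => U) (parSymY x.toKIdx) ((bI F) x)) (dirOpsWalkY x (trBasis 2) (bg9YR (Matrix (Fin 2) (Fin 2) ℂ)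 (specialUnitaryUnits (Fin 2)) (R₁ F) (R₂ F) x) (fun U => U) (parSymY x.toKIdx) ((bI F) x)) 1 ((H F) x) ((S3 F) x) (p3 F).B3 (p F).δ₀ U ∧ (∀ q' μ, IsTransposePair ((dirLettersWalkY x (trBasis 2) (bg9YR (Matrix (Fin 2) (Fin 2) ℂ) (specialUnitaryUnits (Fin 2)) (R₁ F) (R₂ F) x) (fun U => U) (parSymY x.toKIdx) ((bI F) x)).Pt U q' μ) ((dirLettersWalkY x (trBasis 2) (bg9YR (Matrix (Fin 2) (Fin 2) ℂ) (specialUnitaryUnits (Fin 2)) (R₁ F) (R₂ F) x) (fun U => U) (parSymY x.toKIdx) ((bI F) x)).P U q' μ)) ∧ (∀ q', IsTransposePair ((opsWalkY x (trBasis 2) (bg9YR (Matrix (Fin 2) (Fin 2) ℂ) (specialUnitaryUnits (Fin 2)) (R₁ F) (R₂ F) x) (fun U => U) (parSymY x.toKIdx) ((bI F) x)).Ct U q') ((opsWalkY x (trBasis 2) (bg9YR (Matrix (Fin 2) (Fin 2) ℂ) (specialUnitaryUnits (Fin 2)) (R₁ F) (R₂ F) x) (fun U => U) (parSymY x.toKIdx)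 ((bI F) x)).Cop U q'))) ∧ (InputLegsPair37 (opsWalkY x (trBasis 2) (bg9YR (Matrix (Fin 2) (Fin 2) ℂ) (specialUnitaryUnits (Fin 2)) (R₁ F) (R₂ F) x) (fun U => U) (parSymY x.toKIdx) ((bI F) x)) (dirOpsWalkY x (trBasis 2) (bg9YR (Matrix (Fin 2) (Fin 2) ℂ) (specialUnitaryUnits (Fin 2)) (R₁ F) (R₂ F) x) (fun U => U) (parSymY x.toKIdx) ((bI F) x)) ((𝔭 F) x) 1 ((H F) x) ((bHX F) x) ((SI F) x) (p F).BI (p F).BI2 (p F).δ₀ U ∧ FactorsInputPair37Dir (opsWalkY x (trBasis 2) (bg9YR (Matrix (Fin 2) (Fin 2) ℂ) (specialUnitaryUnits (Fin 2)) (R₁ F) (R₂ F) x) (fun U => U) (parSymY x.toKIdx) ((bI F) x)) (dirOpsWalkY x (trBasis 2) (bg9YR (Matrix (Fin 2) (Fin 2) ℂ) (specialUnitaryUnits (Fin 2)) (R₁ F) (R₂ F) x) (fun U => U) (parSymY x.toKIdx) ((bI F) x)) (dirLettersWalkY x (trBasis 2) (bg9YR (Matrix (Fin 2) (Fin 2)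 ℂ) (specialUnitaryUnits (Fin 2)) (R₁ F) (R₂ F) x) (fun U => U) (parSymY x.toKIdx) ((bI F) x)) 1 ((H F) x) ((bHX F) x) (p F).θI (p F).δ₀ U))
    (bHXT : ∀ F : T4Family, ∀ x : MemberY (stage3OfFamily F).d₆ (stage3OfFamily F).ℓ₆ (stage3OfFamily F).hd' (stage3OfFamily F).hL' (stage3OfFamily F).b₀ (stage3OfFamily F).b₁ (Mstar F), (bg9YR (Matrix (Fin 2) (Fin 2) ℂ) (specialUnitaryUnits (Fin 2)) (R₁ F) (R₂ F) x).Cfg → ℝ → BlockNorm (toB6 (geo9Y x) 1 ((H F) x)) ((XSK (TrIdx 2) x.toKIdx) → ℝ)) (hbHXT : ∀ F : T4Family, ∀ (x : MemberY (stage3OfFamily F).d₆ (stage3OfFamily F).ℓ₆ (stage3OfFamily F).hd' (stage3OfFamily F).hL' (stage3OfFamily F).b₀ (stage3OfFamily F).b₁ (Mstar F)) (U : (bg9YR (Matrix (Fin 2) (Fin 2) ℂ) (specialUnitaryUnits (Fin 2)) (R₁ F) (R₂ F) x).Cfg), (bHXT F) x U = fun ε => letI : Fintype (B9GeoNormsKLevelV1.geo9K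 x.toKIdx).Site := (inferInstance : Fintype (geo9Y x).Site); bHZPIfam (κ := TrIdx 2) x.toKIdx (trBasis 2) (taxiS x.toKIdx (bg9YR (Matrix (Fin 2) (Fin 2) ℂ) (specialUnitaryUnits (Fin 2)) (R₁ F) (R₂ F) x) (fun U => U) U) (R := (1 : ℝ)) (H := (H F) x) ε) (hopI : ∀ F : T4Family, ∀ x, (p F).M₁ ≤ (geo9Y x).M → ∀ α₀ : ℝ, 0 < α₀ → (c F) * (geo9Y x).M * α₀ ≤ (p F).a₁ → ∀ U : (bg9YR (Matrix (Fin 2) (Fin 2) ℂ) (specialUnitaryUnits (Fin 2)) (R₁ F) (R₂ F) x).Cfg, (bg9YR (Matrix (Fin 2) (Fin 2) ℂ) (specialUnitaryUnits (Fin 2)) (R₁ F) (R₂ F) x).Reg335 (c F) α₀ U → InputLegsPair37 (opsWalkY x (trBasis 2) (bg9YR (Matrix (Fin 2) (Fin 2) ℂ) (specialUnitaryUnits (Fin 2)) (R₁ F) (R₂ F) x) (fun U => U) (parSymY x.toKIdx) ((bI F) x)) (dirOpsWalkY x (trBasis 2) (bg9YR (Matrix (Fin 2) (Fin 2) ℂ)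 (specialUnitaryUnits (Fin 2)) (R₁ F) (R₂ F) x) (fun U => U) (parSymY x.toKIdx) ((bI F) x)) ((𝔭 F) x) 1 ((H F) x) ((bHXT F) x U) ((SI F) x) (p F).BI (p F).BI2 (p F).δ₀ U ∧ FactorsInputPair37Dir (opsWalkY x (trBasis 2) (bg9YR (Matrix (Fin 2) (Fin 2) ℂ) (specialUnitaryUnits (Fin 2)) (R₁ F) (R₂ F) x) (fun U => U) (parSymY x.toKIdx) ((bI F) x)) (dirOpsWalkY x (trBasis 2) (bg9YR (Matrix (Fin 2) (Fin 2) ℂ) (specialUnitaryUnits (Fin 2)) (R₁ F) (R₂ F) x) (fun U => U) (parSymY x.toKIdx) ((bI F) x)) (dirLettersWalkY x (trBasis 2) (bg9YR (Matrix (Fin 2) (Fin 2) ℂ) (specialUnitaryUnits (Fin 2)) (R₁ F) (R₂ F) x) (fun U => U) (parSymY x.toKIdx) ((bI F) x)) 1 ((H F) x) ((bHXT F) x U) (p F).θI (p F).δ₀ U) (hM1mix : ∀ F : T4Family, MMix (stage3OfFamily F).d₆ (stage3OfFamily F).ℓ₆ (stage3OfFamily F).hd' (stage3OfFamily F).hL'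 (stage3OfFamily F).b₀ (stage3OfFamily F).b₁ (Mstar F) 2 (c F) (hc F) ≤ (p F).M₁)
    (ha1mix : ∀ F : T4Family, (p F).a₁ ≤ aMix (stage3OfFamily F).d₆ (stage3OfFamily F).ℓ₆ (stage3OfFamily F).hd' (stage3OfFamily F).hL' (stage3OfFamily F).b₀ (stage3OfFamily F).b₁ (Mstar F) 2 (c F) (hc F)) (hBMmix : ∀ F : T4Family, BMix (stage3OfFamily F).d₆ (stage3OfFamily F).ℓ₆ (stage3OfFamily F).hd' (stage3OfFamily F).hL' (stage3OfFamily F).b₀ (stage3OfFamily F).b₁ (Mstar F) 2 (c F) (hc F) ≤ (pM F).BM) (hδmix : ∀ F : T4Family, (p F).δ₀ ≤ δMix (stage3OfFamily F).d₆ (stage3OfFamily F).ℓ₆ (stage3OfFamily F).hd' (stage3OfFamily F).hL' (stage3OfFamily F).b₀ (stage3OfFamily F).b₁ (Mstar F) 2 (c F) (hc F)) (hM1fac : ∀ F : T4Family, MRec (stage3OfFamily F).d₆ (stage3OfFamily F).ℓ₆ (stage3OfFamily F).hd' (stage3OfFamily F).hL' (stage3OfFamily F).b₀ (stage3OfFamily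 F).b₁ (Mstar F) 2 (c F) (hc F) ≤ (p F).M₁) (ha1fac : ∀ F : T4Family, (p F).a₁ ≤ aRec (stage3OfFamily F).d₆ (stage3OfFamily F).ℓ₆ (stage3OfFamily F).hd' (stage3OfFamily F).hL' (stage3OfFamily F).b₀ (stage3OfFamily F).b₁ (Mstar F) 2 (c F) (hc F)) (hδfac : ∀ F : T4Family, (p F).δ₀ ≤ δRec (stage3OfFamily F).d₆ (stage3OfFamily F).ℓ₆ (stage3OfFamily F).hd' (stage3OfFamily F).hL' (stage3OfFamily F).b₀ (stage3OfFamily F).b₁ (Mstar F) 2 (c F) (hc F)) (hθfac : ∀ F : T4Family, (p F).θ₀ * Real.exp ((3 / 4 + (p F).δ₀) * (p F).ρ) * BRec (stage3OfFamily F).d₆ (stage3OfFamily F).ℓ₆ (stage3OfFamily F).hd' (stage3OfFamily F).hL' (stage3OfFamily F).b₀ (stage3OfFamily F).b₁ (Mstar F) 2 (c F) (hc F) ≤ (pM F).θM) (hcntH : ∀ F : T4Family, ∀ x (a : (geo9Y x).Site), (∑ cᵢ, if a ∈ (SH F) x cᵢ then (1 : ℝ) else 0) ≤ (p F).NH) (hcnt3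 : ∀ F : T4Family, ∀ x (a : (geo9Y x).Site), (∑ cᵢ, if a ∈ (S3 F) x cᵢ then (1 : ℝ) else 0) ≤ (p3 F).N3) (hcntI : ∀ F : T4Family, ∀ x (a : (geo9Y x).Site), (∑ cᵢ, if a ∈ (SI F) x cᵢ then (1 : ℝ) else 0) ≤ (p F).NI) (hMw : ∀ F : T4Family, ∀ x : MemberY (stage3OfFamily F).d₆ (stage3OfFamily F).ℓ₆ (stage3OfFamily F).hd' (stage3OfFamily F).hL' (stage3OfFamily F).b₀ (stage3OfFamily F).b₁ (Mstar F), walkCntM₀Y (stage3OfFamily F).d₆ (stage3OfFamily F).ℓ₆ (stage3OfFamily F).hd' (stage3OfFamily F).hL' (stage3OfFamily F).b₀ (stage3OfFamily F).b₁ (Mstar F) ≤ (geo9Y x).M) (hNMw : ∀ F : T4Family, walkCntY (stage3OfFamily F).d₆ (stage3OfFamily F).ℓ₆ (stage3OfFamily F).hd' (stage3OfFamily F).hL' (stage3OfFamily F).b₀ (stage3OfFamily F).b₁ (Mstar F) ≤ (pM F).NM)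
    (hM3 : ∀ F : T4Family, nbrM₀Y (stage3OfFamily F).d₆ (stage3OfFamily F).ℓ₆ (stage3OfFamily F).hd' (stage3OfFamily F).hL' (stage3OfFamily F).b₀ (stage3OfFamily F).b₁ 3 ≤ (Mstar F)) (hρ3 : ∀ F : T4Family, 3 ≤ (p F).ρ) (hNc : ∀ F : T4Family, walkCntY (stage3OfFamily F).d₆ (stage3OfFamily F).ℓ₆ (stage3OfFamily F).hd' (stage3OfFamily F).hL' (stage3OfFamily F).b₀ (stage3OfFamily F).b₁ (Mstar F) ≤ (p F).Nc) (hN' : ∀ F : T4Family, walkCntY (stage3OfFamily F).d₆ (stage3OfFamily F).ℓ₆ (stage3OfFamily F).hd' (stage3OfFamily F).hL' (stage3OfFamily F).b₀ (stage3OfFamily F).b₁ (Mstar F) ≤ (p F).N') (hCℓ : ∀ F : T4Family, ((((stage3OfFamily F).ℓ₆ + 1 : ℕ) : ℝ)) ^ 2 ≤ (p F).Cℓ) (hKc : ∀ F : T4Family, KcWalkY (stage3OfFamily F).d₆ (stage3OfFamily F).ℓ₆ (stage3OfFamily F).hd' (stage3OfFamily F).hL' (stage3OfFamily F).b₀ (stage3OfFamily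 F).b₁ (trBasis 2) ≤ (p F).Kc) (hθ₀ : ∀ F : T4Family, thetaWalkY (stage3OfFamily F).d₆ (stage3OfFamily F).ℓ₆ (stage3OfFamily F).hd' (stage3OfFamily F).hL' (stage3OfFamily F).b₀ (stage3OfFamily F).b₁ (trBasis 2) (p F).Cℓ ≤ (p F).θ₀) (𝔬A : ∀ F : T4Family, ∀ x : MemberY (stage3OfFamily F).d₆ (stage3OfFamily F).ℓ₆ (stage3OfFamily F).hd' (stage3OfFamily F).hL' (stage3OfFamily F).b₀ (stage3OfFamily F).b₁ (Mstar F), Ops310 (geo9Y x) (bg9YR (Matrix (Fin 2) (Fin 2) ℂ) (specialUnitaryUnits (Fin 2)) (R₁ F) (R₂ F) x) (XBK (TrIdx 2) x.toKIdx) (XBK (TrIdx 2) x.toKIdx) ((ιA F) x) ((AA F) x)) (rdA : ∀ F : T4Family, ∀ x : MemberY (stage3OfFamily F).d₆ (stage3OfFamily F).ℓ₆ (stage3OfFamily F).hd' (stage3OfFamily F).hL' (stage3OfFamily F).b₀ (stage3OfFamily F).b₁ (Mstar F), WalkReading310 (geo9Y x) (bg9YR (Matrix (Fin 2) (Fin 2)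 ℂ) (specialUnitaryUnits (Fin 2)) (R₁ F) (R₂ F) x) (XBK (TrIdx 2) x.toKIdx) ((ιA F) x) ((AA F) x)) (𝔭A : ∀ F : T4Family, ∀ x : MemberY (stage3OfFamily F).d₆ (stage3OfFamily F).ℓ₆ (stage3OfFamily F).hd' (stage3OfFamily F).hL' (stage3OfFamily F).b₀ (stage3OfFamily F).b₁ (Mstar F), HolderProbes (geo9Y x) (bg9YR (Matrix (Fin 2) (Fin 2) ℂ) (specialUnitaryUnits (Fin 2)) (R₁ F) (R₂ F) x) (XBK (TrIdx 2) x.toKIdx) (XBK (TrIdx 2) x.toKIdx) (PK (FBondY x.toKIdx) (Fin ((stage3OfFamily F).d₆ + 1)) (TrIdx 2)) (PK (FBondY x.toKIdx) (Fin ((stage3OfFamily F).d₆ + 1)) (TrIdx 2)))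
    (h𝔭A : ∀ F : T4Family, ∀ x : MemberY (stage3OfFamily F).d₆ (stage3OfFamily F).ℓ₆ (stage3OfFamily F).hd' (stage3OfFamily F).hL' (stage3OfFamily F).b₀ (stage3OfFamily F).b₁ (Mstar F), (𝔭A F) x = holderProbesKA x.toKIdx (trBasis 2) (bg9YR (Matrix (Fin 2) (Fin 2) ℂ) (specialUnitaryUnits (Fin 2)) (R₁ F) (R₂ F) x) (fun U => U) (lettersYOfRecordV4P 2 (stage3OfFamily F) (Mstar F) (𝔯 F) x).parB ((bI F) x)) (𝔡A : ∀ F : T4Family, ∀ x : MemberY (stage3OfFamily F).d₆ (stage3OfFamily F).ℓ₆ (stage3OfFamily F).hd' (stage3OfFamily F).hL' (stage3OfFamily F).b₀ (stage3OfFamily F).b₁ (Mstar F), DirOps310 ((𝔬A F) x) (Fin ((stage3OfFamily F).d₆ + 1))) (𝔩A : ∀ F : T4Family, ∀ x : MemberY (stage3OfFamily F).d₆ (stage3OfFamily F).ℓ₆ (stage3OfFamily F).hd' (stage3OfFamily F).hL' (stage3OfFamily F).b₀ (stage3OfFamily F).b₁ (Mstar F), DirLetters310 ((𝔬A F) x)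 (Fin ((stage3OfFamily F).d₆ + 1))) (bHXA : ∀ F : T4Family, ∀ x : MemberY (stage3OfFamily F).d₆ (stage3OfFamily F).ℓ₆ (stage3OfFamily F).hd' (stage3OfFamily F).hL' (stage3OfFamily F).b₀ (stage3OfFamily F).b₁ (Mstar F), ℝ → BlockNorm (toB6 (geo9Y x) 1 ((H F) x)) ((XBK (TrIdx 2) x.toKIdx) → ℝ)) (κA : ∀ F : T4Family, MemberY (stage3OfFamily F).d₆ (stage3OfFamily F).ℓ₆ (stage3OfFamily F).hd' (stage3OfFamily F).hL' (stage3OfFamily F).b₀ (stage3OfFamily F).b₁ (Mstar F) → Sizes310) (SHA S3A SIA SMA S2A : ∀ F : T4Family, ∀ x : MemberY (stage3OfFamily F).d₆ (stage3OfFamily F).ℓ₆ (stage3OfFamily F).hd' (stage3OfFamily F).hL' (stage3OfFamily F).b₀ (stage3OfFamily F).b₁ (Mstar F), (ιA F) x → Finset (geo9Y x).Site) (hbHXA : ∀ F : T4Family, ∀ x : MemberY (stage3OfFamily F).d₆ (stage3OfFamily F).ℓ₆ (stage3OfFamily F).hd' (stage3OfFamily F).hL' (stage3OfFamily F).b₀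 (stage3OfFamily F).b₁ (Mstar F), (bHXA F) x = fun ε => letI : Fintype (B9GeoNormsKLevelV1.geo9K x.toKIdx).Site := (inferInstance : Fintype (geo9Y x).Site); bHK x.toKIdx ((bI F) x) ε) (hstA : ∀ F : T4Family, ∀ x, StaticOK310 ((𝔬A F) x) (q F).ρ (q F).Nc (q F).N' (q F).NF (q F).Cℓ ((κA F) x)) (hκA : ∀ F : T4Family, ∀ x, ((κA F) x).Bounded (q F).Kc) (hrdA : ∀ F : T4Family, ∀ x, ((rdA F) x).OKRel ((𝔬A F) x).blk (RelB x.toKIdx)) (hlocA : ∀ F : T4Family, ∀ x, Locality310 ((𝔬A F) x) ((rdA F) x))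
    (h36A : ∀ F : T4Family, ∀ x, (q F).M₁ ≤ (geo9Y x).M → ∀ α₀ : ℝ, 0 < α₀ → (c F) * (geo9Y x).M * α₀ ≤ (q F).a₁ → ∀ U : (bg9YR (Matrix (Fin 2) (Fin 2) ℂ) (specialUnitaryUnits (Fin 2)) (R₁ F) (R₂ F) x).Cfg, (bg9YR (Matrix (Fin 2) (Fin 2) ℂ) (specialUnitaryUnits (Fin 2)) (R₁ F) (R₂ F) x).Reg335 (c F) α₀ U → Local342G ((𝔬A F) x) 1 ((H F) x) (q F).B₀ (q F).δ₀ U ∧ B9Thm310Whole.Factors389 ((𝔬A F) x) 1 ((H F) x) (q F).θ₀ (q F).δ₀ U ∧ Identities310₂ ((𝔬A F) x) ((𝔡A F) x) ((𝔩A F) x) 1 ((H F) x) U) (hGsqA : ∀ F : T4Family, ∀ x, (q F).M₁ ≤ (geo9Y x).M → ∀ α₀ : ℝ, 0 < α₀ → (c F) * (geo9Y x).M * α₀ ≤ (q F).a₁ → ∀ U : (bg9YR (Matrix (Fin 2) (Fin 2) ℂ) (specialUnitaryUnits (Fin 2)) (R₁ F) (R₂ F) x).Cfg, (bg9YR (Matrix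 (Fin 2) (Fin 2) ℂ) (specialUnitaryUnits (Fin 2)) (R₁ F) (R₂ F) x).Reg335 (c F) α₀ U → ∀ i, IsTransposePair (((𝔬A F) x).Gsq U i) (((𝔬A F) x).Gsq U i) ∧ ∀ v, 0 ≤ v ⬝ᵥ ((𝔬A F) x).Gsq U i v) (h36HA : ∀ F : T4Family, ∀ x, (q F).M₁ ≤ (geo9Y x).M → ∀ α₀ : ℝ, 0 < α₀ → (c F) * (geo9Y x).M * α₀ ≤ (q F).a₁ → ∀ U : (bg9YR (Matrix (Fin 2) (Fin 2) ℂ) (specialUnitaryUnits (Fin 2)) (R₁ F) (R₂ F) x).Cfg, (bg9YR (Matrix (Fin 2) (Fin 2) ℂ) (specialUnitaryUnits (Fin 2)) (R₁ F) (R₂ F) x).Reg335 (c F) α₀ U → HolderLegs310 ((𝔬A F) x) ((𝔭A F) x) 1 ((H F) x) ((SHA F) x) (q F).Bl (q F).δ₀ U ∧ FactorsHolder310 ((𝔬A F) x) ((𝔭A F) x) 1 ((H F) x) (q F).Bt (q F).δ₀ U ∧ (L2SecondLegs310 ((𝔬A F) x) ((𝔡A F) x) 1 ((H F) x) ((S3A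 F) x) (q3 F).B3 (q F).δ₀ U ∧ ∀ a, IsTransposePair (((𝔬A F) x).Rt U a) (((𝔬A F) x).Rf U a)) ∧ (InputLegsPair310 ((𝔬A F) x) ((𝔡A F) x) ((𝔭A F) x) 1 ((H F) x) ((bHXA F) x) ((SIA F) x) (q F).BI (q F).BI2 (q F).δ₀ U ∧ FactorsInputPair310 ((𝔬A F) x) ((𝔡A F) x) 1 ((H F) x) ((bHXA F) x) (q F).θI (q F).δ₀ U) ∧ (L2MixedLegs310 ((𝔬A F) x) ((𝔡A F) x) 1 ((H F) x) ((SMA F) x) (qM F).BM (q F).δ₀ U ∧ FactorsL2Mixed310 ((𝔬A F) x) ((𝔡A F) x) 1 ((H F) x) (qM F).θM (q F).δ₀ U)) (bHXTA : ∀ F : T4Family, ∀ x : MemberY (stage3OfFamily F).d₆ (stage3OfFamily F).ℓ₆ (stage3OfFamily F).hd' (stage3OfFamily F).hL' (stage3OfFamily F).b₀ (stage3OfFamily F).b₁ (Mstar F), (bg9YR (Matrix (Fin 2) (Fin 2) ℂ) (specialUnitaryUnits (Fin 2)) (R₁ F) (R₂ F) x).Cfg → ℝ → BlockNorm (toB6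 (geo9Y x) 1 ((H F) x)) ((XBK (TrIdx 2) x.toKIdx) → ℝ))
    (hbHXTA : ∀ F : T4Family, ∀ (x : MemberY (stage3OfFamily F).d₆ (stage3OfFamily F).ℓ₆ (stage3OfFamily F).hd' (stage3OfFamily F).hL' (stage3OfFamily F).b₀ (stage3OfFamily F).b₁ (Mstar F)) (U : (bg9YR (Matrix (Fin 2) (Fin 2) ℂ) (specialUnitaryUnits (Fin 2)) (R₁ F) (R₂ F) x).Cfg), (bHXTA F) x U = fun ε => letI : Fintype (B9GeoNormsKLevelV1.geo9K x.toKIdx).Site := (inferInstance : Fintype (geo9Y x).Site); bHZKPIfam (κ := TrIdx 2) x.toKIdx (trBasis 2) (taxiB x.toKIdx (bg9YR (Matrix (Fin 2) (Fin 2) ℂ) (specialUnitaryUnits (Fin 2)) (R₁ F) (R₂ F) x) (fun U => U) U) (R := (1 : ℝ)) (H := (H F) x) ε) (hopIA : ∀ F : T4Family, ∀ x, (q F).M₁ ≤ (geo9Y x).M → ∀ α₀ : ℝ, 0 < α₀ → (c F) * (geo9Y x).M * α₀ ≤ (q F).a₁ → ∀ U : (bg9YR (Matrix (Fin 2) (Fin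 2) ℂ) (specialUnitaryUnits (Fin 2)) (R₁ F) (R₂ F) x).Cfg, (bg9YR (Matrix (Fin 2) (Fin 2) ℂ) (specialUnitaryUnits (Fin 2)) (R₁ F) (R₂ F) x).Reg335 (c F) α₀ U → InputLegsPair310 ((𝔬A F) x) ((𝔡A F) x) ((𝔭A F) x) 1 ((H F) x) ((bHXTA F) x U) ((SIA F) x) (q F).BI (q F).BI2 (q F).δ₀ U ∧ FactorsInputPair310 ((𝔬A F) x) ((𝔡A F) x) 1 ((H F) x) ((bHXTA F) x U) (q F).θI (q F).δ₀ U) (h36A2 : ∀ F : T4Family, ∀ x, (q F).M₁ ≤ (geo9Y x).M → ∀ α₀ : ℝ, 0 < α₀ → (c F) * (geo9Y x).M * α₀ ≤ (q F).a₁ → ∀ U : (bg9YR (Matrix (Fin 2) (Fin 2) ℂ) (specialUnitaryUnits (Fin 2)) (R₁ F) (R₂ F) x).Cfg, (bg9YR (Matrix (Fin 2) (Fin 2) ℂ) (specialUnitaryUnits (Fin 2)) (R₁ F) (R₂ F) x).Reg335 (c F) α₀ U → L2TwoLegs310 ((𝔬A F) x) 1 ((H F) x) ((S2A F) x) (q F).B2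 (q F).δ₀ U ∧ FactorsL2_310 ((𝔬A F) x) 1 ((H F) x) (q F).θ2 (q F).δ₀ U) (hcntHA : ∀ F : T4Family, ∀ x (a : (geo9Y x).Site), (∑ cᵢ, if a ∈ (SHA F) x cᵢ then (1 : ℝ) else 0) ≤ (q F).NH) (hcnt3A : ∀ F : T4Family, ∀ x (a : (geo9Y x).Site), (∑ cᵢ, if a ∈ (S3A F) x cᵢ then (1 : ℝ) else 0) ≤ (q3 F).N3) (hcntIA : ∀ F : T4Family, ∀ x (a : (geo9Y x).Site), (∑ cᵢ, if a ∈ (SIA F) x cᵢ then (1 : ℝ) else 0) ≤ (q F).NI) (hcntMA : ∀ F : T4Family, ∀ x (a : (geo9Y x).Site), (∑ cᵢ, if a ∈ (SMA F) x cᵢ then (1 : ℝ) else 0) ≤ (qM F).NM) (hcnt2A : ∀ F : T4Family, ∀ x (a : (geo9Y x).Site), (∑ cᵢ, if a ∈ (S2A F) x cᵢ then (1 : ℝ) else 0) ≤ (q F).N2) (hblkA : ∀ F : T4Family, ∀ x : MemberY (stage3OfFamily F).d₆ (stage3OfFamily F).ℓ₆ (stage3OfFamily F).hd' (stage3OfFamily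 F).hL' (stage3OfFamily F).b₀ (stage3OfFamily F).b₁ (Mstar F), ((𝔬A F) x).blk = blkBK x.toKIdx ((bI F) x))
    (hblkYA : ∀ F : T4Family, ∀ x : MemberY (stage3OfFamily F).d₆ (stage3OfFamily F).ℓ₆ (stage3OfFamily F).hd' (stage3OfFamily F).hL' (stage3OfFamily F).b₀ (stage3OfFamily F).b₁ (Mstar F), ((𝔬A F) x).blkY = blkBK x.toKIdx ((bI F) x)) (hGcoA : ∀ F : T4Family, ∀ (x : MemberY (stage3OfFamily F).d₆ (stage3OfFamily F).ℓ₆ (stage3OfFamily F).hd' (stage3OfFamily F).hL' (stage3OfFamily F).b₀ (stage3OfFamily F).b₁ (Mstar F)) (U : (bg9YR (Matrix (Fin 2) (Fin 2) ℂ) (specialUnitaryUnits (Fin 2)) (R₁ F) (R₂ F) x).Cfg), ((𝔬A F) x).G U = GcoK x.toKIdx (trBasis 2) (bg9YR (Matrix (Fin 2) (Fin 2) ℂ) (specialUnitaryUnits (Fin 2)) (R₁ F) (R₂ F) x) (fun U => U) (lettersYOfRecordV4P 2 (stage3OfFamily F) (Mstar F) (𝔯 F) x).GA U) (hDcoA :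 ∀ F : T4Family, ∀ (x : MemberY (stage3OfFamily F).d₆ (stage3OfFamily F).ℓ₆ (stage3OfFamily F).hd' (stage3OfFamily F).hL' (stage3OfFamily F).b₀ (stage3OfFamily F).b₁ (Mstar F)) (U : (bg9YR (Matrix (Fin 2) (Fin 2) ℂ) (specialUnitaryUnits (Fin 2)) (R₁ F) (R₂ F) x).Cfg), ((𝔬A F) x).D U = DcoK x.toKIdx (trBasis 2) (bg9YR (Matrix (Fin 2) (Fin 2) ℂ) (specialUnitaryUnits (Fin 2)) (R₁ F) (R₂ F) x) (fun U => U) U) (hDscoA : ∀ F : T4Family, ∀ (x : MemberY (stage3OfFamily F).d₆ (stage3OfFamily F).ℓ₆ (stage3OfFamily F).hd' (stage3OfFamily F).hL' (stage3OfFamily F).b₀ (stage3OfFamily F).b₁ (Mstar F)) (U : (bg9YR (Matrix (Fin 2) (Fin 2) ℂ) (specialUnitaryUnits (Fin 2)) (R₁ F) (R₂ F) x).Cfg), ((𝔬A F) x).Dstar U = DscoK x.toKIdx (trBasis 2) (bg9YR (Matrix (Fin 2) (Fin 2) ℂ) (specialUnitaryUnits (Fin 2)) (R₁ F) (R₂ F)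 x) (fun U => U) U) (hLcoA : ∀ F : T4Family, ∀ (x : MemberY (stage3OfFamily F).d₆ (stage3OfFamily F).ℓ₆ (stage3OfFamily F).hd' (stage3OfFamily F).hL' (stage3OfFamily F).b₀ (stage3OfFamily F).b₁ (Mstar F)) (U : (bg9YR (Matrix (Fin 2) (Fin 2) ℂ) (specialUnitaryUnits (Fin 2)) (R₁ F) (R₂ F) x).Cfg), ((𝔬A F) x).Lap U = LcoK x.toKIdx (trBasis 2) (bg9YR (Matrix (Fin 2) (Fin 2) ℂ) (specialUnitaryUnits (Fin 2)) (R₁ F) (R₂ F) x) (fun U => U) U) (h𝔡Ad : ∀ F : T4Family, ∀ (x : MemberY (stage3OfFamily F).d₆ (stage3OfFamily F).ℓ₆ (stage3OfFamily F).hd' (stage3OfFamily F).hL' (stage3OfFamily F).b₀ (stage3OfFamily F).b₁ (Mstar F)) (U : (bg9YR (Matrix (Fin 2) (Fin 2) ℂ) (specialUnitaryUnits (Fin 2)) (R₁ F) (R₂ F) x).Cfg), ((𝔡A F) x).Dd U = fun μ => coordOpK (trBasis 2) (fun _ : Fin ((stage3OfFamily F).d₆ + 1) => cdBₗ x.toKIdx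 U μ))
    (h𝔡As : ∀ F : T4Family, ∀ (x : MemberY (stage3OfFamily F).d₆ (stage3OfFamily F).ℓ₆ (stage3OfFamily F).hd' (stage3OfFamily F).hL' (stage3OfFamily F).b₀ (stage3OfFamily F).b₁ (Mstar F)) (U : (bg9YR (Matrix (Fin 2) (Fin 2) ℂ) (specialUnitaryUnits (Fin 2)) (R₁ F) (R₂ F) x).Cfg), ((𝔡A F) x).Dsd U = fun μ => coordOpK (trBasis 2) (fun _ : Fin ((stage3OfFamily F).d₆ + 1) => cdsBₗ x.toKIdx U μ)) (hGsqAS : ∀ F : T4Family, ∀ (x : MemberY (stage3OfFamily F).d₆ (stage3OfFamily F).ℓ₆ (stage3OfFamily F).hd' (stage3OfFamily F).hL' (stage3OfFamily F).b₀ (stage3OfFamily F).b₁ (Mstar F)) (U : (bg9YR (Matrix (Fin 2) (Fin 2) ℂ) (specialUnitaryUnits (Fin 2)) (R₁ F) (R₂ F) x).Cfg) (j : (ιA F) x), ∃ (r : ℝ) (G : (FBondY x.toKIdx → Matrix (Fin 2) (Fin 2) ℂ) →ₗ[ℝ] (FBondY x.toKIdx → Matrix (Fin 2) (Fin 2) ℂ)),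 ((𝔬A F) x).Gsq U j = r • coordOpK (trBasis 2) (fun _ : Fin ((stage3OfFamily F).d₆ + 1) => G)) (𝔬12 : ∀ F : T4Family, ∀ x : MemberY (stage3OfFamily F).d₆ (stage3OfFamily F).ℓ₆ (stage3OfFamily F).hd' (stage3OfFamily F).hL' (stage3OfFamily F).b₀ (stage3OfFamily F).b₁ (Mstar F), B9Thm312Whole.Ops (geo9Y x) (bg9YR (Matrix (Fin 2) (Fin 2) ℂ) (specialUnitaryUnits (Fin 2)) (R₁ F) (R₂ F) x) (XBK (TrIdx 2) x.toKIdx) (XBK (TrIdx 2) x.toKIdx) (XHK (TrIdx 2) x.toKIdx) (XSK (TrIdx 2) x.toKIdx)) (h𝔬12 : ∀ F : T4Family, (𝔬12 F) = ops312YOfRecord 2 (stage3OfFamily F) (Mstar F) (𝔯 F) (R₁ F) (R₂ F) (bI F)) (h𝔈 : ∀ F : T4Family, (𝔈 F) = expsYOfRecordV2 2 (stage3OfFamily F) (Mstar F) (𝔯 F) (𝔈₀ F) (R₁ F) (R₂ F) (bI F) (α' F) (r39 F) (B39 F) (p F) (q F) (p3 F) (q3 F) (pM F) (qM F) (H F)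 (𝔬A F) (rdA F) (𝔬12 F)) (bH13 : ∀ F : T4Family, ∀ x : MemberY (stage3OfFamily F).d₆ (stage3OfFamily F).ℓ₆ (stage3OfFamily F).hd' (stage3OfFamily F).hL' (stage3OfFamily F).b₀ (stage3OfFamily F).b₁ (Mstar F), (bg9YR (Matrix (Fin 2) (Fin 2) ℂ) (specialUnitaryUnits (Fin 2)) (R₁ F) (R₂ F) x).Cfg → BlockNorm (toB6 (geo9Y x) 1 ((H F) x)) (XSK (TrIdx 2) x.toKIdx → ℝ)) (δ12₀ δK12 σ12 ρ12 a12 M12 B12₃ δ12₃ ρ13 α12 : ∀ F : T4Family, ℝ) (ρf12 : ∀ F : T4Family, ℝ) (hρf12 : ∀ F : T4Family, 0 < (ρf12 F)) (hρf1 : ∀ F : T4Family, (ρf12 F) + (σ12 F) ≤ (1 - (α12 F)) * (ρ12 F)) (hρf2 : ∀ F : T4Family, (ρf12 F) + 2 * (σ12 F) + (α12 F) * (ρ12 F) ≤ (ρ12 F)) (hB12₃ : ∀ F : T4Family, 0 ≤ (B12₃ F)) (hσ12 : ∀ F : T4Family, 0 < (σ12 F)) (hρ12 : ∀ F : T4Family,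 0 < (ρ12 F)) (hρS12 : ∀ F : T4Family, (ρ12 F) ≤ (δ12₀ F))
    (hρδ12 : ∀ F : T4Family, (ρ12 F) + 2 * (σ12 F) ≤ (δK12 F)) (hρ₃12 : ∀ F : T4Family, (ρ12 F) + (σ12 F) ≤ (δ12₃ F)) (ha12 : ∀ F : T4Family, 0 < (a12 F)) (hM12 : ∀ F : T4Family, 0 < (M12 F)) (hα12 : ∀ F : T4Family, 0 < (α12 F)) (hα12' : ∀ F : T4Family, (α12 F) ≤ 1 / 2) (hδ₃₀ : ∀ F : T4Family, (δ12₃ F) < (δ12₀ F)) (hδ12₀ : ∀ F : T4Family, (δ12₀ F) ≤ (1 - 3 * (q F).αF) * ((1 - 2 * (q F).α) * (q F).δ₀)) (t12 δT12 ρS σS : ∀ F : T4Family, ℝ) (ht12 : ∀ F : T4Family, 0 ≤ (t12 F)) (hσS : ∀ F : T4Family, 0 < (σS F)) (hρST : ∀ F : T4Family, (ρS F) ≤ (δT12 F)) (hρS₀ : ∀ F : T4Family, (ρS F) + (σS F) ≤ (δ12₀ F)) (hδKS : ∀ F : T4Family, (δK12 F) + (q F).αF * ((1 - 2 * (q F).α)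 * (q F).δ₀) ≤ (ρS F)) (hσSK : ∀ F : T4Family, (σS F) ≤ (δK12 F)) (bXH : ∀ F : T4Family, ∀ x : MemberY (stage3OfFamily F).d₆ (stage3OfFamily F).ℓ₆ (stage3OfFamily F).hd' (stage3OfFamily F).hL' (stage3OfFamily F).b₀ (stage3OfFamily F).b₁ (Mstar F), (bg9YR (Matrix (Fin 2) (Fin 2) ℂ) (specialUnitaryUnits (Fin 2)) (R₁ F) (R₂ F) x).Cfg → BlockNorm (toB6 (geo9Y x) 1 ((H F) x)) (XBK (TrIdx 2) x.toKIdx → ℝ)) (w13 wX : ∀ F : T4Family, ℝ → ℝ) (hw13₀ : ∀ F : T4Family, ∀ s, 0 ≤ (w13 F) s) (hw13₁ : ∀ F : T4Family, ∀ s, (w13 F) s ≤ 1) (hwX₀ : ∀ F : T4Family, ∀ s, 0 ≤ (wX F) s) (hwX₁ : ∀ F : T4Family, ∀ s, (wX F) s ≤ 1) (hbH13 : ∀ F : T4Family, ∀ (x : MemberY (stage3OfFamily F).d₆ (stage3OfFamily F).ℓ₆ (stage3OfFamily F).hd' (stage3OfFamily F).hL' (stage3OfFamily F).b₀ (stage3OfFamily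 F).b₁ (Mstar F)) (U : (bg9YR (Matrix (Fin 2) (Fin 2) ℂ) (specialUnitaryUnits (Fin 2)) (R₁ F) (R₂ F) x).Cfg), (bH13 F) x U = letI : Fintype (B9GeoNormsKLevelV1.geo9K x.toKIdx).Site := (inferInstance : Fintype (geo9Y x).Site); bHZPG (κ := TrIdx 2) x.toKIdx (trBasis 2) (taxiS x.toKIdx (bg9YR (Matrix (Fin 2) (Fin 2) ℂ) (specialUnitaryUnits (Fin 2)) (R₁ F) (R₂ F) x) (fun U => U) U) (R := (1 : ℝ)) (H := (H F) x) (w13 F) (hw13₀ F) (hw13₁ F))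
    (hbXH : ∀ F : T4Family, ∀ (x : MemberY (stage3OfFamily F).d₆ (stage3OfFamily F).ℓ₆ (stage3OfFamily F).hd' (stage3OfFamily F).hL' (stage3OfFamily F).b₀ (stage3OfFamily F).b₁ (Mstar F)) (U : (bg9YR (Matrix (Fin 2) (Fin 2) ℂ) (specialUnitaryUnits (Fin 2)) (R₁ F) (R₂ F) x).Cfg), (bXH F) x U = letI : Fintype (B9GeoNormsKLevelV1.geo9K x.toKIdx).Site := (inferInstance : Fintype (geo9Y x).Site); bHZKPG (κ := TrIdx 2) x.toKIdx (trBasis 2) (taxiB x.toKIdx (bg9YR (Matrix (Fin 2) (Fin 2) ℂ) (specialUnitaryUnits (Fin 2)) (R₁ F) (R₂ F) x) (fun U => U) U) (R := (1 : ℝ)) (H := (H F) x) (wX F) (hwX₀ F) (hwX₁ F)) (hρ13 : ∀ F : T4Family, 0 < (ρ13 F)) (hρ13ρ : ∀ F : T4Family, (ρ13 F) + 5 * (σ12 F) ≤ (ρ12 F)) (hσρ13 : ∀ F : T4Family, 3 * (σ12 F) < (1 - (α12 F)) * (ρ13 F)) (B13₄ : ∀ F : T4Family, ℝ) (Bx13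 : ∀ F : T4Family, ℝ → ℝ) (hB13₄ : ∀ F : T4Family, 0 ≤ (B13₄ F)) (hBx13 : ∀ F : T4Family, ∀ β, 0 ≤ β → β < 1 → 0 ≤ (Bx13 F) β) (tJ δB rT : ∀ F : T4Family, ℝ) (ha1J : ∀ F : T4Family, 10 * (((stage3OfFamily F).ℓ₆ + 1 : ℕ) : ℝ) ^ 7 * (a12 F) ≤ 1) (htJ : ∀ F : T4Family, 2 * (((stage3OfFamily F).d₆ : ℝ) + 1) * ((((stage3OfFamily F).ℓ₆ + 1 : ℕ) : ℝ)) ^ 3 * (2 : ℝ) * (10 ^ 4 * (((stage3OfFamily F).d₆ : ℝ) + 1) * (10 * (((stage3OfFamily F).ℓ₆ + 1 : ℕ) : ℝ) ^ 7)) * Real.exp (3 * (δB F)) ≤ (tJ F)) (hrTP : ∀ F : T4Family, (rT F) ≤ min ((1 - 2 * (p F).α) * (p F).δ₀) (δ39 F) / 8) (hrTB : ∀ F : T4Family, (rT F) ≤ (δB F)) (hδT12 : ∀ F : T4Family, 0 ≤ (δT12 F)) (hδTr : ∀ F : T4Family, (δT12 F) + 3 * (σS F) + 3 * ((q F).αF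 * ((1 - 2 * (q F).α) * (q F).δ₀)) ≤ (rT F)) (ϑF : ∀ F : T4Family, ℝ) (hϑF : ∀ F : T4Family, 2 * (10 * ((((stage3OfFamily F).ℓ₆ + 1 : ℕ) : ℝ)) * (a12 F)) * (1 + 10 * ((((stage3OfFamily F).ℓ₆ + 1 : ℕ) : ℝ)) * (a12 F)) * Real.exp (4 * (10 * ((((stage3OfFamily F).ℓ₆ + 1 : ℕ) : ℝ)) * (a12 F))) * ((((stage3OfFamily F).ℓ₆ + 1 : ℕ) : ℝ)) ≤ (ϑF F)) (sch : ∀ F : T4Family, ℝ → ℝ) (hsch0 : ∀ F : T4Family, ∀ β', 0 ≤ β' → β' < 1 → 0 < (sch F) β') (hsch1 : ∀ F : T4Family, ∀ β', 0 ≤ β' → β' < 1 → (sch F) β' < 1) (hschβ : ∀ F : T4Family, ∀ β', 0 ≤ β' → β' < 1 → β' < (sch F) β') (hwsch : ∀ F : T4Family, ∀ β', 0 ≤ β' → β' < 1 → 0 < (w13 F) ((sch F) β')) (δ45 : ∀ F : T4Family, ℝ) (hδ45 : ∀ F : T4Family, (δ12₃ F) < (δ45 F)) (BZ : ∀ F :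 T4Family, ℝ → ℝ) (hBZ : ∀ F : T4Family, ∀ β', 0 ≤ β' → β' < 1 → 0 ≤ (BZ F) β')
    (hBZge : ∀ F : T4Family, ∀ β', 0 ≤ β' → β' < 1 → ((((stage3OfFamily F).ℓ₆ + 1 : ℕ) : ℝ)) * inputConst45 (exp261 (@geo9Y (stage3OfFamily F).d₆ (stage3OfFamily F).ℓ₆ (stage3OfFamily F).hd' (stage3OfFamily F).hL' (stage3OfFamily F).b₀ (stage3OfFamily F).b₁ (Mstar F)) (q F).δ₀ (q F).α) (q F).δ₀ (q F).α (q F).NI (q F).NF ((((stage3OfFamily F).ℓ₆ + 1 : ℕ) : ℝ)) (holderConst (exp261 (@geo9Y (stage3OfFamily F).d₆ (stage3OfFamily F).ℓ₆ (stage3OfFamily F).hd' (stage3OfFamily F).hL' (stage3OfFamily F).b₀ (stage3OfFamily F).b₁ (Mstar F)) (q F).δ₀ (q F).α) (q F).δ₀ (q F).α (q F).NH (q F).NF (const37 (exp261 (@geo9Y (stage3OfFamily F).d₆ (stage3OfFamily F).ℓ₆ (stage3OfFamily F).hd' (stage3OfFamily F).hL' (stage3OfFamily F).b₀ (stage3OfFamily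 F).b₁ (Mstar F)) (q F).δ₀ (q F).α) (q F).δ₀ (q F).α (q F).ρ (q F).B₀ (q F).Nc (q F).N' (q F).Cℓ (q F).Kc) ((q F).Bl β') ((q F).Bt β')) ((q F).BI2 ((sch F) β' - β') β') ((q F).θI ((sch F) β')) ≤ (BZ F) β') (hδ45le : ∀ F : T4Family, (δ45 F) ≤ ((1 - (q F).αF) * ((1 - 2 * (q F).α) * (q F).δ₀) - (q F).α * (q F).δ₀)) (δ₂ : ∀ F : T4Family, ℝ) (hrT4 : ∀ F : T4Family, (rT F) ≤ δ46 (stage3OfFamily F).d₆ (stage3OfFamily F).ℓ₆ (stage3OfFamily F).hd' (stage3OfFamily F).hL' (stage3OfFamily F).b₀ (stage3OfFamily F).b₁ (Mstar F) 2 (c F) (hc F)) (hrT2 : ∀ F : T4Family, (rT F) ≤ (δ₂ F)) (hδ₃T : ∀ F : T4Family, (δ12₃ F) ≤ (1 - 2 * (q F).αF) * (rT F) - (σS F)) (hδ12₃F : ∀ F : T4Family, (δ12₃ F) ≤ (1 - 2 * (p F).αF) * ((1 - 2 * (p F).α) * (p F).δ₀)) (δ45Y : ∀ F : T4Family, ℝ)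 (hδ45Y : ∀ F : T4Family, (δ12₃ F) < (δ45Y F)) (BiY : ∀ F : T4Family, ℝ → ℝ) (hBiY : ∀ F : T4Family, ∀ β', 0 ≤ β' → β' < 1 → 0 ≤ (BiY F) β') (αW σW δFW : ∀ F : T4Family, ℝ) (hαW0 : ∀ F : T4Family, 0 < (αW F)) (hαW1 : ∀ F : T4Family, (αW F) < 1) (hσW : ∀ F : T4Family, 0 < (σW F)) (hδFW : ∀ F : T4Family, 0 < (δFW F)) (hδFP : ∀ F : T4Family, (δFW F) ≤ min ((1 - 2 * (p F).α) * (p F).δ₀) (δ39 F) / 8) (hbudW : ∀ F : T4Family, 0 ≤ (δFW F) - (αW F) * (δFW F) - 2 * (σW F)) (hδ3W : ∀ F : T4Family, (δ12₃ F) ≤ (δFW F) - (αW F) * (δFW F) - 2 * (σW F)) (hwschX : ∀ F : T4Family, ∀ β', 0 ≤ β' → β' < 1 → 0 < (wX F) ((sch F) β')) (δ45W : ∀ F : T4Family, ℝ) (hδ45W : ∀ F : T4Family, (δFW F) - (αW F) * (δFW F) - 2 * (σW F) ≤ (δ45W F)) (B45W : ∀ F : T4Family, ℝ → ℝ) (hB45W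 : ∀ F : T4Family, ∀ β', 0 ≤ β' → β' < 1 → 0 ≤ (B45W F) β') (δhW : ∀ F : T4Family, ℝ)
    (hδhW : ∀ F : T4Family, (δFW F) - (αW F) * (δFW F) - (σW F) ≤ (δhW F)) (BhW : ∀ F : T4Family, ℝ → ℝ) (hBhW : ∀ F : T4Family, ∀ β', 0 ≤ β' → β' < 1 → 0 ≤ (BhW F) β')
    (hB45Wge : ∀ F : T4Family, ∀ β', 0 ≤ β' → β' < 1 → let Cσ : ℝ := (((((stage3OfFamily F).ℓ₆ + 1 : ℕ) : ℝ)) * (((((stage3OfFamily F).ℓ₆ + 1 : ℕ) : ℝ)) ^ 3 * (2 + 2 * coordBound39 (trBasis 2) * basisBound39 (trBasis 2) * ((((stage3OfFamily F).ℓ₆ + 1 : ℕ) : ℝ)) ^ 2)) * Real.exp ((1 - (p F).αF) * ((1 - 2 * (p F).α) * (p F).δ₀) * (2 * (rNear (stage3OfFamily F).d₆ (stage3OfFamily F).ℓ₆ + 1) + ((((stage3OfFamily F).d₆ : ℝ) + 1) * ((((stage3OfFamily F).ℓ₆ : ℝ) + 1) + 1) + 2)))); let X44 : ℝ := (((((stage3OfFamily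 F).ℓ₆ + 1 : ℕ) : ℝ)) * ((1 + CLip (stage3OfFamily F).d₆ (stage3OfFamily F).ℓ₆) * inputConst44 (exp261 (@geo9Y (stage3OfFamily F).d₆ (stage3OfFamily F).ℓ₆ (stage3OfFamily F).hd' (stage3OfFamily F).hL' (stage3OfFamily F).b₀ (stage3OfFamily F).b₁ (Mstar F)) (p F).δ₀ (p F).α) (p F).δ₀ (p F).α (p F).NI (p F).N' ((p F).C (exp261 (@geo9Y (stage3OfFamily F).d₆ (stage3OfFamily F).ℓ₆ (stage3OfFamily F).hd' (stage3OfFamily F).hL' (stage3OfFamily F).b₀ (stage3OfFamily F).b₁ (Mstar F)) (p F).δ₀ (p F).α)) ((((stage3OfFamily F).ℓ₆ + 1 : ℕ) : ℝ)) ((p F).BI ((sch F) β')) ((p F).θI ((sch F) β')) * Cσ * B6.c1 (exp261 (@geo9Y (stage3OfFamily F).d₆ (stage3OfFamily F).ℓ₆ (stage3OfFamily F).hd' (stage3OfFamily F).hL' (stage3OfFamily F).b₀ (stage3OfFamily F).b₁ (Mstar F)) (p F).δ₀ (p F).α) (p F).δ₀ (p F).α)); ((((stage3OfFamily F).d₆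 + 1 : ℕ) : ℝ)) * (((((((stage3OfFamily F).ℓ₆ + 1 : ℕ) : ℝ)) * ((1 + CLip (stage3OfFamily F).d₆ (stage3OfFamily F).ℓ₆) * inputConst45 (exp261 (@geo9Y (stage3OfFamily F).d₆ (stage3OfFamily F).ℓ₆ (stage3OfFamily F).hd' (stage3OfFamily F).hL' (stage3OfFamily F).b₀ (stage3OfFamily F).b₁ (Mstar F)) (p F).δ₀ (p F).α) (p F).δ₀ (p F).α (p F).NI (p F).N' ((((stage3OfFamily F).ℓ₆ + 1 : ℕ) : ℝ)) (holderConst (exp261 (@geo9Y (stage3OfFamily F).d₆ (stage3OfFamily F).ℓ₆ (stage3OfFamily F).hd' (stage3OfFamily F).hL' (stage3OfFamily F).b₀ (stage3OfFamily F).b₁ (Mstar F)) (p F).δ₀ (p F).α) (p F).δ₀ (p F).α (p F).NH (p F).N' ((p F).C (exp261 (@geo9Y (stage3OfFamily F).d₆ (stage3OfFamily F).ℓ₆ (stage3OfFamily F).hd' (stage3OfFamily F).hL' (stage3OfFamily F).b₀ (stage3OfFamily F).b₁ (Mstar F)) (p F).δ₀ (p F).α)) ((p F).Bl β') ((p F).Bt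 β')) ((p F).BI2 ((sch F) β' - β') β') ((p F).θI ((sch F) β')) * Cσ * B6.c1 (exp261 (@geo9Y (stage3OfFamily F).d₆ (stage3OfFamily F).ℓ₆ (stage3OfFamily F).hd' (stage3OfFamily F).hL' (stage3OfFamily F).b₀ (stage3OfFamily F).b₁ (Mstar F)) (p F).δ₀ (p F).α) (p F).δ₀ (p F).α)) + 2 * coordBound39 (trBasis 2) * basisBound39 (trBasis 2) * (((stage3OfFamily F).ℓ₆ : ℝ) + 1) * Real.exp (((1 - (p F).αF) * ((1 - 2 * (p F).α) * (p F).δ₀) - 3 * ((p F).α * (p F).δ₀)) * ((((stage3OfFamily F).d₆ : ℝ) + 1) * ((((stage3OfFamily F).ℓ₆ : ℝ) + 1) + 1) + 2)) * (((((stage3OfFamily F).d₆ + 1 : ℕ) : ℝ)) ^ 2 * (2 * (10 * ((((stage3OfFamily F).ℓ₆ + 1 : ℕ) : ℝ)) * ((p F).a₁ / (c F))) * (1 + 10 * ((((stage3OfFamily F).ℓ₆ + 1 : ℕ) : ℝ)) * ((p F).a₁ / (c F))) * Real.exp (4 * (10 * ((((stage3OfFamily F).ℓ₆ + 1 : ℕ)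 : ℝ)) * ((p F).a₁ / (c F))))) * ((((stage3OfFamily F).ℓ₆ + 1 : ℕ) : ℝ)) ^ 6) * X44 + coordBound39 (trBasis 2) * basisBound39 (trBasis 2) * X44 + X44) + X44 + coordBound39 (trBasis 2) * basisBound39 (trBasis 2) * X44) ≤ (B45W F) β')
    (hδ45Wle : ∀ F : T4Family, (δ45W F) ≤ ((1 - (p F).αF) * ((1 - 2 * (p F).α) * (p F).δ₀) - 3 * ((p F).α * (p F).δ₀)))
    (hBhWge : ∀ F : T4Family, ∀ β', 0 ≤ β' → β' < 1 → ((B9RWSums343Holder.holderConst (B9RWSums347DefiniteFaces.exp261 (@geo9Y (stage3OfFamily F).d₆ (stage3OfFamily F).ℓ₆ (stage3OfFamily F).hd' (stage3OfFamily F).hL' (stage3OfFamily F).b₀ (stage3OfFamily F).b₁ (Mstar F)) (p F).δ₀ (p F).α) (p F).δ₀ (p F).α (p F).NH (p F).N' ((p F).C (B9RWSums347DefiniteFaces.exp261 (@geo9Y (stage3OfFamily F).d₆ (stage3OfFamily F).ℓ₆ (stage3OfFamily F).hd' (stage3OfFamily F).hL' (stage3OfFamily F).b₀ (stage3OfFamily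 F).b₁ (Mstar F)) (p F).δ₀ (p F).α)) ((p F).Bl β') ((p F).Bt β') + 2 * B9Thm39ReadingCoords.coordBound39 (trBasis 2) * B9Thm39ReadingCoords.basisBound39 (trBasis 2) * (((stage3OfFamily F).ℓ₆ : ℝ) + 1) * Real.exp (((1 - 2 * (p F).α) * (p F).δ₀) * ((((stage3OfFamily F).d₆ : ℝ) + 1) * ((((stage3OfFamily F).ℓ₆ : ℝ) + 1) + 1) + 2)) * (((((stage3OfFamily F).d₆ + 1 : ℕ) : ℝ)) ^ 2 * (2 * (10 * (((stage3OfFamily F).ℓ₆ + 1 : ℕ) : ℝ) * ((p F).a₁ / (c F))) * (1 + 10 * (((stage3OfFamily F).ℓ₆ + 1 : ℕ) : ℝ) * ((p F).a₁ / (c F))) * Real.exp (4 * (10 * (((stage3OfFamily F).ℓ₆ + 1 : ℕ) : ℝ) * ((p F).a₁ / (c F))))) * (((stage3OfFamily F).ℓ₆ + 1 : ℕ) : ℝ) ^ 6) * ((p F).C (B9RWSums347DefiniteFaces.exp261 (@geo9Y (stage3OfFamily F).d₆ (stage3OfFamily F).ℓ₆ (stage3OfFamily F).hd' (stage3OfFamily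 F).hL' (stage3OfFamily F).b₀ (stage3OfFamily F).b₁ (Mstar F)) (p F).δ₀ (p F).α)) + B9Thm39ReadingCoords.coordBound39 (trBasis 2) * B9Thm39ReadingCoords.basisBound39 (trBasis 2) * ((p F).C (B9RWSums347DefiniteFaces.exp261 (@geo9Y (stage3OfFamily F).d₆ (stage3OfFamily F).ℓ₆ (stage3OfFamily F).hd' (stage3OfFamily F).hL' (stage3OfFamily F).b₀ (stage3OfFamily F).b₁ (Mstar F)) (p F).δ₀ (p F).α)) + ((p F).C (B9RWSums347DefiniteFaces.exp261 (@geo9Y (stage3OfFamily F).d₆ (stage3OfFamily F).ℓ₆ (stage3OfFamily F).hd' (stage3OfFamily F).hL' (stage3OfFamily F).b₀ (stage3OfFamily F).b₁ (Mstar F)) (p F).δ₀ (p F).α))) + ((p F).C (B9RWSums347DefiniteFaces.exp261 (@geo9Y (stage3OfFamily F).d₆ (stage3OfFamily F).ℓ₆ (stage3OfFamily F).hd' (stage3OfFamily F).hL' (stage3OfFamily F).b₀ (stage3OfFamily F).b₁ (Mstar F)) (p F).δ₀ (p F).α)) + B9Thm39ReadingCoords.coordBound39 (trBasis 2) * B9Thm39ReadingCoords.basisBound39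 (trBasis 2) * ((p F).C (B9RWSums347DefiniteFaces.exp261 (@geo9Y (stage3OfFamily F).d₆ (stage3OfFamily F).ℓ₆ (stage3OfFamily F).hd' (stage3OfFamily F).hL' (stage3OfFamily F).b₀ (stage3OfFamily F).b₁ (Mstar F)) (p F).δ₀ (p F).α))) ≤ (BhW F) β')
    (hδhWle : ∀ F : T4Family, (δhW F) ≤ ((1 - 2 * (p F).α) * (p F).δ₀)) (CP : ∀ F : T4Family, ℝ) (hCPge : ∀ F : T4Family, (((stage3OfFamily F).d₆ + 1 : ℕ) : ℝ) * (coordBound39 (trBasis 2) * basisBound39 (trBasis 2) * nearBlkCntY (stage3OfFamily F).d₆ (stage3OfFamily F).ℓ₆ (stage3OfFamily F).hd' (stage3OfFamily F).hL' (stage3OfFamily F).b₀ (stage3OfFamily F).b₁ (Mstar F) * ((max 1 (2 : ℝ) * ((nbrCountY (stage3OfFamily F).d₆ (stage3OfFamily F).ℓ₆ (stage3OfFamily F).hd' (stage3OfFamily F).hL' (stage3OfFamily F).b₀ (stage3OfFamily F).b₁ 2 : ℝ) * (p F).C (B9RWSums347DefiniteFaces.exp261 (@geo9Y (stage3OfFamily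 F).d₆ (stage3OfFamily F).ℓ₆ (stage3OfFamily F).hd' (stage3OfFamily F).hL' (stage3OfFamily F).b₀ (stage3OfFamily F).b₁ (Mstar F)) (p F).δ₀ (p F).α) * Real.exp (2 * ((1 - 2 * (p F).α) * (p F).δ₀)))) * (cR39 (basis39 (Matrix (Fin 2) (Fin 2) ℂ)) * Fintype.card (κ39 (Matrix (Fin 2) (Fin 2) ℂ)) * (B39 F) * Real.exp (2 * (δ39 F))) * (max 1 (2 : ℝ) * ((nbrCountY (stage3OfFamily F).d₆ (stage3OfFamily F).ℓ₆ (stage3OfFamily F).hd' (stage3OfFamily F).hL' (stage3OfFamily F).b₀ (stage3OfFamily F).b₁ 2 : ℝ) * (p F).C (B9RWSums347DefiniteFaces.exp261 (@geo9Y (stage3OfFamily F).d₆ (stage3OfFamily F).ℓ₆ (stage3OfFamily F).hd' (stage3OfFamily F).hL' (stage3OfFamily F).b₀ (stage3OfFamily F).b₁ (Mstar F)) (p F).δ₀ (p F).α) * Real.exp (2 * ((1 - 2 * (p F).α) * (p F).δ₀)))) * cg349 (stage3OfFamily F).d₆ (stage3OfFamily F).ℓ₆ (stage3OfFamily F).hd'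 (stage3OfFamily F).hL' (stage3OfFamily F).b₀ (stage3OfFamily F).b₁ ((1 - 2 * (p F).α) * (p F).δ₀) (δ39 F)) * Real.exp (2 * (min ((1 - 2 * (p F).α) * (p F).δ₀) (δ39 F) / 8))) ≤ (CP F)) (hBxW : ∀ F : T4Family, ∀ β', 0 ≤ β' → β' < 1 → (cR39 (trBasis 2))⁻¹ * (((wX F) ((sch F) β'))⁻¹ * (B45W F) β' + (BhW F) β' * ((CP F) * ((((stage3OfFamily F).ℓ₆ + 1 : ℕ) : ℝ))) * (((wX F) ((sch F) β'))⁻¹ * (((((stage3OfFamily F).ℓ₆ + 1 : ℕ) : ℝ)) * Real.exp (((δFW F) - (αW F) * (δFW F) - (σW F)) * (rNear (stage3OfFamily F).d₆ (stage3OfFamily F).ℓ₆ + 1)))) * rowConst261 (@geo9Y (stage3OfFamily F).d₆ (stage3OfFamily F).ℓ₆ (stage3OfFamily F).hd' (stage3OfFamily F).hL' (stage3OfFamily F).b₀ (stage3OfFamily F).b₁ (Mstar F)) (σW F) * rowConst261 (@geo9Y (stage3OfFamily F).d₆ (stage3OfFamily F).ℓ₆ (stage3OfFamily F).hd' (stage3OfFamily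 F).hL' (stage3OfFamily F).b₀ (stage3OfFamily F).b₁ (Mstar F)) (σW F)) ≤ (Bx13 F) β')
    (hBiYge : ∀ F : T4Family, ∀ β', 0 ≤ β' → β' < 1 → ((((stage3OfFamily F).ℓ₆ + 1 : ℕ) : ℝ)) * inputConst45 (exp261 (@geo9Y (stage3OfFamily F).d₆ (stage3OfFamily F).ℓ₆ (stage3OfFamily F).hd' (stage3OfFamily F).hL' (stage3OfFamily F).b₀ (stage3OfFamily F).b₁ (Mstar F)) (q F).δ₀ (q F).α) (q F).δ₀ (q F).α (q F).NI (q F).NF ((((stage3OfFamily F).ℓ₆ + 1 : ℕ) : ℝ)) (holderConst (exp261 (@geo9Y (stage3OfFamily F).d₆ (stage3OfFamily F).ℓ₆ (stage3OfFamily F).hd' (stage3OfFamily F).hL' (stage3OfFamily F).b₀ (stage3OfFamily F).b₁ (Mstar F)) (q F).δ₀ (q F).α) (q F).δ₀ (q F).α (q F).NH (q F).NF (const37 (exp261 (@geo9Y (stage3OfFamily F).d₆ (stage3OfFamily F).ℓ₆ (stage3OfFamily F).hd' (stage3OfFamily F).hL' (stage3OfFamily F).b₀ (stage3OfFamily F).b₁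 (Mstar F)) (q F).δ₀ (q F).α) (q F).δ₀ (q F).α (q F).ρ (q F).B₀ (q F).Nc (q F).N' (q F).Cℓ (q F).Kc) ((q F).Bl β') ((q F).Bt β')) ((q F).BI2 ((sch F) β' - β') β') ((q F).θI ((sch F) β')) ≤ (BiY F) β') (hδ45Yle : ∀ F : T4Family, (δ45Y F) ≤ ((1 - (q F).αF) * ((1 - 2 * (q F).α) * (q F).δ₀) - (q F).α * (q F).δ₀)) (hZ : ∀ F : T4Family, ∀ x : MemberY (stage3OfFamily F).d₆ (stage3OfFamily F).ℓ₆ (stage3OfFamily F).hd' (stage3OfFamily F).hL' (stage3OfFamily F).b₀ (stage3OfFamily F).b₁ (Mstar F), (M12 F) ≤ (geo9Y x).M → ∀ α₀ : ℝ, 0 < α₀ → (geo9Y x).M * α₀ ≤ (a12 F) → ∀ U : (bg9YR (Matrix (Fin 2) (Fin 2) ℂ) (specialUnitaryUnits (Fin 2)) (R₁ F) (R₂ F) x).Cfg, (bg9YR (Matrix (Fin 2) (Fin 2) ℂ) (specialUnitaryUnits (Fin 2)) (R₁ F) (R₂ F) x).Reg335 (c F) α₀ U → (bg9YR (Matrix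 (Fin 2) (Fin 2) ℂ) (specialUnitaryUnits (Fin 2)) (R₁ F) (R₂ F) x).Reg336 (c F) α₀ U → QY x.toKIdx (parBY x.toKIdx) U ∘ₗ gradY x.toKIdx U ∘ₗ GpPhysY x.toKIdx (parSymY x.toKIdx) U ∘ₗ RY x.toKIdx (parSymY x.toKIdx) (GpPhysY x.toKIdx (parSymY x.toKIdx)) U = 0) (s44 : ∀ F : T4Family, ℝ) (hs440 : ∀ F : T4Family, 0 < (s44 F)) (hs441 : ∀ F : T4Family, (s44 F) < 1) (hws44 : ∀ F : T4Family, 0 < (w13 F) (s44 F)) (δ44 : ∀ F : T4Family, ℝ) (hδ44 : ∀ F : T4Family, (δ12₃ F) < (δ44 F)) (Bi44 : ∀ F : T4Family, ℝ) (hBi44 : ∀ F : T4Family, 0 ≤ (Bi44 F))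
    (hB12₃d : ∀ F : T4Family, (((stage3OfFamily F).d₆ : ℝ) + 1) * ((1 + CLip (stage3OfFamily F).d₆ (stage3OfFamily F).ℓ₆) * (Bi44 F) * (CJG (stage3OfFamily F).d₆ (stage3OfFamily F).ℓ₆ (trBasis 2) (s44 F) (thetaL (stage3OfFamily F).d₆ (stage3OfFamily F).ℓ₆ (ϑF F)) ((w13 F) (s44 F)) ((δ12₃ F) + 1 + 1 / 2 * ((δ44 F) - (δ12₃ F))) * ((((stage3OfFamily F).ℓ₆ + 1 : ℕ) : ℝ))) * rowConst261 (@geo9Y (stage3OfFamily F).d₆ (stage3OfFamily F).ℓ₆ (stage3OfFamily F).hd' (stage3OfFamily F).hL' (stage3OfFamily F).b₀ (stage3OfFamily F).b₁ (Mstar F)) 1) ≤ (B12₃ F)) (hB12₃p : ∀ F : T4Family, (((stage3OfFamily F).d₆ : ℝ) + 1) * (1 * ((((stage3OfFamily F).d₆ : ℝ) + 1) * ((1 + CLip (stage3OfFamily F).d₆ (stage3OfFamily F).ℓ₆) * (Bi44 F) * (CJG (stage3OfFamily F).d₆ (stage3OfFamily F).ℓ₆ (trBasis 2) (s44 F) (thetaL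 (stage3OfFamily F).d₆ (stage3OfFamily F).ℓ₆ (ϑF F)) ((w13 F) (s44 F)) ((δ12₃ F) + 1 + 1 / 2 * ((δ44 F) - (δ12₃ F))) * ((((stage3OfFamily F).ℓ₆ + 1 : ℕ) : ℝ))) * rowConst261 (@geo9Y (stage3OfFamily F).d₆ (stage3OfFamily F).ℓ₆ (stage3OfFamily F).hd' (stage3OfFamily F).hL' (stage3OfFamily F).b₀ (stage3OfFamily F).b₁ (Mstar F)) 1)) * rowConst261 (@geo9Y (stage3OfFamily F).d₆ (stage3OfFamily F).ℓ₆ (stage3OfFamily F).hd' (stage3OfFamily F).hL' (stage3OfFamily F).b₀ (stage3OfFamily F).b₁ (Mstar F)) 1) ≤ (B12₃ F)) (hBi44ge : ∀ F : T4Family, ((((stage3OfFamily F).ℓ₆ + 1 : ℕ) : ℝ)) * inputConst44 (exp261 (@geo9Y (stage3OfFamily F).d₆ (stage3OfFamily F).ℓ₆ (stage3OfFamily F).hd' (stage3OfFamily F).hL' (stage3OfFamily F).b₀ (stage3OfFamily F).b₁ (Mstar F)) (q F).δ₀ (q F).α) (q F).δ₀ (q F).α (q F).NI (q F).NF (const37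 (exp261 (@geo9Y (stage3OfFamily F).d₆ (stage3OfFamily F).ℓ₆ (stage3OfFamily F).hd' (stage3OfFamily F).hL' (stage3OfFamily F).b₀ (stage3OfFamily F).b₁ (Mstar F)) (q F).δ₀ (q F).α) (q F).δ₀ (q F).α (q F).ρ (q F).B₀ (q F).Nc (q F).N' (q F).Cℓ (q F).Kc) ((((stage3OfFamily F).ℓ₆ + 1 : ℕ) : ℝ)) ((q F).BI (s44 F)) ((q F).θI (s44 F)) ≤ (Bi44 F)) (hδ44le : ∀ F : T4Family, (δ44 F) ≤ ((1 - (q F).αF) * ((1 - 2 * (q F).α) * (q F).δ₀) - (q F).α * (q F).δ₀)) (hwX44 : ∀ F : T4Family, 0 < (wX F) (s44 F)) (B44G δ44G : ∀ F : T4Family, ℝ) (hB44G : ∀ F : T4Family, 0 ≤ (B44G F)) (hδ44G : ∀ F : T4Family, (δFW F) - (αW F) * (δFW F) - 2 * (σW F) ≤ (δ44G F))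
    (hB44Gge : ∀ F : T4Family, let Cσ : ℝ := (((((stage3OfFamily F).ℓ₆ + 1 : ℕ) : ℝ)) * (((((stage3OfFamily F).ℓ₆ + 1 : ℕ) : ℝ)) ^ 3 * (2 + 2 * coordBound39 (trBasis 2) * basisBound39 (trBasis 2) * ((((stage3OfFamily F).ℓ₆ + 1 : ℕ) : ℝ)) ^ 2)) * Real.exp ((1 - (p F).αF) * ((1 - 2 * (p F).α) * (p F).δ₀) * (2 * (rNear (stage3OfFamily F).d₆ (stage3OfFamily F).ℓ₆ + 1) + ((((stage3OfFamily F).d₆ : ℝ) + 1) * ((((stage3OfFamily F).ℓ₆ : ℝ) + 1) + 1) + 2)))); ((((stage3OfFamily F).ℓ₆ + 1 : ℕ) : ℝ)) * (((((stage3OfFamily F).d₆ + 1 : ℕ) : ℝ)) * ((1 + CLip (stage3OfFamily F).d₆ (stage3OfFamily F).ℓ₆) * inputConst44 (exp261 (@geo9Y (stage3OfFamily F).d₆ (stage3OfFamily F).ℓ₆ (stage3OfFamily F).hd' (stage3OfFamily F).hL' (stage3OfFamily F).b₀ (stage3OfFamily F).b₁ (Mstar F)) (p F).δ₀ (p F).α)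 (p F).δ₀ (p F).α (p F).NI (p F).N' ((p F).C (exp261 (@geo9Y (stage3OfFamily F).d₆ (stage3OfFamily F).ℓ₆ (stage3OfFamily F).hd' (stage3OfFamily F).hL' (stage3OfFamily F).b₀ (stage3OfFamily F).b₁ (Mstar F)) (p F).δ₀ (p F).α)) ((((stage3OfFamily F).ℓ₆ + 1 : ℕ) : ℝ)) ((p F).BI (s44 F)) ((p F).θI (s44 F)) * Cσ * B6.c1 (exp261 (@geo9Y (stage3OfFamily F).d₆ (stage3OfFamily F).ℓ₆ (stage3OfFamily F).hd' (stage3OfFamily F).hL' (stage3OfFamily F).b₀ (stage3OfFamily F).b₁ (Mstar F)) (p F).δ₀ (p F).α) (p F).δ₀ (p F).α)) ≤ (B44G F)) (hδ44Gle : ∀ F : T4Family, (δ44G F) ≤ ((1 - (p F).αF) * ((1 - 2 * (p F).α) * (p F).δ₀) - 3 * ((p F).α * (p F).δ₀))) (hB₃wG : ∀ F : T4Family, (cR39 (trBasis 2))⁻¹ * (((wX F) (s44 F))⁻¹ * (B44G F) + ((((stage3OfFamily F).d₆ + 1 : ℕ) : ℝ) * (p F).C (B9RWSums347DefiniteFaces.exp261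 (@geo9Y (stage3OfFamily F).d₆ (stage3OfFamily F).ℓ₆ (stage3OfFamily F).hd' (stage3OfFamily F).hL' (stage3OfFamily F).b₀ (stage3OfFamily F).b₁ (Mstar F)) (p F).δ₀ (p F).α)) * ((CP F) * ((((stage3OfFamily F).ℓ₆ + 1 : ℕ) : ℝ))) * (((wX F) (s44 F))⁻¹ * (((((stage3OfFamily F).ℓ₆ + 1 : ℕ) : ℝ)) * Real.exp (((δFW F) - (αW F) * (δFW F) - (σW F)) * (rNear (stage3OfFamily F).d₆ (stage3OfFamily F).ℓ₆ + 1)))) * rowConst261 (@geo9Y (stage3OfFamily F).d₆ (stage3OfFamily F).ℓ₆ (stage3OfFamily F).hd' (stage3OfFamily F).hL' (stage3OfFamily F).b₀ (stage3OfFamily F).b₁ (Mstar F)) (σW F) * rowConst261 (@geo9Y (stage3OfFamily F).d₆ (stage3OfFamily F).ℓ₆ (stage3OfFamily F).hd' (stage3OfFamily F).hL' (stage3OfFamily F).b₀ (stage3OfFamily F).b₁ (Mstar F)) (σW F)) ≤ (B12₃ F)) (BHG : ∀ F : T4Family, ℝ)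
    (hBHG : ∀ F : T4Family, 0 ≤ (BHG F)) (hwBhG : ∀ F : T4Family, ∀ s, 0 < s → s < 1 → (wX F) s * holderConst (exp261 (@geo9Y (stage3OfFamily F).d₆ (stage3OfFamily F).ℓ₆ (stage3OfFamily F).hd' (stage3OfFamily F).hL' (stage3OfFamily F).b₀ (stage3OfFamily F).b₁ (Mstar F)) (q F).δ₀ (q F).α) (q F).δ₀ (q F).α (q F).NH (q F).NF (const37 (exp261 (@geo9Y (stage3OfFamily F).d₆ (stage3OfFamily F).ℓ₆ (stage3OfFamily F).hd' (stage3OfFamily F).hL' (stage3OfFamily F).b₀ (stage3OfFamily F).b₁ (Mstar F)) (q F).δ₀ (q F).α) (q F).δ₀ (q F).α (q F).ρ (q F).B₀ (q F).Nc (q F).N' (q F).Cℓ (q F).Kc) ((q F).Bl s) ((q F).Bt s) ≤ (BHG F)) (B43 δ43 : ∀ F : T4Family, ℝ) (hB43 : ∀ F : T4Family, 0 ≤ (B43 F)) (B₀D : ∀ F : T4Family, ℝ) (hB₀D : ∀ F : T4Family, 0 ≤ (B₀D F))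
    (hbudD : ∀ F : T4Family, ∀ s : ℝ, 0 < s → s < 1 → (w13 F) s * (((((stage3OfFamily F).d₆ + 1 : ℕ) : ℝ)) * (B9RWSums343Holder.holderConst (B9RWSums347DefiniteFaces.exp261 (@geo9Y (stage3OfFamily F).d₆ (stage3OfFamily F).ℓ₆ (stage3OfFamily F).hd' (stage3OfFamily F).hL' (stage3OfFamily F).b₀ (stage3OfFamily F).b₁ (Mstar F)) (p F).δ₀ (p F).α) (p F).δ₀ (p F).α (p F).NH (p F).N' ((p F).C (B9RWSums347DefiniteFaces.exp261 (@geo9Y (stage3OfFamily F).d₆ (stage3OfFamily F).ℓ₆ (stage3OfFamily F).hd' (stage3OfFamily F).hL' (stage3OfFamily F).b₀ (stage3OfFamily F).b₁ (Mstar F)) (p F).δ₀ (p F).α)) ((p F).Bl s) ((p F).Bt s) + 2 * B9Thm39ReadingCoords.coordBound39 (trBasis 2) * B9Thm39ReadingCoords.basisBound39 (trBasis 2) * (((stage3OfFamily F).ℓ₆ : ℝ) + 1) * Real.exp (((1 - 2 * (p F).α) * (p F).δ₀) * ((((stage3OfFamily F).d₆ : ℝ) + 1) * ((((stage3OfFamily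 F).ℓ₆ : ℝ) + 1) + 1) + 2)) * (((((stage3OfFamily F).d₆ + 1 : ℕ) : ℝ)) ^ 2 * (2 * (10 * (((stage3OfFamily F).ℓ₆ + 1 : ℕ) : ℝ) * ((p F).a₁ / (c F))) * (1 + 10 * (((stage3OfFamily F).ℓ₆ + 1 : ℕ) : ℝ) * ((p F).a₁ / (c F))) * Real.exp (4 * (10 * (((stage3OfFamily F).ℓ₆ + 1 : ℕ) : ℝ) * ((p F).a₁ / (c F))))) * (((stage3OfFamily F).ℓ₆ + 1 : ℕ) : ℝ) ^ 6) * ((p F).C (B9RWSums347DefiniteFaces.exp261 (@geo9Y (stage3OfFamily F).d₆ (stage3OfFamily F).ℓ₆ (stage3OfFamily F).hd' (stage3OfFamily F).hL' (stage3OfFamily F).b₀ (stage3OfFamily F).b₁ (Mstar F)) (p F).δ₀ (p F).α)) + B9Thm39ReadingCoords.coordBound39 (trBasis 2) * B9Thm39ReadingCoords.basisBound39 (trBasis 2) * ((p F).C (B9RWSums347DefiniteFaces.exp261 (@geo9Y (stage3OfFamily F).d₆ (stage3OfFamily F).ℓ₆ (stage3OfFamily F).hd' (stage3OfFamily F).hL'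 (stage3OfFamily F).b₀ (stage3OfFamily F).b₁ (Mstar F)) (p F).δ₀ (p F).α)) + ((p F).C (B9RWSums347DefiniteFaces.exp261 (@geo9Y (stage3OfFamily F).d₆ (stage3OfFamily F).ℓ₆ (stage3OfFamily F).hd' (stage3OfFamily F).hL' (stage3OfFamily F).b₀ (stage3OfFamily F).b₁ (Mstar F)) (p F).δ₀ (p F).α)))) ≤ (B₀D F))
    (hB43ge : ∀ F : T4Family, ((((stage3OfFamily F).ℓ₆ + 1 : ℕ) : ℝ)) * (((((stage3OfFamily F).d₆ + 1 : ℕ) : ℝ)) * ((p F).C (B9RWSums347DefiniteFaces.exp261 (@geo9Y (stage3OfFamily F).d₆ (stage3OfFamily F).ℓ₆ (stage3OfFamily F).hd' (stage3OfFamily F).hL' (stage3OfFamily F).b₀ (stage3OfFamily F).b₁ (Mstar F)) (p F).δ₀ (p F).α)) + (B₀D F)) * Real.exp (((1 - 2 * (p F).α) * (p F).δ₀) * (rNear (stage3OfFamily F).d₆ (stage3OfFamily F).ℓ₆ + 1)) ≤ (B43 F)) (hδ43le : ∀ F : T4Family, (δ43 F) ≤ ((1 - 2 * (p F).α) * (p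 F).δ₀)) (ρrg : ∀ F : T4Family, ℝ) (hρrg0 : ∀ F : T4Family, 0 ≤ (ρrg F)) (hbudrg : ∀ F : T4Family, (ρrg F) + (σW F) + (αW F) * (δFW F) ≤ (δFW F)) (hbud43 : ∀ F : T4Family, (ρrg F) + (σW F) ≤ (δ43 F)) (hδ₃rg : ∀ F : T4Family, (δ12₃ F) ≤ (ρrg F))
    (hB₃rg : ∀ F : T4Family, (B43 F) * (cR39 (trBasis 2))⁻¹ * rowConst261 (@geo9Y (stage3OfFamily F).d₆ (stage3OfFamily F).ℓ₆ (stage3OfFamily F).hd' (stage3OfFamily F).hL' (stage3OfFamily F).b₀ (stage3OfFamily F).b₁ (Mstar F)) (σW F) + CTel (stage3OfFamily F).d₆ (stage3OfFamily F).ℓ₆ (trBasis 2) (ρrg F) ((CP F) * ((((stage3OfFamily F).ℓ₆ + 1 : ℕ) : ℝ)) * (((((stage3OfFamily F).d₆ + 1 : ℕ) : ℝ) * (p F).C (B9RWSums347DefiniteFaces.exp261 (@geo9Y (stage3OfFamily F).d₆ (stage3OfFamily F).ℓ₆ (stage3OfFamily F).hd' (stage3OfFamily F).hL' (stage3OfFamily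 F).b₀ (stage3OfFamily F).b₁ (Mstar F)) (p F).δ₀ (p F).α)) * (cR39 (trBasis 2))⁻¹ * rowConst261 (@geo9Y (stage3OfFamily F).d₆ (stage3OfFamily F).ℓ₆ (stage3OfFamily F).hd' (stage3OfFamily F).hL' (stage3OfFamily F).b₀ (stage3OfFamily F).b₁ (Mstar F)) (σW F)) * rowConst261 (@geo9Y (stage3OfFamily F).d₆ (stage3OfFamily F).ℓ₆ (stage3OfFamily F).hd' (stage3OfFamily F).hL' (stage3OfFamily F).b₀ (stage3OfFamily F).b₁ (Mstar F)) (σW F)) ((CP F) * ((((stage3OfFamily F).ℓ₆ + 1 : ℕ) : ℝ)) * (((((stage3OfFamily F).d₆ + 1 : ℕ) : ℝ) * (p F).C (B9RWSums347DefiniteFaces.exp261 (@geo9Y (stage3OfFamily F).d₆ (stage3OfFamily F).ℓ₆ (stage3OfFamily F).hd' (stage3OfFamily F).hL' (stage3OfFamily F).b₀ (stage3OfFamily F).b₁ (Mstar F)) (p F).δ₀ (p F).α)) * (cR39 (trBasis 2))⁻¹ * rowConst261 (@geo9Y (stage3OfFamily F).d₆ (stage3OfFamily F).ℓ₆ (stage3OfFamily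 F).hd' (stage3OfFamily F).hL' (stage3OfFamily F).b₀ (stage3OfFamily F).b₁ (Mstar F)) (σW F)) * rowConst261 (@geo9Y (stage3OfFamily F).d₆ (stage3OfFamily F).ℓ₆ (stage3OfFamily F).hd' (stage3OfFamily F).hL' (stage3OfFamily F).b₀ (stage3OfFamily F).b₁ (Mstar F)) (σW F)) ≤ (B12₃ F)) (E14₁ E14₂ : ∀ F : T4Family, ∀ x : MemberY (stage3OfFamily F).d₆ (stage3OfFamily F).ℓ₆ (stage3OfFamily F).hd' (stage3OfFamily F).hL' (stage3OfFamily F).b₀ (stage3OfFamily F).b₁ (Mstar F), B9.RWExpansion (geo9Y x) (bg9YR (Matrix (Fin 2) (Fin 2) ℂ) (specialUnitaryUnits (Fin 2)) (R₁ F) (R₂ F) x)) (T14₁ : ∀ F : T4Family, ∀ x : MemberY (stage3OfFamily F).d₆ (stage3OfFamily F).ℓ₆ (stage3OfFamily F).hd' (stage3OfFamily F).hL' (stage3OfFamily F).b₀ (stage3OfFamily F).b₁ (Mstar F), ((E14₁ F) x).Walk → BondOpY (Matrix (Fin 2) (Fin 2) ℂ) x.toKIdx)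
    (T14₂ : ∀ F : T4Family, ∀ x : MemberY (stage3OfFamily F).d₆ (stage3OfFamily F).ℓ₆ (stage3OfFamily F).hd' (stage3OfFamily F).hL' (stage3OfFamily F).b₀ (stage3OfFamily F).b₁ (Mstar F), ((E14₂ F) x).Walk → BondOpY (Matrix (Fin 2) (Fin 2) ℂ) x.toKIdx) (X14₁ : ∀ F : T4Family, ∀ x : MemberY (stage3OfFamily F).d₆ (stage3OfFamily F).ℓ₆ (stage3OfFamily F).hd' (stage3OfFamily F).hL' (stage3OfFamily F).b₀ (stage3OfFamily F).b₁ (Mstar F), ((E14₁ F) x).Walk → ℕ → (geo9Y x).Site → Prop) (M14₁ : ∀ F : T4Family, ∀ x : MemberY (stage3OfFamily F).d₆ (stage3OfFamily F).ℓ₆ (stage3OfFamily F).hd' (stage3OfFamily F).hL' (stage3OfFamily F).b₀ (stage3OfFamily F).b₁ (Mstar F), ((E14₁ F) x).Walk → ℕ → Prop) (X14₂ : ∀ F : T4Family, ∀ x : MemberY (stage3OfFamily F).d₆ (stage3OfFamily F).ℓ₆ (stage3OfFamily F).hd' (stage3OfFamily F).hL' (stage3OfFamily F).b₀ (stage3OfFamily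 F).b₁ (Mstar F), ((E14₂ F) x).Walk → ℕ → (geo9Y x).Site → Prop) (M14₂ : ∀ F : T4Family, ∀ x : MemberY (stage3OfFamily F).d₆ (stage3OfFamily F).ℓ₆ (stage3OfFamily F).hd' (stage3OfFamily F).hL' (stage3OfFamily F).b₀ (stage3OfFamily F).b₁ (Mstar F), ((E14₂ F) x).Walk → ℕ → Prop) (diam14 : ∀ F : T4Family, MemberY (stage3OfFamily F).d₆ (stage3OfFamily F).ℓ₆ (stage3OfFamily F).hd' (stage3OfFamily F).hL' (stage3OfFamily F).b₀ (stage3OfFamily F).b₁ (Mstar F) → ℝ) (r14 : ∀ F : T4Family, ℝ) (hr14 : ∀ F : T4Family, ∀ x, (diam14 F) x ≤ (r14 F)) (near14₁ : ∀ F : T4Family, ∀ (x : MemberY (stage3OfFamily F).d₆ (stage3OfFamily F).ℓ₆ (stage3OfFamily F).hd' (stage3OfFamily F).hL' (stage3OfFamily F).b₀ (stage3OfFamily F).b₁ (Mstar F)) ω m pᵢ, (M14₁ F) x ω m → (X14₁ F) x ω m pᵢ → ∃ qᵢ, qᵢ ∈ OmegaC x.D x.D' ∧ tdistK (ℓ :=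 (stage3OfFamily F).ℓ₆) (Mh := x.Mh) (k := x.k) (P := x.P') (kLab x pᵢ) qᵢ ≤ (diam14 F) x) (first14₁ : ∀ F : T4Family, ∀ (x : MemberY (stage3OfFamily F).d₆ (stage3OfFamily F).ℓ₆ (stage3OfFamily F).hd' (stage3OfFamily F).hL' (stage3OfFamily F).b₀ (stage3OfFamily F).b₁ (Mstar F)) ω y, ((E14₁ F) x).first ω y → (X14₁ F) x ω 0 y)
    (chain14₁ : ∀ F : T4Family, ∀ (x : MemberY (stage3OfFamily F).d₆ (stage3OfFamily F).ℓ₆ (stage3OfFamily F).hd' (stage3OfFamily F).hL' (stage3OfFamily F).b₀ (stage3OfFamily F).b₁ (Mstar F)) ω y y', ((E14₁ F) x).first ω y → ((E14₁ F) x).last ω y' → ∃ l : List (geo9Y x).Site, l.length = ((E14₁ F) x).wlen ω ∧ (∀ (m : ℕ) (hm : m < l.length), (X14₁ F) x ω (m + 1) (l[m])) ∧ B9Thm314.chainSum (geo9Y x).dist y l y' ≤ ((E14₁ F) x).wdist ω y y') (near14₂ : ∀ F : T4Family, ∀ (x : MemberY (stage3OfFamily F).d₆ (stage3OfFamily F).ℓ₆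 (stage3OfFamily F).hd' (stage3OfFamily F).hL' (stage3OfFamily F).b₀ (stage3OfFamily F).b₁ (Mstar F)) ω m pᵢ, (M14₂ F) x ω m → (X14₂ F) x ω m pᵢ → ∃ qᵢ, qᵢ ∈ OmegaC x.D x.D' ∧ tdistK (ℓ := (stage3OfFamily F).ℓ₆) (Mh := x.Mh) (k := x.k) (P := x.P') (kLab x pᵢ) qᵢ ≤ (diam14 F) x) (first14₂ : ∀ F : T4Family, ∀ (x : MemberY (stage3OfFamily F).d₆ (stage3OfFamily F).ℓ₆ (stage3OfFamily F).hd' (stage3OfFamily F).hL' (stage3OfFamily F).b₀ (stage3OfFamily F).b₁ (Mstar F)) ω y, ((E14₂ F) x).first ω y → (X14₂ F) x ω 0 y) (chain14₂ : ∀ F : T4Family, ∀ (x : MemberY (stage3OfFamily F).d₆ (stage3OfFamily F).ℓ₆ (stage3OfFamily F).hd' (stage3OfFamily F).hL' (stage3OfFamily F).b₀ (stage3OfFamily F).b₁ (Mstar F)) ω y y', ((E14₂ F) x).first ω y → ((E14₂ F) x).last ω y' → ∃ l : List (geo9Y x).Site, l.length = ((E14₂ F) x).wlen ω ∧ (∀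 (m : ℕ) (hm : m < l.length), (X14₂ F) x ω (m + 1) (l[m])) ∧ B9Thm314.chainSum (geo9Y x).dist y l y' ≤ ((E14₂ F) x).wdist ω y y') (h14₁ : ∀ F : T4Family, Thm310AllNormsPrinted (c F) geo9Y (bg9YR (Matrix (Fin 2) (Fin 2) ℂ) (specialUnitaryUnits (Fin 2)) (R₁ F) (R₂ F)) (E14₁ F) (fun x ω => kernelFamilyB x.toKIdx (bg9YR (Matrix (Fin 2) (Fin 2) ℂ) (specialUnitaryUnits (Fin 2)) (R₁ F) (R₂ F) x) (fun U => U) ((T14₁ F) x ω) (lettersYOfRecordV4P 2 (stage3OfFamily F) (Mstar F) (𝔯 F) x).parB)) (h14₂ : ∀ F : T4Family, Thm310AllNormsPrinted (c F) geo9Y (bg9YR (Matrix (Fin 2) (Fin 2) ℂ) (specialUnitaryUnits (Fin 2)) (R₁ F) (R₂ F)) (E14₂ F) (fun x ω => kernelFamilyB x.toKIdx (bg9YR (Matrix (Fin 2) (Fin 2) ℂ) (specialUnitaryUnits (Fin 2)) (R₁ F) (R₂ F) x) (fun U => U) ((T14₂ F) x ω) (lettersYOfRecordV4P 2 (stage3OfFamily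 F) (Mstar F) (𝔯 F) x).parB))
    (W14₁ : ∀ F : T4Family, ∀ x : MemberY (stage3OfFamily F).d₆ (stage3OfFamily F).ℓ₆ (stage3OfFamily F).hd' (stage3OfFamily F).hL' (stage3OfFamily F).b₀ (stage3OfFamily F).b₁ (Mstar F), ℕ → (geo9Y x).Site → (geo9Y x).Site → Finset ((E14₁ F) x).Walk) (W14₂ : ∀ F : T4Family, ∀ x : MemberY (stage3OfFamily F).d₆ (stage3OfFamily F).ℓ₆ (stage3OfFamily F).hd' (stage3OfFamily F).hL' (stage3OfFamily F).b₀ (stage3OfFamily F).b₁ (Mstar F), ℕ → (geo9Y x).Site → (geo9Y x).Site → Finset ((E14₂ F) x).Walk) (hW14₁ : ∀ F : T4Family, ∀ x, WalkSetsSpec ((E14₁ F) x) ((W14₁ F) x)) (hW14₂ : ∀ F : T4Family, ∀ x, WalkSetsSpec ((E14₂ F) x) ((W14₂ F) x)) (hcnt14₁ : ∀ F : T4Family, WalkWeightsSummable geo9Y (bg9YR (Matrix (Fin 2) (Fin 2) ℂ) (specialUnitaryUnits (Fin 2)) (R₁ F) (R₂ F)) (E14₁ F) (W14₁ F)) (hcnt14₂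 : ∀ F : T4Family, WalkWeightsSummable geo9Y (bg9YR (Matrix (Fin 2) (Fin 2) ℂ) (specialUnitaryUnits (Fin 2)) (R₁ F) (R₂ F)) (E14₂ F) (W14₂ F)) (hexp14 : ∀ F : T4Family, ∀ (x : MemberY (stage3OfFamily F).d₆ (stage3OfFamily F).ℓ₆ (stage3OfFamily F).hd' (stage3OfFamily F).hL' (stage3OfFamily F).b₀ (stage3OfFamily F).b₁ (Mstar F)) (U : (bg9YR (Matrix (Fin 2) (Fin 2) ℂ) (specialUnitaryUnits (Fin 2)) (R₁ F) (R₂ F) x).Cfg), ((E14₁ F) x).Converges U ∧ ((E14₂ F) x).Converges U → ExpansionReads x.toKIdx (B := bg9YR (Matrix (Fin 2) (Fin 2) ℂ) (specialUnitaryUnits (Fin 2)) (R₁ F) (R₂ F) x) (fun U => U) (lettersYOfRecordV4P 2 (stage3OfFamily F) (Mstar F) (𝔯 F) x).Kdiff (pairOp (locDataY x ((E14₁ F) x) ((X14₁ F) x) ((M14₁ F) x) ((diam14 F) x)).Touches (locData₂ (locDataY x ((E14₁ F) x) ((X14₁ F) x) ((M14₁ F) x) ((diam14 F) x)) ((X14₂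 F) x) ((M14₂ F) x)).Touches ((T14₁ F) x) ((T14₂ F) x)) (pairWalkSets ((W14₁ F) x) ((W14₂ F) x) (locDataY x ((E14₁ F) x) ((X14₁ F) x) ((M14₁ F) x) ((diam14 F) x)).Touches (locData₂ (locDataY x ((E14₁ F) x) ((X14₁ F) x) ((M14₁ F) x) ((diam14 F) x)) ((X14₂ F) x) ((M14₂ F) x)).Touches) U) (a₀E δ₁E B₁E : ∀ F : T4Family, ℝ) (ha₀E : ∀ F : T4Family, 0 < (a₀E F)) (hδ₁E : ∀ F : T4Family, 0 < (δ₁E F)) (hB₁E : ∀ F : T4Family, 0 < (B₁E F))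
    (hE : ∀ F : T4Family, ∀ (x : MemberY (stage3OfFamily F).d₆ (stage3OfFamily F).ℓ₆ (stage3OfFamily F).hd' (stage3OfFamily F).hL' (stage3OfFamily F).b₀ (stage3OfFamily F).b₁ (Mstar F)), ((Mstar F) : ℝ) ≤ (geo9Y x).M → ∀ (α₀ : ℝ), 0 < α₀ → (geo9Y x).M * α₀ ≤ (a₀E F) → ∀ U : (bg9YR (Matrix (Fin 2) (Fin 2) ℂ) (specialUnitaryUnits (Fin 2)) (R₁ F) (R₂ F) x).Cfg, (bg9YR (Matrix (Fin 2) (Fin 2) ℂ) (specialUnitaryUnits (Fin 2)) (R₁ F) (R₂ F) x).Reg335 (c F) α₀ U → (bg9YR (Matrix (Fin 2) (Fin 2) ℂ) (specialUnitaryUnits (Fin 2)) (R₁ F) (R₂ F) x).Reg336 (c F) α₀ U → givenBy3185stY x (lettersYOfRecordV4P 2 (stage3OfFamily F) (Mstar F) (𝔯 F) x) (sectEStYOfRecordV7 2 (stage3OfFamily F) (Mstar F) (𝔢₀ F) x) U ∧ hasRWExpCY ((𝔴 F) x) U (δ₁E F) ∧ DecayMidOnStY x (lettersYOfRecordV4P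 2 (stage3OfFamily F) (Mstar F) (𝔯 F) x) (sectEStYOfRecordV7 2 (stage3OfFamily F) (Mstar F) (𝔢₀ F) x) (B₁E F) U (δ₁E F)) (τS δP Bx13₀ : ∀ F : T4Family, ℝ) (hτS : ∀ F : T4Family, 0 < (τS F)) (hBx13₀ : ∀ F : T4Family, 0 ≤ (Bx13₀ F)) (hwBx13 : ∀ F : T4Family, ∀ s, 0 < s → s < 1 → (wX F) s * (Bx13 F) s ≤ (Bx13₀ F)) (hρP12 : ∀ F : T4Family, (ρ12 F) + 2 * (σ12 F) ≤ (δP F)) (hU8a : ∀ F : T4Family, (δK12 F) + 3 * (σS F) + 4 * (τS F) ≤ (1 - 2 * (p F).α) * (p F).δ₀) (hU8b : ∀ F : T4Family, (δK12 F) + 3 * (σS F) + 4 * (τS F) ≤ min ((1 - 2 * (p F).α) * (p F).δ₀) (δ39 F) / 8) (hU8c : ∀ F : T4Family, (δK12 F) + 3 * (σS F) + 4 * (τS F) ≤ (δ₂ F)) (hU8d : ∀ F : T4Family, (δK12 F) + 3 * (σS F) + 5 * (τS F) ≤ (δ44G F)) (hU8e : ∀ F : T4Family, (δK12 F) + 3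 * (σS F) + 4 * (τS F) ≤ (δB F)) (hU8f : ∀ F : T4Family, (δK12 F) + 2 * (σS F) + (τS F) ≤ (δ43 F)) (hU8g : ∀ F : T4Family, (δK12 F) + (τS F) + (σS F) ≤ (δT12 F)) (hU8h : ∀ F : T4Family, (δK12 F) + (τS F) + (σS F) ≤ (δ12₃ F)) (hU8i : ∀ F : T4Family, (δK12 F) + (τS F) + (σS F) ≤ (δP F)) (hU8j : ∀ F : T4Family, (δP F) + 2 * (τS F) ≤ (δ12₀ F)) (hU8k : ∀ F : T4Family, (δP F) + (σS F) + 2 * (τS F) ≤ (δ12₃ F)) (τR : ∀ F : T4Family, ℝ) (hτR : ∀ F : T4Family, 0 < (τR F)) (hR8a : ∀ F : T4Family, (δ12₃ F) + 5 * (τR F) + 3 * (σS F) + 4 * (τS F) ≤ (1 - 2 * (p F).α) * (p F).δ₀) (hR8b : ∀ F : T4Family, (δ12₃ F) + 5 * (τR F) + 3 * (σS F) + 4 * (τS F) ≤ min ((1 - 2 * (p F).α) * (p F).δ₀) (δ39 F) / 8) (hR8c : ∀ F : T4Family, (δ12₃ F) + 5 * (τR F) + 3 * (σS F) + 4 * (τS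 F) ≤ (δ₂ F)) (hR8d : ∀ F : T4Family, (δ12₃ F) + 5 * (τR F) + 3 * (σS F) + 5 * (τS F) ≤ (δ44G F))
    (hR8e : ∀ F : T4Family, (δ12₃ F) + 5 * (τR F) + 3 * (σS F) + 4 * (τS F) ≤ (δB F)) (hR8f : ∀ F : T4Family, (δ12₃ F) + 5 * (τR F) + 2 * (σS F) + (τS F) ≤ (δ43 F)) (hR8g : ∀ F : T4Family, (δ12₃ F) + 5 * (τR F) + (τS F) + (σS F) ≤ (δT12 F)) (hR8h : ∀ F : T4Family, (δ12₃ F) + 5 * (τR F) + 2 * (σS F) + 3 * (τS F) < (δ12₀ F)) (hR8i : ∀ F : T4Family, (δ12₃ F) + 5 * (τR F) + 2 * (σS F) + 3 * (τS F) < (δ44 F)) (hR8j : ∀ F : T4Family, (δ12₃ F) + 5 * (τR F) + 2 * (σS F) + 3 * (τS F) < (δ45 F)) (hR8k : ∀ F : T4Family, (δ12₃ F) + 5 * (τR F) + 2 * (σS F) + 3 * (τS F) < (δ45Y F)) (ρG : ∀ F : T4Family, ℝ) (hρG : ∀ F : T4Family, 0 < (ρG F)) (hρGP : ∀ F : T4Family,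 (ρG F) + (σS F) ≤ (δP F)) (hρGK : ∀ F : T4Family, (ρG F) + 2 * (σS F) ≤ (δK12 F)) (κC δC2 : ∀ F : T4Family, ℝ) (hκC : ∀ F : T4Family, 0 ≤ (κC F)) (hgap : ∀ F : T4Family, (δ₂ F) < (δC2 F)) (hC2 : ∀ F : T4Family, ∀ x : MemberY (stage3OfFamily F).d₆ (stage3OfFamily F).ℓ₆ (stage3OfFamily F).hd' (stage3OfFamily F).hL' (stage3OfFamily F).b₀ (stage3OfFamily F).b₁ (Mstar F), (M12 F) ≤ (geo9Y x).M → ∀ α₀ : ℝ, 0 < α₀ → (geo9Y x).M * α₀ ≤ (a12 F) → ∀ U : (bg9YR (Matrix (Fin 2) (Fin 2) ℂ) (specialUnitaryUnits (Fin 2)) (R₁ F) (R₂ F) x).Cfg, (bg9YR (Matrix (Fin 2) (Fin 2) ℂ) (specialUnitaryUnits (Fin 2)) (R₁ F) (R₂ F) x).Reg335 (c F) α₀ U → (bg9YR (Matrix (Fin 2) (Fin 2) ℂ) (specialUnitaryUnits (Fin 2)) (R₁ F) (R₂ F) x).Reg336 (c F) α₀ U → C2FormMaj x.toKIdx (g :=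 geo9Y x) ((bI F) x) (fun cᵢ => cᵢ) (c2YOfRecord 2 (stage3OfFamily F) (Mstar F) x).form U (κC F) (δC2 F) (fun cᵢ => (geo9Y x).len cᵢ * ((((((stage3OfFamily F).ℓ₆ + 1 : ℕ) : ℝ) ^ ((stage3OfFamily F).d₆ + 1)) ^ lvl x.hN x.D x.hk cᵢ)⁻¹))) (ιR : ∀ F : T4Family, Type) (instN06_7 : ∀ F : T4Family, Fintype (ιR F)) (instN06_8 : ∀ F : T4Family, DecidableEq (ιR F)) (bR : ∀ F : T4Family, Module.Basis (ιR F) ℝ (Matrix (Fin 2) (Fin 2) ℂ)) (C38 : ∀ F : T4Family, ∀ j : (SCMemberY (stage3OfFamily F).d₆ (stage3OfFamily F).ℓ₆ (stage3OfFamily F).hd' (stage3OfFamily F).hL' (stage3OfFamily F).b₀ (stage3OfFamily F).b₁ (Mstar F)), ℝ → CfgY (Matrix (Fin 2) (Fin 2) ℂ) j.val.toKIdx → AfldY (Matrix (Fin 2) (Fin 2) ℂ) j.val.toKIdx → Prop)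
    (instN06_9 : ∀ F : T4Family, ∀ x : MemberY (stage3OfFamily F).d₆ (stage3OfFamily F).ℓ₆ (stage3OfFamily F).hd' (stage3OfFamily F).hL' (stage3OfFamily F).b₀ (stage3OfFamily F).b₁ (Mstar F), Nonempty (geo9Y x).Site)
    -- NODE N07's LEAF from NODE 00's `CarriersZSectE.b11Leaf_Z11OfRecord_withSectE_of_parts` at print's letters `L := F.L`, `η i := (F.P i.K).eta i.k`: the six remaining printed parts of [B11] + n16's dictionary inputs, displayed per F
    (hN07 : ∀ F : T4Family, ∃ (β : ZIdx → Type) (_ : ∀ i, Fintype (β i)) (_ : Fact (0 < (F.L : ℝ))) (_ : ∀ i : ZIdx, Fact (0 < (F.P i.K).eta i.k))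
      (ζ : ResidZ F 2) (E : SectEPres F 2 (F.L : ℝ) (fun i : ZIdx => (F.P i.K).eta i.k) β ζ)
      (βr : ∀ i, B11Prop7Assembly.Bridge ((Z11OfRecord F 2 (ζ.withSectE E)).famX i) ((Z11OfRecord F 2 (ζ.withSectE E)).famLG i)) (O₁ O₂ e₅ a : ℝ),
      0 < E.C₄ ∧ 0 < E.a₃ ∧ 0 < E.α ∧
      (∀ i, (βr i).Laws ζ.C₁ ζ.B₃) ∧ (∀ i, B11Prop7Assembly.ExistenceLeavesCap (βr i) ζ.B₀ ζ.B₃ ζ.C₁ O₁ O₂ e₅) ∧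
      (∀ i, ((Z11OfRecord F 2 (ζ.withSectE E)).famX i).Laws) ∧
      0 < ζ.B₀ ∧ 0 < ζ.B₁ ∧ 1 ≤ ζ.B₃ ∧ 1 ≤ ζ.C₁ ∧ ζ.B₀ ≤ 4 * ζ.B₁ ∧ 0 < ζ.c₁ ∧ 0 < O₁ ∧ 0 < O₂ ∧ 0 < e₅ ∧ 0 < a ∧
      (∀ (i : ZIdx) (ε₁ : ℝ) (V : ((Z11OfRecord F 2 (ζ.withSectE E)).famX i).Bdry), 0 < ε₁ → ε₁ ≤ a →
        ((Z11OfRecord F 2 (ζ.withSectE E)).famX i).Reg7 ε₁ V →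
          ∃ U₀ : ((Z11OfRecord F 2 (ζ.withSectE E)).famLG i).Cfg,
            ((Z11OfRecord F 2 (ζ.withSectE E)).famLG i).Sat14 (ζ.C₁ * ζ.B₃ * ε₁) (ζ.C₁ * ε₁) ((βr i).bdry V) U₀) ∧
      B11.Prop2Printed ζ.B₁ ζ.B₃ ζ.C₁ ζ.c₁ (Z11OfRecord F 2 (ζ.withSectE E)).famLG ∧
      B11.Prop3Printed ζ.C₁ ζ.B₃ ζ.C₂ ζ.C₃ ζ.B₀ ζ.c1h ζ.c₄ ζ.δ₀ (Z11OfRecord F 2 (ζ.withSectE E)).famLG ∧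
      B11.Prop5Printed ζ.B₁ ζ.B₃ ζ.C₁ (Z11OfRecord F 2 (ζ.withSectE E)).famLG ∧
      B11.Prop8Printed ζ.B₃ (Z11OfRecord F 2 (ζ.withSectE E)).famX ∧ B11.SectFPrinted ζ.B₃ (Z11OfRecord F 2 (ζ.withSectE E)).famX ∧
      B11.Prop9Printed ζ.B₅ ζ.C₁ ζ.β₀ ζ.δ₀ ζ.famAn)
    -- NODE N08's SLOT from dag-n08-w4's `…N08AlphaEq324RowACReMassedZSlot.printedUV3V_at_slotOfRecord_of_coreLTAtAC_of_massBoundZAE_of_consts` at `N := 2, L := F.L`: N08's (α)-AC residual (R-AC-324⁷ reading), displayed per F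
    (hN08 : ∀ F : T4Family, ∃ (𝔊 : Literature.MathematicalPhysics.QuantumFieldTheory.Balaban1985CMP102.Setting.GroupModel (SU 2)) (𝔠 : Summit.QuantumFields.Balaban3D.Proofs.Primitives.AlphaConsts F.L 𝔊.N) (εbg cm : ℝ)
      (X : ∀ S : Literature.MathematicalPhysics.QuantumFieldTheory.Balaban1985CMP102.Setting.Scales F.L, Summit.QuantumFields.Balaban3D.Proofs.StandardAC.ExternalInputsAC S (SU 2))
      (𝔖 : ∀ (S : Literature.MathematicalPhysics.QuantumFieldTheory.Balaban1985CMP102.Setting.Scales F.L) (k : ℕ), Summit.QuantumFields.Balaban3D.Carriers.StepSeries S (SU 2) ↥(Summit.QuantumFields.Balaban3D.Proofs.GroupModelLieC.lieC 𝔊) (Summit.QuantumFields.Balaban3D.Carriers.nblkOf S 𝔠.lane.carrier k) k)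
      (𝔄 : ∀ S : Literature.MathematicalPhysics.QuantumFieldTheory.Balaban1985CMP102.Setting.Scales F.L, Summit.QuantumFields.YangMills.Theorems.BalabanUVNodesN08AlphaEq324RowAC.AlphaDataLTAC 𝔊 𝔠 (X S) (𝔖 S))
      (c : ∀ (S : Literature.MathematicalPhysics.QuantumFieldTheory.Balaban1985CMP102.Setting.Scales F.L) (k : ℕ), Summit.QuantumFields.Balaban3D.Carriers.Hist S.P (k + 1) → GaugeField S.P (k + 1) (SU 2) → ℕ → ℝ),
      (∀ S, (X S).av = B10RunsOfRecord.avOfPrint 2 S) ∧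
      (∀ (S : Literature.MathematicalPhysics.QuantumFieldTheory.Balaban1985CMP102.Setting.Scales F.L) k (V : GaugeField S.P (k + 1) (SU 2)), (X S).Uk k V = B10RunsOfRecord.UkA 2 (fun S => (X S).av) S (k + 1) εbg V) ∧
      𝔠.lane.F.b₀ * (𝔠.lane.F.p₀ ^ 𝔠.lane.F.p₀ * Real.exp (1 - 𝔠.lane.F.p₀)) ≤ εbg ∧
      (∀ S : Literature.MathematicalPhysics.QuantumFieldTheory.Balaban1985CMP102.Theorems.Family F.L (Summit.QuantumFields.Balaban3D.Proofs.Constants.eps0Of 𝔠.gamma0), Summit.QuantumFields.YangMills.Theorems.BalabanUVNodesN08AlphaEq324RowAC.RunAlphaEq324CoreLTAtAC 𝔊 𝔠 (X S.1) (𝔖 S.1) (𝔄 S.1) (c S.1)) ∧ 0 ≤ cm ∧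
      (∀ S : Literature.MathematicalPhysics.QuantumFieldTheory.Balaban1985CMP102.Theorems.Family F.L (Summit.QuantumFields.Balaban3D.Proofs.Constants.eps0Of 𝔠.gamma0), ∀ k, 1 ≤ k → k ≤ S.1.K → ∀ h : Summit.QuantumFields.Balaban3D.Carriers.Hist S.1.P k, ∀ᵐ U ∂(fieldMeasure S.1.P k (SU 2)),
        Summit.QuantumFields.Balaban3D.Proofs.MassesAC.massRecAC 𝔠.lane.carrier.M₁ (Summit.QuantumFields.Balaban3D.Carriers.rcolOf S.1 𝔠.lane.carrier) (Summit.QuantumFields.Balaban3D.Carriers.eps1Of S.1 𝔠.lane.carrier) (Summit.QuantumFields.Balaban3D.Carriers.epsSOf S.1 𝔠.lane.carrier) (X S.1).av k h U ≤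
          Real.exp (cm * S.1.sites k + 𝔠.lane.carrier.dg * 𝔠.lane.carrier.c₁ *
            ∑ j ∈ Finset.range k, (Summit.QuantumFields.Balaban3D.Carriers.ZVol 𝔠.lane.carrier.M₁ (Summit.QuantumFields.Balaban3D.Carriers.rcolOf S.1 𝔠.lane.carrier) k h j : ℝ))))
    (h09 : ∀ (F : T4Family) {j : ℕ} {γ ε₀ ε₂₉ B₃ B₃' a₀ a₁ : ℝ} (hγ₀ : 0 < γ) (hγh : γ ≤ 1 / 2) (hε : 0 < ε₀) (hε' : 0 < ε₂₉) (hB : 0 ≤ B₃) (hB' : 0 ≤ B₃') (ha₀ : 0 < a₀) (ha₁ : 0 < a₁) (ha₀ρ : a₀ ≤ 1 / (109824 * (F.L : ℝ) ^ 2)) (hε₀ρ : ε₀ = a₀) {bl β' : ℝ} (hbox : BetaLowerH bl γ (betaOfRecord₁₃ F 2 (theta13OfThm1CCMWZB F 2 j γ a₀ ε₀ ε₂₉ B₃ B₃' a₀ a₁ (Efl F j γ ε₀ ε₂₉ B₃ B₃' a₀ a₁) (fun p i => Real.log (B16ZLower.zNorm (SU 2) (gOfRecord₁₃ F 2 (theta13OfThm1CCMWZB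 F 2 j γ a₀ ε₀ ε₂₉ B₃ B₃' a₀ a₁ (fun _ _ => 0) (fun _ _ => 0)) p i ^ 2) ε))))) (hbox' : BetaUpperH β' γ (betaOfRecord₁₃ F 2 (theta13OfThm1CCMWZB F 2 j γ a₀ ε₀ ε₂₉ B₃ B₃' a₀ a₁ (Efl F j γ ε₀ ε₂₉ B₃ B₃' a₀ a₁) (fun p i => Real.log (B16ZLower.zNorm (SU 2) (gOfRecord₁₃ F 2 (theta13OfThm1CCMWZB F 2 j γ a₀ ε₀ ε₂₉ B₃ B₃' a₀ a₁ (fun _ _ => 0) (fun _ _ => 0)) p i ^ 2) ε))))) (hl : -bl * γ ^ 2 ≤ 3) (hβ' : β' * γ ^ 2 ≤ 3 / 4),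
      ∃ lam12 : ResidB12 F 2 (theta13OfThm1CCMWZB F 2 j γ a₀ ε₀ ε₂₉ B₃ B₃' a₀ a₁ (Efl F j γ ε₀ ε₂₉ B₃ B₃' a₀ a₁) (fun p i => Real.log (B16ZLower.zNorm (SU 2) (gOfRecord₁₃ F 2 (theta13OfThm1CCMWZB F 2 j γ a₀ ε₀ ε₂₉ B₃ B₃' a₀ a₁ (fun _ _ => 0) (fun _ _ => 0)) p i ^ 2) ε))).τ9.M,
      ∀ P : B12.RunParams, B12Sec2to5.Lemma4Printed (F12OfRecord₁₂ F 2 (theta13OfThm1CCMWZB F 2 j γ a₀ ε₀ ε₂₉ B₃ B₃' a₀ a₁ (Efl F j γ ε₀ ε₂₉ B₃ B₃' a₀ a₁) (fun p i => Real.log (B16ZLower.zNorm (SU 2) (gOfRecord₁₃ F 2 (theta13OfThm1CCMWZB F 2 j γ a₀ ε₀ ε₂₉ B₃ B₃' a₀ a₁ (fun _ _ => 0) (fun _ _ => 0)) p i ^ 2) ε))).toStage12Params lam12 P) (lam12 P).consts)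
    (hN09T : ∀ (F : T4Family) {j : ℕ} {γ ε₀ ε₂₉ B₃ B₃' a₀ a₁ : ℝ} (hγ₀ : 0 < γ) (hγh : γ ≤ 1 / 2) (hε : 0 < ε₀) (hε' : 0 < ε₂₉) (hB : 0 ≤ B₃) (hB' : 0 ≤ B₃') (ha₀ : 0 < a₀) (ha₁ : 0 < a₁) (ha₀ρ : a₀ ≤ 1 / (109824 * (F.L : ℝ) ^ 2)) (hε₀ρ : ε₀ = a₀) {bl β' : ℝ} (hbox : BetaLowerH bl γ (betaOfRecord₁₃ F 2 (theta13OfThm1CCMWZB F 2 j γ a₀ ε₀ ε₂₉ B₃ B₃' a₀ a₁ (Efl F j γ ε₀ ε₂₉ B₃ B₃' a₀ a₁) (fun p i => Real.log (B16ZLower.zNorm (SU 2) (gOfRecord₁₃ F 2 (theta13OfThm1CCMWZB F 2 j γ a₀ ε₀ ε₂₉ B₃ B₃' a₀ a₁ (fun _ _ => 0) (fun _ _ => 0)) p i ^ 2) ε))))) (hbox' : BetaUpperH β' γ (betaOfRecord₁₃ F 2 (theta13OfThm1CCMWZB F 2 j γ a₀ ε₀ ε₂₉ B₃ B₃' a₀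 a₁ (Efl F j γ ε₀ ε₂₉ B₃ B₃' a₀ a₁) (fun p i => Real.log (B16ZLower.zNorm (SU 2) (gOfRecord₁₃ F 2 (theta13OfThm1CCMWZB F 2 j γ a₀ ε₀ ε₂₉ B₃ B₃' a₀ a₁ (fun _ _ => 0) (fun _ _ => 0)) p i ^ 2) ε))))) (hl : -bl * γ ^ 2 ≤ 3) (hβ' : β' * γ ^ 2 ≤ 3 / 4),
      ∃ cd : (P : B12.RunParams) → (i : ℕ) → ContourData (F.P P.K) i (SU 2),
        (∀ (P : B12.RunParams) (k : ℕ), k ≤ P.K → ∀ V ∈ domAltOfRecord F 2 (numerics7OfThm1CCM F.L j ε₀ B₃ B₃' a₀ a₁) P.K k, Uk F 2 P.K k a₀ V ∈ bgReg F 2 P.K k a₀) ∧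
        (∀ (P : B12.RunParams), ∀ i < P.K, ∀ W ∈ domAltOfRecord F 2 (numerics7OfThm1CCM F.L j ε₀ B₃ B₃' a₀ a₁) P.K (i + 1), AxialGauge (cd P i) (critCfgOfRecord F 2 (numerics7OfThm1CCM F.L j ε₀ B₃ B₃' a₀ a₁) P.K i W)) ∧
        (∀ (P : B12.RunParams) (k : ℕ), k ≤ P.K → ∀ V ∈ domAltOfRecord F 2 (numerics7OfThm1CCM F.L j ε₀ B₃ B₃' a₀ a₁) P.K k, ∀ i < k, AxialGauge (cd P i) (Averaging.iter (avOfRecord F 2 P.K) i (Uk F 2 P.K k a₀ V))) ∧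
        (∀ (P : B12.RunParams) (i : ℕ), i + 1 < P.K → ∀ U : GaugeField (F.P P.K) (i + 1) (SU 2), (avOfRecord F 2 P.K (i + 1)).avg U ∈ domAltOfRecord F 2 (numerics7OfThm1CCM F.L j ε₀ B₃ B₃' a₀ a₁) P.K (i + 2) →
          U ∉ regSetOfRecord F 2 P.K i (betaInputOfRecord F 2 (TβOfRecord₁₃ F 2) (chiβOfRecord₁₃ F 2 (theta13OfThm1CCMWZB F 2 j γ a₀ ε₀ ε₂₉ B₃ B₃' a₀ a₁ (Efl F j γ ε₀ ε₂₉ B₃ B₃' a₀ a₁) (fun p i => Real.log (B16ZLower.zNorm (SU 2) (gOfRecord₁₃ F 2 (theta13OfThm1CCMWZB F 2 j γ a₀ ε₀ ε₂₉ B₃ B₃' a₀ a₁ (fun _ _ => 0) (fun _ _ => 0)) p i ^ 2) ε)))) P.K (gOfRecord₁₃ F 2 (theta13OfThm1CCMWZB F 2 j γ a₀ ε₀ ε₂₉ B₃ B₃' a₀ a₁ (Efl F j γ ε₀ ε₂₉ B₃ B₃' a₀ a₁) (fun p i => Real.log (B16ZLower.zNorm (SU 2) (gOfRecord₁₃ F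 2 (theta13OfThm1CCMWZB F 2 j γ a₀ ε₀ ε₂₉ B₃ B₃' a₀ a₁ (fun _ _ => 0) (fun _ _ => 0)) p i ^ 2) ε))) P) i) ∩ domAltOfRecord F 2 (numerics7OfThm1CCM F.L j ε₀ B₃ B₃' a₀ a₁) P.K (i + 1) →
            chiβOfRecord₁₃ F 2 (theta13OfThm1CCMWZB F 2 j γ a₀ ε₀ ε₂₉ B₃ B₃' a₀ a₁ (Efl F j γ ε₀ ε₂₉ B₃ B₃' a₀ a₁) (fun p i => Real.log (B16ZLower.zNorm (SU 2) (gOfRecord₁₃ F 2 (theta13OfThm1CCMWZB F 2 j γ a₀ ε₀ ε₂₉ B₃ B₃' a₀ a₁ (fun _ _ => 0) (fun _ _ => 0)) p i ^ 2) ε))) P.K (gOfRecord₁₃ F 2 (theta13OfThm1CCMWZB F 2 j γ a₀ ε₀ ε₂₉ B₃ B₃' a₀ a₁ (Efl F j γ ε₀ ε₂₉ B₃ B₃' a₀ a₁) (fun p i => Real.log (B16ZLower.zNorm (SU 2) (gOfRecord₁₃ F 2 (theta13OfThm1CCMWZB F 2 j γ a₀ ε₀ ε₂₉ B₃ B₃'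 a₀ a₁ (fun _ _ => 0) (fun _ _ => 0)) p i ^ 2) ε))) P) (i + 1) U = 0) ∧
        (∀ (P : B12.RunParams), ∀ i < P.K, MeasureTheory.Integrable (betaInputOfRecord F 2 (TβOfRecord₁₃ F 2) (chiβOfRecord₁₃ F 2 (theta13OfThm1CCMWZB F 2 j γ a₀ ε₀ ε₂₉ B₃ B₃' a₀ a₁ (Efl F j γ ε₀ ε₂₉ B₃ B₃' a₀ a₁) (fun p i => Real.log (B16ZLower.zNorm (SU 2) (gOfRecord₁₃ F 2 (theta13OfThm1CCMWZB F 2 j γ a₀ ε₀ ε₂₉ B₃ B₃' a₀ a₁ (fun _ _ => 0) (fun _ _ => 0)) p i ^ 2) ε)))) P.K (gOfRecord₁₃ F 2 (theta13OfThm1CCMWZB F 2 j γ a₀ ε₀ ε₂₉ B₃ B₃' a₀ a₁ (Efl F j γ ε₀ ε₂₉ B₃ B₃' a₀ a₁) (fun p i => Real.log (B16ZLower.zNorm (SU 2) (gOfRecord₁₃ F 2 (theta13OfThm1CCMWZB F 2 j γ a₀ ε₀ ε₂₉ B₃ B₃' a₀ a₁ (fun _ _ => 0) (fun _ _ => 0))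 p i ^ 2) ε))) P) i) (fieldMeasure (F.P P.K) i (SU 2))) ∧
        (∀ (P : B12.RunParams) (k : ℕ), k ≤ P.K → ∀ V ∈ domAltOfRecord F 2 (numerics7OfThm1CCM F.L j ε₀ B₃ B₃' a₀ a₁) P.K k, UkExists F 2 P.K k a₀ V ∧ UniqueUkOrbit F 2 P.K k a₀ V) ∧
        (∀ (P : B12.RunParams) (k : ℕ), k ≤ P.K → HRestrict F 2 a₀ P.K k (domAltOfRecord F 2 (numerics7OfThm1CCM F.L j ε₀ B₃ B₃' a₀ a₁) P.K k)) ∧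
        (∀ (P : B12.RunParams) (k : ℕ), k ≤ P.K → ∀ V ∈ domAltOfRecord F 2 (numerics7OfThm1CCM F.L j ε₀ B₃ B₃' a₀ a₁) P.K k, ∀ i < k, UniqueUkOrbit F 2 P.K (i + 1) a₀ (Averaging.iter (avOfRecord F 2 P.K) (i + 1) (Uk F 2 P.K k a₀ V))))
    (h10 : ∀ F : T4Family, ∃ lam13 : B12.RunParams → ResidB13 (stage3OfFamily F), ∀ P : B12.RunParams, B13LeafOfRecord (stage3OfFamily F) (lam13 P))
    (h11N : ∀ (F : T4Family) {j : ℕ} {γ ε₀ ε₂₉ B₃ B₃' a₀ a₁ : ℝ} (hγ₀ : 0 < γ) (hγh : γ ≤ 1 / 2) (hε : 0 < ε₀) (hε' : 0 < ε₂₉) (hB : 0 ≤ B₃) (hB' : 0 ≤ B₃') (ha₀ : 0 < a₀) (ha₁ : 0 < a₁) (ha₀ρ : a₀ ≤ 1 / (109824 * (F.L : ℝ) ^ 2)) (hε₀ρ : ε₀ = a₀) {bl β' : ℝ} (hbox : BetaLowerH bl γ (betaOfRecord₁₃ F 2 (theta13OfThm1CCMWZB F 2 j γ a₀ ε₀ ε₂₉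 B₃ B₃' a₀ a₁ (Efl F j γ ε₀ ε₂₉ B₃ B₃' a₀ a₁) (fun p i => Real.log (B16ZLower.zNorm (SU 2) (gOfRecord₁₃ F 2 (theta13OfThm1CCMWZB F 2 j γ a₀ ε₀ ε₂₉ B₃ B₃' a₀ a₁ (fun _ _ => 0) (fun _ _ => 0)) p i ^ 2) ε))))) (hbox' : BetaUpperH β' γ (betaOfRecord₁₃ F 2 (theta13OfThm1CCMWZB F 2 j γ a₀ ε₀ ε₂₉ B₃ B₃' a₀ a₁ (Efl F j γ ε₀ ε₂₉ B₃ B₃' a₀ a₁) (fun p i => Real.log (B16ZLower.zNorm (SU 2) (gOfRecord₁₃ F 2 (theta13OfThm1CCMWZB F 2 j γ a₀ ε₀ ε₂₉ B₃ B₃' a₀ a₁ (fun _ _ => 0) (fun _ _ => 0)) p i ^ 2) ε))))) (hl : -bl * γ ^ 2 ≤ 3) (hβ' : β' * γ ^ 2 ≤ 3 / 4),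
      ∃ σ : (P : B12.RunParams) → Sect3Supplier (gaussPinH (Stage13HParams.ofHistoryBlind F 2 ⟨theta13OfThm1CCMWZB F 2 j γ a₀ ε₀ ε₂₉ B₃ B₃' a₀ a₁ (Efl F j γ ε₀ ε₂₉ B₃ B₃' a₀ a₁) (fun p i => Real.log (B16ZLower.zNorm (SU 2) (gOfRecord₁₃ F 2 (theta13OfThm1CCMWZB F 2 j γ a₀ ε₀ ε₂₉ B₃ B₃' a₀ a₁ (fun _ _ => 0) (fun _ _ => 0)) p i ^ 2) ε)), ZrOfRecord₁₃ F 2 (theta13OfThm1CCMWZB F 2 j γ a₀ ε₀ ε₂₉ B₃ B₃' a₀ a₁ (Efl F j γ ε₀ ε₂₉ B₃ B₃' a₀ a₁) (fun p i => Real.log (B16ZLower.zNorm (SU 2) (gOfRecord₁₃ F 2 (theta13OfThm1CCMWZB F 2 j γ a₀ ε₀ ε₂₉ B₃ B₃' a₀ a₁ (fun _ _ => 0) (fun _ _ => 0)) p i ^ 2) ε)))⟩)) P,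
        (∀ P : B12.RunParams, Step.InInterval γ P.K (gOfRecord₁₃ F 2 (theta13OfThm1CCMWZB F 2 j γ a₀ ε₀ ε₂₉ B₃ B₃' a₀ a₁ (Efl F j γ ε₀ ε₂₉ B₃ B₃' a₀ a₁) (fun p i => Real.log (B16ZLower.zNorm (SU 2) (gOfRecord₁₃ F 2 (theta13OfThm1CCMWZB F 2 j γ a₀ ε₀ ε₂₉ B₃ B₃' a₀ a₁ (fun _ _ => 0) (fun _ _ => 0)) p i ^ 2) ε))) P) → SupplierObligations (gaussPinH (Stage13HParams.ofHistoryBlind F 2 ⟨theta13OfThm1CCMWZB F 2 j γ a₀ ε₀ ε₂₉ B₃ B₃' a₀ a₁ (Efl F j γ ε₀ ε₂₉ B₃ B₃' a₀ a₁) (fun p i => Real.log (B16ZLower.zNorm (SU 2) (gOfRecord₁₃ F 2 (theta13OfThm1CCMWZB F 2 j γ a₀ ε₀ ε₂₉ B₃ B₃' a₀ a₁ (fun _ _ => 0) (fun _ _ => 0)) p i ^ 2) ε)), ZrOfRecord₁₃ F 2 (theta13OfThm1CCMWZB F 2 j γ a₀ ε₀ ε₂₉ B₃ B₃' a₀ a₁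 (Efl F j γ ε₀ ε₂₉ B₃ B₃' a₀ a₁) (fun p i => Real.log (B16ZLower.zNorm (SU 2) (gOfRecord₁₃ F 2 (theta13OfThm1CCMWZB F 2 j γ a₀ ε₀ ε₂₉ B₃ B₃' a₀ a₁ (fun _ _ => 0) (fun _ _ => 0)) p i ^ 2) ε)))⟩)) P (σ P)) ∧
        (∀ P : B12.RunParams, Step.InInterval γ P.K (gOfRecord₁₃ F 2 (theta13OfThm1CCMWZB F 2 j γ a₀ ε₀ ε₂₉ B₃ B₃' a₀ a₁ (Efl F j γ ε₀ ε₂₉ B₃ B₃' a₀ a₁) (fun p i => Real.log (B16ZLower.zNorm (SU 2) (gOfRecord₁₃ F 2 (theta13OfThm1CCMWZB F 2 j γ a₀ ε₀ ε₂₉ B₃ B₃' a₀ a₁ (fun _ _ => 0) (fun _ _ => 0)) p i ^ 2) ε))) P) → OperandRowsAlongChain (gaussPinH (Stage13HParams.ofHistoryBlind F 2 ⟨theta13OfThm1CCMWZB F 2 j γ a₀ ε₀ ε₂₉ B₃ B₃' a₀ a₁ (Efl F j γ ε₀ ε₂₉ B₃ B₃' a₀ a₁) (fun p i => Real.log (B16ZLower.zNorm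 (SU 2) (gOfRecord₁₃ F 2 (theta13OfThm1CCMWZB F 2 j γ a₀ ε₀ ε₂₉ B₃ B₃' a₀ a₁ (fun _ _ => 0) (fun _ _ => 0)) p i ^ 2) ε)), ZrOfRecord₁₃ F 2 (theta13OfThm1CCMWZB F 2 j γ a₀ ε₀ ε₂₉ B₃ B₃' a₀ a₁ (Efl F j γ ε₀ ε₂₉ B₃ B₃' a₀ a₁) (fun p i => Real.log (B16ZLower.zNorm (SU 2) (gOfRecord₁₃ F 2 (theta13OfThm1CCMWZB F 2 j γ a₀ ε₀ ε₂₉ B₃ B₃' a₀ a₁ (fun _ _ => 0) (fun _ _ => 0)) p i ^ 2) ε)))⟩)) P (σ P)))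
    (hEfl : ∀ (F : T4Family) (j : ℕ) (γ ε₀ ε₂₉ B₃ B₃' a₀ a₁ : ℝ), ∃ CE : ℝ, 0 ≤ CE ∧ ∀ (P : B12.RunParams) (i : ℕ), i < P.K → |Efl F j γ ε₀ ε₂₉ B₃ B₃' a₀ a₁ P i| ≤ CE * sitesCard (F.P P.K) (i + 1))
    (h13pos : ∀ (F : T4Family) {j : ℕ} {γ ε₀ ε₂₉ B₃ B₃' a₀ a₁ : ℝ} (hγ₀ : 0 < γ) (hγh : γ ≤ 1 / 2) (hε : 0 < ε₀) (hε' : 0 < ε₂₉) (hB : 0 ≤ B₃) (hB' : 0 ≤ B₃') (ha₀ : 0 < a₀) (ha₁ : 0 < a₁) (ha₀ρ : a₀ ≤ 1 / (109824 * (F.L : ℝ) ^ 2)) (hε₀ρ : ε₀ = a₀) {bl β' : ℝ} (hbox : BetaLowerH bl γ (betaOfRecord₁₃ F 2 (theta13OfThm1CCMWZB F 2 j γ a₀ ε₀ ε₂₉ B₃ B₃' a₀ a₁ (Efl F j γ ε₀ ε₂₉ B₃ B₃' a₀ a₁) (fun p i => Real.log (B16ZLower.zNorm (SU 2) (gOfRecord₁₃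 F 2 (theta13OfThm1CCMWZB F 2 j γ a₀ ε₀ ε₂₉ B₃ B₃' a₀ a₁ (fun _ _ => 0) (fun _ _ => 0)) p i ^ 2) ε))))) (hbox' : BetaUpperH β' γ (betaOfRecord₁₃ F 2 (theta13OfThm1CCMWZB F 2 j γ a₀ ε₀ ε₂₉ B₃ B₃' a₀ a₁ (Efl F j γ ε₀ ε₂₉ B₃ B₃' a₀ a₁) (fun p i => Real.log (B16ZLower.zNorm (SU 2) (gOfRecord₁₃ F 2 (theta13OfThm1CCMWZB F 2 j γ a₀ ε₀ ε₂₉ B₃ B₃' a₀ a₁ (fun _ _ => 0) (fun _ _ => 0)) p i ^ 2) ε))))) (hl : -bl * γ ^ 2 ≤ 3) (hβ' : β' * γ ^ 2 ≤ 3 / 4)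
      (hP : (gaussPinH (Stage13HParams.ofHistoryBlind F 2 ⟨theta13OfThm1CCMWZB F 2 j γ a₀ ε₀ ε₂₉ B₃ B₃' a₀ a₁ (Efl F j γ ε₀ ε₂₉ B₃ B₃' a₀ a₁) (fun p i => Real.log (B16ZLower.zNorm (SU 2) (gOfRecord₁₃ F 2 (theta13OfThm1CCMWZB F 2 j γ a₀ ε₀ ε₂₉ B₃ B₃' a₀ a₁ (fun _ _ => 0) (fun _ _ => 0)) p i ^ 2) ε)), ZrOfRecord₁₃ F 2 (theta13OfThm1CCMWZB F 2 j γ a₀ ε₀ ε₂₉ B₃ B₃' a₀ a₁ (Efl F j γ ε₀ ε₂₉ B₃ B₃' a₀ a₁) (fun p i => Real.log (B16ZLower.zNorm (SU 2) (gOfRecord₁₃ F 2 (theta13OfThm1CCMWZB F 2 j γ a₀ ε₀ ε₂₉ B₃ B₃' a₀ a₁ (fun _ _ => 0) (fun _ _ => 0)) p i ^ 2) ε)))⟩)).Provisos₁₃SepCoPH F 2),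
      ∃ γ₁₃ : ℝ, 0 < γ₁₃ ∧ ∃ em ep : ℝ → ℝ,
        (∀ P : B12.RunParams, ((datumOfRecord₁₃SepCoPH F 2 (gaussPinH (Stage13HParams.ofHistoryBlind F 2 ⟨theta13OfThm1CCMWZB F 2 j γ a₀ ε₀ ε₂₉ B₃ B₃' a₀ a₁ (Efl F j γ ε₀ ε₂₉ B₃ B₃' a₀ a₁) (fun p i => Real.log (B16ZLower.zNorm (SU 2) (gOfRecord₁₃ F 2 (theta13OfThm1CCMWZB F 2 j γ a₀ ε₀ ε₂₉ B₃ B₃' a₀ a₁ (fun _ _ => 0) (fun _ _ => 0)) p i ^ 2) ε)), ZrOfRecord₁₃ F 2 (theta13OfThm1CCMWZB F 2 j γ a₀ ε₀ ε₂₉ B₃ B₃' a₀ a₁ (Efl F j γ ε₀ ε₂₉ B₃ B₃' a₀ a₁) (fun p i => Real.log (B16ZLower.zNorm (SU 2) (gOfRecord₁₃ F 2 (theta13OfThm1CCMWZB F 2 j γ a₀ ε₀ ε₂₉ B₃ B₃' a₀ a₁ (fun _ _ => 0) (fun _ _ => 0)) p i ^ 2) ε)))⟩)) hP).C P).flow.InInterval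 γ₁₃ P.K → ∀ k, k + 1 ≤ P.K → SLaw₁₃CoPH F 2 (gaussPinH (Stage13HParams.ofHistoryBlind F 2 ⟨theta13OfThm1CCMWZB F 2 j γ a₀ ε₀ ε₂₉ B₃ B₃' a₀ a₁ (Efl F j γ ε₀ ε₂₉ B₃ B₃' a₀ a₁) (fun p i => Real.log (B16ZLower.zNorm (SU 2) (gOfRecord₁₃ F 2 (theta13OfThm1CCMWZB F 2 j γ a₀ ε₀ ε₂₉ B₃ B₃' a₀ a₁ (fun _ _ => 0) (fun _ _ => 0)) p i ^ 2) ε)), ZrOfRecord₁₃ F 2 (theta13OfThm1CCMWZB F 2 j γ a₀ ε₀ ε₂₉ B₃ B₃' a₀ a₁ (Efl F j γ ε₀ ε₂₉ B₃ B₃' a₀ a₁) (fun p i => Real.log (B16ZLower.zNorm (SU 2) (gOfRecord₁₃ F 2 (theta13OfThm1CCMWZB F 2 j γ a₀ ε₀ ε₂₉ B₃ B₃' a₀ a₁ (fun _ _ => 0) (fun _ _ => 0)) p i ^ 2) ε)))⟩)) P (k + 1) →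
      ∀ᵐ U ∂(fieldMeasure (F.P P.K) (k + 1) (SU 2)),
        chiβOfRecord₁₃ F 2 (theta13OfThm1CCMWZB F 2 j γ a₀ ε₀ ε₂₉ B₃ B₃' a₀ a₁ (Efl F j γ ε₀ ε₂₉ B₃ B₃' a₀ a₁) (fun p i => Real.log (B16ZLower.zNorm (SU 2) (gOfRecord₁₃ F 2 (theta13OfThm1CCMWZB F 2 j γ a₀ ε₀ ε₂₉ B₃ B₃' a₀ a₁ (fun _ _ => 0) (fun _ _ => 0)) p i ^ 2) ε))) P.K (gOfRecord₁₃ F 2 (theta13OfThm1CCMWZB F 2 j γ a₀ ε₀ ε₂₉ B₃ B₃' a₀ a₁ (Efl F j γ ε₀ ε₂₉ B₃ B₃' a₀ a₁) (fun p i => Real.log (B16ZLower.zNorm (SU 2) (gOfRecord₁₃ F 2 (theta13OfThm1CCMWZB F 2 j γ a₀ ε₀ ε₂₉ B₃ B₃' a₀ a₁ (fun _ _ => 0) (fun _ _ => 0)) p i ^ 2) ε))) P) (k + 1) U *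
              Real.exp (-(1 / (gOfRecord₁₃ F 2 (theta13OfThm1CCMWZB F 2 j γ a₀ ε₀ ε₂₉ B₃ B₃' a₀ a₁ (Efl F j γ ε₀ ε₂₉ B₃ B₃' a₀ a₁) (fun p i => Real.log (B16ZLower.zNorm (SU 2) (gOfRecord₁₃ F 2 (theta13OfThm1CCMWZB F 2 j γ a₀ ε₀ ε₂₉ B₃ B₃' a₀ a₁ (fun _ _ => 0) (fun _ _ => 0)) p i ^ 2) ε))) P (k + 1)) ^ 2 * wilsonBGOfRecord F 2 (theta13OfThm1CCMWZB F 2 j γ a₀ ε₀ ε₂₉ B₃ B₃' a₀ a₁ (Efl F j γ ε₀ ε₂₉ B₃ B₃' a₀ a₁) (fun p i => Real.log (B16ZLower.zNorm (SU 2) (gOfRecord₁₃ F 2 (theta13OfThm1CCMWZB F 2 j γ a₀ ε₀ ε₂₉ B₃ B₃' a₀ a₁ (fun _ _ => 0) (fun _ _ => 0)) p i ^ 2) ε))).εbg P (k + 1) U)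
                - em (gOfRecord₁₃ F 2 (theta13OfThm1CCMWZB F 2 j γ a₀ ε₀ ε₂₉ B₃ B₃' a₀ a₁ (Efl F j γ ε₀ ε₂₉ B₃ B₃' a₀ a₁) (fun p i => Real.log (B16ZLower.zNorm (SU 2) (gOfRecord₁₃ F 2 (theta13OfThm1CCMWZB F 2 j γ a₀ ε₀ ε₂₉ B₃ B₃' a₀ a₁ (fun _ _ => 0) (fun _ _ => 0)) p i ^ 2) ε))) P (k + 1)) * (Fintype.card (Literature.MathematicalPhysics.QuantumFieldTheory.Balaban1983to89.Site (F.P P.K) (k + 1)) : ℝ)) ≤ densOfRecord₁₃ F 2 (theta13OfThm1CCMWZB F 2 j γ a₀ ε₀ ε₂₉ B₃ B₃' a₀ a₁ (Efl F j γ ε₀ ε₂₉ B₃ B₃' a₀ a₁) (fun p i => Real.log (B16ZLower.zNorm (SU 2) (gOfRecord₁₃ F 2 (theta13OfThm1CCMWZB F 2 j γ a₀ ε₀ ε₂₉ B₃ B₃' a₀ a₁ (fun _ _ => 0) (fun _ _ => 0)) p i ^ 2) ε))) P (k + 1) U ∧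
          densOfRecord₁₃ F 2 (theta13OfThm1CCMWZB F 2 j γ a₀ ε₀ ε₂₉ B₃ B₃' a₀ a₁ (Efl F j γ ε₀ ε₂₉ B₃ B₃' a₀ a₁) (fun p i => Real.log (B16ZLower.zNorm (SU 2) (gOfRecord₁₃ F 2 (theta13OfThm1CCMWZB F 2 j γ a₀ ε₀ ε₂₉ B₃ B₃' a₀ a₁ (fun _ _ => 0) (fun _ _ => 0)) p i ^ 2) ε))) P (k + 1) U ≤ Real.exp (ep (gOfRecord₁₃ F 2 (theta13OfThm1CCMWZB F 2 j γ a₀ ε₀ ε₂₉ B₃ B₃' a₀ a₁ (Efl F j γ ε₀ ε₂₉ B₃ B₃' a₀ a₁) (fun p i => Real.log (B16ZLower.zNorm (SU 2) (gOfRecord₁₃ F 2 (theta13OfThm1CCMWZB F 2 j γ a₀ ε₀ ε₂₉ B₃ B₃' a₀ a₁ (fun _ _ => 0) (fun _ _ => 0)) p i ^ 2) ε))) P (k + 1)) * (Fintype.card (Literature.MathematicalPhysics.QuantumFieldTheory.Balaban1983to89.Site (F.P P.K) (k + 1)) : ℝ))))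
    (hrowsR : ∀ (F : T4Family) {j : ℕ} {γ ε₀ ε₂₉ B₃ B₃' a₀ a₁ : ℝ} (hγ₀ : 0 < γ) (hγh : γ ≤ 1 / 2) (hε : 0 < ε₀) (hε' : 0 < ε₂₉) (hB : 0 ≤ B₃) (hB' : 0 ≤ B₃') (ha₀ : 0 < a₀) (ha₁ : 0 < a₁) (ha₀ρ : a₀ ≤ 1 / (109824 * (F.L : ℝ) ^ 2)) (hε₀ρ : ε₀ = a₀) {bl β' : ℝ} (hbox : BetaLowerH bl γ (betaOfRecord₁₃ F 2 (theta13OfThm1CCMWZB F 2 j γ a₀ ε₀ ε₂₉ B₃ B₃' a₀ a₁ (Efl F j γ ε₀ ε₂₉ B₃ B₃' a₀ a₁) (fun p i => Real.log (B16ZLower.zNorm (SU 2) (gOfRecord₁₃ F 2 (theta13OfThm1CCMWZB F 2 j γ a₀ ε₀ ε₂₉ B₃ B₃' a₀ a₁ (fun _ _ => 0) (fun _ _ => 0)) p i ^ 2) ε))))) (hbox' : BetaUpperH β' γ (betaOfRecord₁₃ F 2 (theta13OfThm1CCMWZB F 2 j γ a₀ ε₀ ε₂₉ B₃ B₃' a₀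 a₁ (Efl F j γ ε₀ ε₂₉ B₃ B₃' a₀ a₁) (fun p i => Real.log (B16ZLower.zNorm (SU 2) (gOfRecord₁₃ F 2 (theta13OfThm1CCMWZB F 2 j γ a₀ ε₀ ε₂₉ B₃ B₃' a₀ a₁ (fun _ _ => 0) (fun _ _ => 0)) p i ^ 2) ε))))) (hl : -bl * γ ^ 2 ≤ 3) (hβ' : β' * γ ^ 2 ≤ 3 / 4),
      ∃ (b : ℕ → ℝ) (r γ₀ M : ℝ), 0 < γ₀ ∧
        (∀ (n : ℕ) (gs : ℕ → ℝ), RGEqH n (betaOfRecord₁₃ F 2 (theta13OfThm1CCMWZB F 2 j γ a₀ ε₀ ε₂₉ B₃ B₃' a₀ a₁ (Efl F j γ ε₀ ε₂₉ B₃ B₃' a₀ a₁) (fun p i => Real.log (B16ZLower.zNorm (SU 2) (gOfRecord₁₃ F 2 (theta13OfThm1CCMWZB F 2 j γ a₀ ε₀ ε₂₉ B₃ B₃' a₀ a₁ (fun _ _ => 0) (fun _ _ => 0)) p i ^ 2) ε)))) gs → Step.InInterval γ₀ n gs → ∀ k, k ≤ n → |betaOfRecord₁₃ F 2 (theta13OfThm1CCMWZB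 F 2 j γ a₀ ε₀ ε₂₉ B₃ B₃' a₀ a₁ (Efl F j γ ε₀ ε₂₉ B₃ B₃' a₀ a₁) (fun p i => Real.log (B16ZLower.zNorm (SU 2) (gOfRecord₁₃ F 2 (theta13OfThm1CCMWZB F 2 j γ a₀ ε₀ ε₂₉ B₃ B₃' a₀ a₁ (fun _ _ => 0) (fun _ _ => 0)) p i ^ 2) ε))) k (prefixOf gs k) - b k| ≤ r) ∧
        (∀ (n : ℕ) (gs : ℕ → ℝ), RGEqH n (betaOfRecord₁₃ F 2 (theta13OfThm1CCMWZB F 2 j γ a₀ ε₀ ε₂₉ B₃ B₃' a₀ a₁ (Efl F j γ ε₀ ε₂₉ B₃ B₃' a₀ a₁) (fun p i => Real.log (B16ZLower.zNorm (SU 2) (gOfRecord₁₃ F 2 (theta13OfThm1CCMWZB F 2 j γ a₀ ε₀ ε₂₉ B₃ B₃' a₀ a₁ (fun _ _ => 0) (fun _ _ => 0)) p i ^ 2) ε)))) gs → Step.InInterval γ₀ n gs → ∀ k, k ≤ n → -M ≤ ∑ j ∈ Finset.Ico k n, betaOfRecord₁₃ F 2 (theta13OfThm1CCMWZB F 2 j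 γ a₀ ε₀ ε₂₉ B₃ B₃' a₀ a₁ (Efl F j γ ε₀ ε₂₉ B₃ B₃' a₀ a₁) (fun p i => Real.log (B16ZLower.zNorm (SU 2) (gOfRecord₁₃ F 2 (theta13OfThm1CCMWZB F 2 j γ a₀ ε₀ ε₂₉ B₃ B₃' a₀ a₁ (fun _ _ => 0) (fun _ _ => 0)) p i ^ 2) ε))) j (prefixOf gs j)) ∧
        ∀ k : ℕ, ContinuousOn (fun x : ℝ => betaOfRecord₁₃ F 2 (theta13OfThm1CCMWZB F 2 j γ a₀ ε₀ ε₂₉ B₃ B₃' a₀ a₁ (Efl F j γ ε₀ ε₂₉ B₃ B₃' a₀ a₁) (fun p i => Real.log (B16ZLower.zNorm (SU 2) (gOfRecord₁₃ F 2 (theta13OfThm1CCMWZB F 2 j γ a₀ ε₀ ε₂₉ B₃ B₃' a₀ a₁ (fun _ _ => 0) (fun _ _ => 0)) p i ^ 2) ε))) k (clampPrefix (betaOfRecord₁₃ F 2 (theta13OfThm1CCMWZB F 2 j γ a₀ ε₀ ε₂₉ B₃ B₃' a₀ a₁ (Efl F j γ ε₀ ε₂₉ B₃ B₃' a₀ a₁)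 (fun p i => Real.log (B16ZLower.zNorm (SU 2) (gOfRecord₁₃ F 2 (theta13OfThm1CCMWZB F 2 j γ a₀ ε₀ ε₂₉ B₃ B₃' a₀ a₁ (fun _ _ => 0) (fun _ _ => 0)) p i ^ 2) ε)))) γ₀ k x))
          {x : ℝ | 0 < x ∧ x ≤ γ₀ ∧ ∀ j', j' ≤ k → 1 / γ₀ ^ 2 ≤ Y (betaOfRecord₁₃ F 2 (theta13OfThm1CCMWZB F 2 j γ a₀ ε₀ ε₂₉ B₃ B₃' a₀ a₁ (Efl F j γ ε₀ ε₂₉ B₃ B₃' a₀ a₁) (fun p i => Real.log (B16ZLower.zNorm (SU 2) (gOfRecord₁₃ F 2 (theta13OfThm1CCMWZB F 2 j γ a₀ ε₀ ε₂₉ B₃ B₃' a₀ a₁ (fun _ _ => 0) (fun _ _ => 0)) p i ^ 2) ε)))) γ₀ j' x}) :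
    Summit.QuantumFields.YangMills.Theses.BalabanUVNodes.StabilityBRunRowsAtRecordR13SepCoPHV := by
  -- NODE N07's leaf from its six remaining printed parts through NODE 00's Sect.-E presentation BY NAME (print's letters `L := F.L`, `η i := (F.P i.K).eta i.k`)
  have h07 : ∀ F : T4Family, ∃ ζ : ResidZ F 2, B11Leaf (Z11OfRecord F 2 ζ) := fun F => by
    obtain ⟨β, iβ, iL, iη, ζ, E, βr, O₁, O₂, e₅, a, hC₄, ha₃, hα, laws, leaves, plaws, hB₀, hB₁, hB₃, hC₁, hB₀B₁, hc₁, hO₁, hO₂, he₅, ha, hbg,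
      p2, p3, p5, p8, sF, p9⟩ := hN07 F
    exact ⟨ζ.withSectE E, b11Leaf_Z11OfRecord_withSectE_of_parts ζ E hC₄ ha₃ hα βr laws leaves plaws hB₀ hB₁ hB₃ hC₁ hB₀B₁ hc₁ hO₁ hO₂ he₅ ha hbg p2 p3 p5 p8 sF p9⟩
  -- NODE N08's slot from its (α)-AC residual through dag-n08-w4's slot theorem BY NAME (`N := 2`, `L := F.L`)
  have h08 : ∀ F : T4Family, PrintedUV3V 2 F.L := fun F => by
    obtain ⟨𝔊, 𝔠, εbg, cm, X, 𝔖, 𝔄, c, hav, hUk, hε, R, hcm, hmass⟩ := hN08 F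
    exact Summit.QuantumFields.YangMills.Theorems.BalabanUVNodesN08AlphaEq324RowACReMassedZSlot.printedUV3V_at_slotOfRecord_of_coreLTAtAC_of_massBoundZAE_of_consts (𝔄 := 𝔄) (c := c) hav hUk hε R hcm hmass
  -- NODE N06's leaf at every door, TYPED AT N06's OBJECT OF RECORD (edition 2), from dag-n06-d's certificate BY NAME at the door witness's Stage-11 view (its Stage-3 dictionary IS `stage3OfFamily F`, `rfl`; its run-indexed weight binder is not read)
  have h06 : ∀ (F : T4Family) {j : ℕ} {γ ε₀ ε₂₉ B₃ B₃' a₀ a₁ : ℝ}, 0 < γ → γ ≤ 1 / 2 → 0 < ε₀ → 0 < ε₂₉ → 0 ≤ B₃ → 0 ≤ B₃' → 0 < a₀ → 0 < a₁ →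
      B9LeafX (Y9OfRecordUPb (J := SCMemberY (stage3OfFamily F).d₆ (stage3OfFamily F).ℓ₆ (stage3OfFamily F).hd' (stage3OfFamily F).hL' (stage3OfFamily F).b₀ (stage3OfFamily F).b₁ (Mstar F)) 2 (stage3OfFamily F) (Mstar F) (opsYNuStOfRecordV4PE 2 (stage3OfFamily F) (Mstar F) (𝔯 F) (sectEStYOfRecordV7 2 (stage3OfFamily F) (Mstar F) (𝔢₀ F)) (𝔴 F) (𝔈 F)) SCMemberY.val (bR F) SCMemberY.ιBsc (C38 F)) := by
    intro F j γ ε₀ ε₂₉ B₃ B₃' a₀ a₁ dγ₀ dγh dε dε' dB dB' da₀ da₁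
    exact @b9LeafXUR_opsYNuOfRecordV6E_pairVQ 2 _ F ((theta13OfThm1CCMWZB F 2 j γ a₀ ε₀ ε₂₉ B₃ B₃' a₀ a₁ (Efl F j γ ε₀ ε₂₉ B₃ B₃' a₀ a₁) (fun p i => Real.log (B16ZLower.zNorm (SU 2) (gOfRecord₁₃ F 2 (theta13OfThm1CCMWZB F 2 j γ a₀ ε₀ ε₂₉ B₃ B₃' a₀ a₁ (fun _ _ => 0) (fun _ _ => 0)) p i ^ 2) ε))).toStage12Params.toStage11 F 2 ⟨0, 0, 0⟩) ((admissible_theta13OfThm1CCMWZB_of_le_half F 2 (Efl F j γ ε₀ ε₂₉ B₃ B₃' a₀ a₁) (fun p i => Real.log (B16ZLower.zNorm (SU 2) (gOfRecord₁₃ F 2 (theta13OfThm1CCMWZB F 2 j γ a₀ ε₀ ε₂₉ B₃ B₃' a₀ a₁ (fun _ _ => 0) (fun _ _ => 0)) p i ^ 2) ε)) (j := j) dγ₀ dγh da₀ dε dε' dB dB' da₀ da₁).toStage12.toStage11 ⟨0, 0, 0⟩) (Mstar F) (𝔯 F) (h𝔯 F) (𝔢₀ F) (𝔴 F) (𝔈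 F) (𝔈₀ F) (R₁ F) (R₂ F) (c F) (hcB F) (hc F) (hGR F) (hRP1 F) (hRP2 F) (hP1 F) (hP2 F) (instN06_1 F) (instN06_2 F) (instN06_3 F) (instN06_4 F) (bI F) (hbI F) (α' F) (r39 F) (δ39 F) (B39 F) (a39 F) (M39 F) (hα'0 F) (hα'1 F) (hr39 F) (hrδ39 F) (hB39 F) (ha39 F) (hM39 F) (h348 F) (ιA F) (AA F) (instN06_5 F) (instN06_6 F) (p F) (q F) (hp F) (hq F) (hα3 F) (p3 F) (q3 F) (hp3 F) (hq3 F) (pM F) (qM F) (hpM F) (hqM F) (H F) (hM₀ F) (hM₀' F) (hM₀B F) (𝔭 F) (h𝔭 F) (bHX F) (hbHX F) (SH F) (S3 F) (SI F) (Bc F) (hBc F) (hM₀N F) (hB₀ge F) (h36b F) (h36H F) (bHXT F) (hbHXT F) (hopI F) (hM1mix F) (ha1mix F) (hBMmix F) (hδmix F) (hM1fac F) (ha1fac F) (hδfac F) (hθfac F) (hcntH F) (hcnt3 F) (hcntI F) (hMw F) (hNMw F) (hM3 F) (hρ3 F) (hNc F) (hN' F) (hCℓ F) (hKc F) (hθ₀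 F) (𝔬A F) (rdA F) (𝔭A F) (h𝔭A F) (𝔡A F) (𝔩A F) (bHXA F) (κA F) (SHA F) (S3A F) (SIA F) (SMA F) (S2A F) (hbHXA F) (hstA F) (hκA F) (hrdA F) (hlocA F) (h36A F) (hGsqA F) (h36HA F) (bHXTA F) (hbHXTA F) (hopIA F) (h36A2 F) (hcntHA F) (hcnt3A F) (hcntIA F) (hcntMA F) (hcnt2A F) (hblkA F) (hblkYA F) (hGcoA F) (hDcoA F) (hDscoA F) (hLcoA F) (h𝔡Ad F) (h𝔡As F) (hGsqAS F) (𝔬12 F) (h𝔬12 F) (h𝔈 F) (bH13 F) (δ12₀ F) (δK12 F) (σ12 F) (ρ12 F) (a12 F) (M12 F) (B12₃ F) (δ12₃ F) (ρ13 F) (α12 F) (ρf12 F) (hρf12 F) (hρf1 F) (hρf2 F) (hB12₃ F) (hσ12 F) (hρ12 F) (hρS12 F) (hρδ12 F) (hρ₃12 F) (ha12 F) (hM12 F) (hα12 F) (hα12' F) (hδ₃₀ F) (hδ12₀ F) (t12 F) (δT12 F) (ρS F) (σS F) (ht12 F) (hσS F) (hρST F) (hρS₀ F) (hδKS F) (hσSK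 F) (bXH F) (w13 F) (wX F) (hw13₀ F) (hw13₁ F) (hwX₀ F) (hwX₁ F) (hbH13 F) (hbXH F) (hρ13 F) (hρ13ρ F) (hσρ13 F) (B13₄ F) (Bx13 F) (hB13₄ F) (hBx13 F) (tJ F) (δB F) (rT F) (ha1J F) (htJ F) (hrTP F) (hrTB F) (hδT12 F) (hδTr F) (ϑF
      F) (hϑF F) (sch F) (hsch0 F) (hsch1 F) (hschβ F) (hwsch F) (δ45 F) (hδ45 F) (BZ F) (hBZ F) (hBZge F) (hδ45le F) (δ₂ F) (hrT4 F) (hrT2 F) (hδ₃T F) (hδ12₃F F) (δ45Y F) (hδ45Y F) (BiY F) (hBiY F) (αW F) (σW F) (δFW F) (hαW0 F) (hαW1 F) (hσW F) (hδFW F) (hδFP F) (hbudW F) (hδ3W F) (hwschX F) (δ45W F) (hδ45W F) (B45W F) (hB45W F) (δhW F) (hδhW F) (BhW F) (hBhW F) (hB45Wge F) (hδ45Wle F) (hBhWge F) (hδhWle F) (CP F) (hCPge F) (hBxW F) (hBiYge F) (hδ45Yle F) (hZ F) (s44 F) (hs440 F) (hs441 F) (hws44 F) (δ44 F) (hδ44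 F) (Bi44 F) (hBi44 F) (hB12₃d F) (hB12₃p F) (hBi44ge F) (hδ44le F) (hwX44 F) (B44G F) (δ44G F) (hB44G F) (hδ44G F) (hB44Gge F) (hδ44Gle F) (hB₃wG F) (BHG F) (hBHG F) (hwBhG F) (B43 F) (δ43 F) (hB43 F) (B₀D F) (hB₀D F) (hbudD F) (hB43ge F) (hδ43le F) (ρrg F) (hρrg0 F) (hbudrg F) (hbud43 F) (hδ₃rg F) (hB₃rg F) (E14₁ F) (E14₂ F) (T14₁ F) (T14₂ F) (X14₁ F) (M14₁ F) (X14₂ F) (M14₂ F) (diam14 F) (r14 F) (hr14 F) (near14₁ F) (first14₁ F) (chain14₁ F) (near14₂ F) (first14₂ F) (chain14₂ F) (h14₁ F) (h14₂ F) (W14₁ F) (W14₂ F) (hW14₁ F) (hW14₂ F) (hcnt14₁ F) (hcnt14₂ F) (hexp14 F) (a₀E F) (δ₁E F) (B₁E F) (ha₀E F) (hδ₁E F) (hB₁E F) (hE F) (τS F) (δP F) (Bx13₀ F) (hτS F) (hBx13₀ F) (hwBx13 F) (hρP12 F) (hU8a F) (hU8b F) (hU8c F) (hU8d F) (hU8e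 F) (hU8f F) (hU8g F) (hU8h F) (hU8i F) (hU8j F) (hU8k F) (τR F) (hτR F) (hR8a F) (hR8b F) (hR8c F) (hR8d F) (hR8e F) (hR8f F) (hR8g F) (hR8h F) (hR8i F) (hR8j F) (hR8k F) (ρG F) (hρG F) (hρGP F) (hρGK F) (κC F) (δC2 F) (hκC F) (hgap F) (hC2 F) (SCMemberY (stage3OfFamily F).d₆ (stage3OfFamily F).ℓ₆ (stage3OfFamily F).hd' (stage3OfFamily F).hL' (stage3OfFamily F).b₀ (stage3OfFamily F).b₁ (Mstar F)) SCMemberY.val (ιR F) (instN06_7 F) (instN06_8 F) (bR F) SCMemberY.ιBsc (C38 F) SCMemberY.hιsc (instN06_9 F)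
  refine N24_stabilityBRunRowsAtRecordR13SepCoPHV_byName_of_registeredStubsGridGZ_of_childrenSplitSlot8DoorPinnedN09Thm3InputsN11OperandRowsThm1AEPos_atGaussPinPrintedZB_pinY_of_runRowsCont
    (fun θ₃ lam8 => ∃ (P : ℕ) (c₁ : ℝ) (ρ₀ : ℕ) (ax : ∀ i : IdxB8SubDPer θ₃ P, (famB8OfRecordPer θ₃ (lam8.cutSubBP₅κPer P M₁ R c₁ ρ₀).β (lam8.cutSubBP₅κPer P M₁ R c₁ ρ₀).len P i).Cfg → (famB8OfRecordPer θ₃ (lam8.cutSubBP₅κPer P M₁ R c₁ ρ₀).β (lam8.cutSubBP₅κPer P M₁ R c₁ ρ₀).len P i).Pert → (famB8OfRecordPer θ₃ (lam8.cutSubBP₅κPer P M₁ R c₁ ρ₀).β (lam8.cutSubBP₅κPer P M₁ R c₁ ρ₀).len P i).Pert), (0 < P ∧ M₁ * θ₃.L ∣ P) ∧ 0 < c₁ ∧ 1 ≤ ρ₀ ∧ B8LeafOfRecordSubBP₂DPerκ θ₃ P M₁ R ⟨lam8.cutSubBP₅κPer P M₁ R c₁ ρ₀, ax⟩)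
    ε hεz Efl h1G3 h3 (fun F {j} {γ} {ε₀} {ε₂₉} {B₃} {B₃'} {a₀} {a₁} hγ₀ hγh hε hε' hB hB' ha₀ ha₁ ha₀ρ hε₀ρ {bl} {β'} hbox hbox' hl hβ' => ?_)
    (fun F {j} {γ} {ε₀} {ε₂₉} {B₃} {B₃'} {a₀} {a₁} hγ₀ hγh hε hε' hB hB' ha₀ ha₁ _ _ {bl} {β'} _ _ _ _ => ⟨_, @h06 F j γ ε₀ ε₂₉ B₃ B₃' a₀ a₁ hγ₀ hγh hε hε' hB hB' ha₀ ha₁⟩) h07 h08 h09 hN09T (fun F {j} {γ} {ε₀} {ε₂₉} {B₃} {B₃'} {a₀} {a₁} _ _ _ _ _ _ _ _ _ _ {bl} {β'} _ _ _ _ => h10 F) h11N hEfl h13pos hrowsR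
  -- the Stage-3 view of the printed-z member IS the family dictionary (`rfl`); ζ-L's door at `stage3OfFamily F`
  haveI : FiniteDimensional ℝ (stage3OfFamily F).𝔸 :=
    -- RE-KEY-NEUTRAL (director-ym №262, FLAG №14 T0 (β)): the by-name lemma of `Node00/Record12NumericsFamilyFiniteDim` (p692370), any `(stage3OfFamily F).𝔸`.
    Literature.MathematicalPhysics.QuantumFieldTheory.Balaban1983to89.Node00.finiteDimensional_𝔸_stage3OfFamily F
  -- print's trace state on the record algebra `(stage3OfFamily F).𝔸 = M₂(ℂ)` BY NAME (NODE 00 `Record12NumericsFamilyTraceState`): `τ := tr`, `C_τ := 2`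
  obtain ⟨τ, Cτ, hτp, hτt, hτs, hCτ⟩ := Literature.MathematicalPhysics.QuantumFieldTheory.Balaban1983to89.Node00.exists_traceState_stage3OfFamily F
  obtain ⟨β, len, B₀'H, B₂', BG, BR, cL, hβ, hlen, hB₀'H, hB₂', hBG, hBR, hcL, hLet, SLetUB⟩ := hN06 F
  -- dag-n06-b's theorem is UNIFORM in the base letters `ops₀` and the block parameter `M`: chosen here (`ops₀ := 0`, `M := 1`), off the display
  let ops₀ : ℝ → ZdIdx (stage3OfFamily F).D (stage3OfFamily F).L → ℕ → OpsZd (stage3OfFamily F).D (stage3OfFamily F).𝔸 :=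
    fun _ _ _ => ⟨fun _ _ _ _ => 0, fun _ _ _ _ => 0, fun _ _ _ _ => 0, fun _ _ _ _ => 0⟩
  haveI : NeZero (M₁ * (stage3OfFamily F).L) := ⟨Nat.pos_iff_ne_zero.mp (Nat.mul_pos hM₁ (by have := F.hL11; show 0 < F.L; omega))⟩
  -- N06's five binders with ONE constant set over all members, from dag-n06-b's η-free ∃∀ theorem (road (i): the η-scaling of the record)
  obtain ⟨aI, haI, aT, haT, B₀, hB₀, Cβ, hCβ, cS, hcS, cSβ, hcSβ, hB⟩ :=
    Literature.MathematicalPhysics.QuantumFieldTheory.Balaban1983to89.B9Thm33BindersUniformZdPerNestedEta.IdxB8SubDPerκ.binders_uniform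
      (P := M₁ * (stage3OfFamily F).L) (Mκ := M₁) (Rκ := R) τ hτp hτt hτs (by show 2 ≤ 4; norm_num) hCτ ops₀ 1 hβ hlen
  -- ζ-L's door with `a_S := a_T`, `C_β ↦ max C_β 1` (dag-n05-d's two glue lines), the Hölder binder weakened by `holderAtIH2Per_anti`
  exact exists_residB8_slot8κ'_of_bindersLettersPer_doorL (stage3OfFamily F) (by show 2 ≤ 4; norm_num) (by have := F.hL11; show 5 ≤ F.L; omega) M₁ R hM₁
    τ hτp hτt hτs hCτ ops₀ le_rfl haI haT haT hB₀ (lt_max_of_lt_right one_pos) hcS hcSβ hB₀'H hB₂' hBG hBR hcL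
    (fun a m hm => (hB a m hm).1) (fun a m hm => (hB a m hm).2.1) (fun a m hm => holderAtIH2Per_anti (ha := le_rfl) (hC := le_max_left Cβ 1) (h := (hB a m hm).2.2.1))
    (fun a m hm => (hB a m hm).2.2.2.1) (fun a m hm => (hB a m hm).2.2.2.2) hLet SLetUB

end Summit.QuantumFields.YangMills.BalabanUVNodes.N24K1FaceTrN06VQSCN07N08N09T5JunctionLSlot8KappaPrimeAtGaussPinPrintedZBY

end
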